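import Literature.Probability.LatticeModels.SquareTilingModulusProofs
import Literature.Probability.Percolation.PlanarDuality
import Literature.Probability.LatticeModels.WeakBeurlingEstimate
import Literature.Probability.RandomPlanarGeometry.JordanDomainInterior
import Literature.Probability.RandomPlanarGeometry.ExteriorULC
import Literature.Topology.PlaneTopology.RectangleDuality
import Mathlib.Algebra.Order.Chebyshev
import HarnessLib

/-!
# Square tilings of lattice domains, III: the discrete conjugate of the potential

Topic: Probability / LatticeModels. Third file of the proof of [GP19] Corollary 4.15
(`SquareTilingModulus.lean`, `SquareTilingModulusProofs.lean`, `SquareTilingModulusLimsup.lean`),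
towards the lower half `lim inf_n R^eff_n ≥ d_Ω(T, B)`: the conjugate function `h'` of the
potential `h_n` on the bounded faces of `Ω_n` (A. Georgakopoulos, C. Panagiotis, *Convergence of
square tilings to the Riemann map*, arXiv:1910.06886 (**[GP19]**), §3.1–3.2 and (CRd) of §4.1),
constructed directly on the squares of `ℤ²` — without abstract planar duals — from the current
`i(x → y) = h(x) - h(y)` and the winding numbers of `PlanarDuality.lean`:

* §D2 the flux of a walk of squares (`SquareTiling.stepFlux`, `walkFlux`) and the **discrete
  divergence theorem** for closed walks of squares, `flux = Σ_u wind(u) · div(u)`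
  (`walkFlux_eq_sum_winding_mul_divAt`, from the jump relations
  `walkWinding_sub_walkWinding_right/up` of `PlanarDuality.lean`);
* §D1 inner squares (`IsInnerSq`: the four sides are edges of `Ω_n`; these are the bounded faces of
  `Ω_n`, [GP19] §3.1), the dual graph (`dualGraph`), the dictionary faces ↔ lattice points
  (`sepEdge_sub_one_right/up`) and corner routes (`walkWinding_eq_of_cornerChain`);
* §D3 squares in the plane (`closedSq`, `floorSq`), king chains shadowing paths
  (`exists_kingChain_of_path`), inner squares lie in the domain (Jordan curve theorem,
  `closedSq_subset_of_isInnerSq`), **walks of inner squares do not wind around vertices of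
  `∂Ω_n`** (`walkWinding_eq_zero_of_mem_boundary`), exterior paths avoiding a small ball about a
  boundary point (`JordanDomain.exists_joinedIn_exterior_diff_closedBall`, Janiszewski), and
  **justified shadows**: walks of squares along a path each step crossing a side at a point of
  the path (`exists_dualWalk_of_path`, a last-exit construction);
* §D4 the current (`cur`), **closed walks of the dual graph carry no flux**
  (`walkFlux_eq_zero_of_closed`), the conjugate `dualPot` and the **discrete Cauchy–Riemann
  identity** (`dualPot_sub_dualPot_of_adj`), harmonicity on the dual lattice
  (`sum_stepFlux_eq_zero_of_isInnerSq`);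
* §D5 exits of the dual component and their virtual values (`exitVal`), short boundary arcs
  (`exists_short_boundary_arc`), and **exits near a boundary point far from `T ∪ B` have equal
  virtual values** (`exitVal_eq_exitVal`: in the planar dual of [GP19] these are the values at
  the outer vertices `l`, `r`);
* §D6 a **local bound** `|h' - c| ≤ 1 + 8 √E` near such boundary points, replacing the global
  `0 ≤ h' ≤ I*_n` of the planar dual: the outer square of an exit meets `∂Ω`
  (`exists_mem_frontier_of_adj_not_isInnerSq`), the discrete maximum principle on index
  rectangles (`abs_le_of_meanValue_rect`), boundary rings of rectangles (`rectRing`,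
  `sum_rectRing_eq`, `abs_dualPot_sub_le_of_ring`), good rows and columns by length–area
  (`sum_cur_sq_le_energy`, `exists_good_row`, `exists_good_col`), `abs_dualPot_sub_le_local`;
* §D7 the **weak Beurling estimate for the conjugate** at the exits
  (`abs_dualPot_sub_le_beurling`, `abs_dualPot_sub_exitVal_le`; the dual, discrete counterpart
  of [GP19], Lemma 4.8, via `weakBeurling_of_cutPath` of `WeakBeurlingEstimate.lean`).

Everything here is proved; no named fact is introduced.

## References

* [GeorgakopoulosPanagiotis2019] A. Georgakopoulos, C. Panagiotis, *Convergence of square tilings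
  to the Riemann map*, arXiv:1910.06886 (2019), §2.3, §3.1–3.2, §4.1 (CRd).
* [Kesten1982] H. Kesten, *Percolation theory for mathematicians*, Birkhäuser 1982, §2.2
  (winding numbers of lattice walks; the tree's `PlanarDuality.lean`).
* [Newman1939] M. H. A. Newman, *Elements of the topology of plane sets of points*, CUP 1939,
  Ch. V §9 (Janiszewski's theorem; the tree's `Janiszewski.lean`).
* [Smirnov2010] S. Smirnov, *Conformal invariance in random cluster models. I*, Ann. of Math. 172
  (2010), Appendix B, Lemma B.2 (weak Beurling; the tree's `WeakBeurlingEstimate.lean`).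
-/

noncomputable section

namespace Literature.Probability.LatticeModels

open _root_.Filter _root_.Set _root_.Metric SimpleGraph
open scoped ENNReal NNReal _root_.Topology
open Literature.Probability.Percolation

namespace SquareTiling

/-! ### §D2. Flux of dual lattice walks and the discrete divergence theorem -/

section DualFlux

variable {a b : Site 2}

/-- The flux contribution of a step `x → y` of a walk of unit SQUARES of `ℤ²` (a square is
indexed by its lower-left corner): the signed current of the primal edge it crosses, from the
left of the step to its right. Here `jh u` is the current along the horizontal primal edge from
`u + (1,1)` to `u + (1,1) + e₀` and `jv u` the current along the vertical primal edge from
`u + (1,1)` to `u + (1,1) + e₁` (the index shift matches `Percolation.walkWinding`, which winds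
around `u + (½,½)` in index space, i.e. around the lattice point `u + (1,1)`). [folklore] -/
def stepFlux (jh jv : Site 2 → ℝ) (x y : Site 2) : ℝ :=
  if y 1 = x 1 + 1 ∧ y 0 = x 0 then jh (x - Pi.single 0 1)
  else if x 1 = y 1 + 1 ∧ y 0 = x 0 then -jh (y - Pi.single 0 1)
  else if y 0 = x 0 + 1 ∧ y 1 = x 1 then -jv (x - Pi.single 1 1)
  else if x 0 = y 0 + 1 ∧ y 1 = x 1 then jv (y - Pi.single 1 1)
  else 0

/-- The flux through a walk of squares: the sum of the step fluxes. [folklore] -/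
def walkFlux (jh jv : Site 2 → ℝ) {G : SimpleGraph (Site 2)} {a b : Site 2} (Λ : G.Walk a b) : ℝ :=
  (Λ.darts.map fun d => stepFlux jh jv d.fst d.snd).sum

/-- Flux of the trivial walk. [folklore] -/
@[simp] theorem walkFlux_nil (jh jv : Site 2 → ℝ) {G : SimpleGraph (Site 2)} (a : Site 2) :
    walkFlux jh jv (Walk.nil : G.Walk a a) = 0 := rfl

/-- Flux of a walk with a first step. [folklore] -/
@[simp] theorem walkFlux_cons (jh jv : Site 2 → ℝ) {G : SimpleGraph (Site 2)} {a b c : Site 2}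
    (h : G.Adj a b) (Λ : G.Walk b c) :
    walkFlux jh jv (Walk.cons h Λ) = stepFlux jh jv a b + walkFlux jh jv Λ := by
  simp [walkFlux]

/-- Flux is additive under concatenation. [folklore] -/
@[simp] theorem walkFlux_append (jh jv : Site 2 → ℝ) {G : SimpleGraph (Site 2)} {a b c : Site 2}
    (Λ : G.Walk a b) (Λ' : G.Walk b c) :
    walkFlux jh jv (Λ.append Λ') = walkFlux jh jv Λ + walkFlux jh jv Λ' := by
  simp [walkFlux, Walk.darts_append]

/-- Antisymmetry of the step flux. [folklore] -/
theorem stepFlux_antisymm (jh jv : Site 2 → ℝ) {x y : Site 2} (hxy : StepKind x y) :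
    stepFlux jh jv y x = -stepFlux jh jv x y := by
  unfold stepFlux
  rcases hxy with ⟨h0, h1⟩ | ⟨h0, h1⟩ | ⟨h1, h0⟩ | ⟨h1, h0⟩ <;> split_ifs <;> first | omega | simp

/-- Reversal negates the flux. [folklore] -/
@[simp] theorem walkFlux_reverse (jh jv : Site 2 → ℝ) {a b : Site 2} (Λ : (zdGraph 2).Walk a b) :
    walkFlux jh jv Λ.reverse = -walkFlux jh jv Λ := by
  induction Λ with
  | nil => simp
  | cons h p ih =>
    simp only [Walk.reverse_cons, walkFlux_append, ih, walkFlux_cons, walkFlux_nil, add_zero]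
    rw [stepFlux_antisymm jh jv (stepKind_of_adj h)]
    ring

/-- Mapping a walk along an inclusion of graphs does not change its flux. [folklore] -/
theorem walkFlux_map_le (jh jv : Site 2 → ℝ) {G G' : SimpleGraph (Site 2)} (hGG' : G ≤ G')
    {a b : Site 2} (Λ : G.Walk a b) :
    walkFlux jh jv (Λ.map (Hom.ofLE hGG')) = walkFlux jh jv Λ := by
  induction Λ with
  | nil => rfl
  | cons h p ih =>
    rw [Walk.map_cons, walkFlux_cons, walkFlux_cons, ih]
    rfl

/-- The step flux as a sum against the traversal indicators `vCross`, `hCross` of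
`PlanarDuality.lean`. [folklore] -/
theorem stepFlux_eq_sum {jh jv : Site 2 → ℝ} {S : Finset (Site 2)}
    (hS : ∀ u ∉ S, jh u = 0 ∧ jv u = 0) {x y : Site 2} (hxy : StepKind x y) :
    stepFlux jh jv x y = ∑ u ∈ S, ((vCross u x y : ℝ) * jh u - (hCross u x y : ℝ) * jv u) := by
  -- in each of the four cases exactly one `u` can contribute
  have key : ∀ (u₀ : Site 2) (c : ℝ) (F : Site 2 → ℝ), (∀ u, u ≠ u₀ → F u = 0) → F u₀ = c →
      (u₀ ∉ S → c = 0) → c = ∑ u ∈ S, F u := by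
    intro u₀ c F hF hc h0
    by_cases hu : u₀ ∈ S
    · rw [Finset.sum_eq_single u₀ (fun u _ hne => hF u hne) (fun h => (h hu).elim), hc]
    · rw [Finset.sum_eq_zero fun u hu' => hF u (by rintro rfl; exact hu hu'), h0 hu]
  rcases hxy with ⟨h0, h1⟩ | ⟨h0, h1⟩ | ⟨h1, h0⟩ | ⟨h1, h0⟩
  · -- right step: crosses the vertical edge indexed by `x - e₁`
    have hval : stepFlux jh jv x y = -jv (x - Pi.single 1 1) := by
      unfold stepFlux; split_ifs <;> first | omega | rfl
    rw [hval]
    refine key (x - Pi.single 1 1) _ _ (fun u hu => ?_) ?_ (fun hu => by simp [(hS _ hu).2])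
    · have hv : vCross u x y = 0 := by unfold vCross; split_ifs <;> omega
      have hh : hCross u x y = 0 := by
        unfold hCross
        have : ¬ (x 0 = u 0 ∧ x 1 = u 1 + 1 ∧ y 0 = u 0 + 1 ∧ y 1 = u 1 + 1) := by
          rintro ⟨e0, e1, -, -⟩
          exact hu (by ext i; fin_cases i <;> simp <;> omega)
        split_ifs <;> omega
      simp [hv, hh]
    · have c0 : (x - Pi.single 1 1 : Site 2) 0 = x 0 := by simp
      have c1 : (x - Pi.single 1 1 : Site 2) 1 = x 1 - 1 := by simp
      have hv : vCross (x - Pi.single 1 1) x y = 0 := by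
        unfold vCross; rw [c0, c1]; split_ifs <;> omega
      have hh : hCross (x - Pi.single 1 1) x y = 1 := by
        unfold hCross; rw [c0, c1]; split_ifs <;> omega
      simp [hv, hh]
  · -- left step
    have hval : stepFlux jh jv x y = jv (y - Pi.single 1 1) := by
      unfold stepFlux; split_ifs <;> first | omega | rfl
    rw [hval]
    refine key (y - Pi.single 1 1) _ _ (fun u hu => ?_) ?_ (fun hu => by simp [(hS _ hu).2])
    · have hv : vCross u x y = 0 := by unfold vCross; split_ifs <;> omega
      have hh : hCross u x y = 0 := by
        unfold hCross
        have : ¬ (y 0 = u 0 ∧ y 1 = u 1 + 1 ∧ x 0 = u 0 + 1 ∧ x 1 = u 1 + 1) := by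
          rintro ⟨e0, e1, -, -⟩
          exact hu (by ext i; fin_cases i <;> simp <;> omega)
        split_ifs <;> omega
      simp [hv, hh]
    · have c0 : (y - Pi.single 1 1 : Site 2) 0 = y 0 := by simp
      have c1 : (y - Pi.single 1 1 : Site 2) 1 = y 1 - 1 := by simp
      have hv : vCross (y - Pi.single 1 1) x y = 0 := by
        unfold vCross; rw [c0, c1]; split_ifs <;> omega
      have hh : hCross (y - Pi.single 1 1) x y = -1 := by
        unfold hCross; rw [c0, c1]; split_ifs <;> omega
      simp [hv, hh]
  · -- up step: crosses the horizontal edge indexed by `x - e₀`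
    have hval : stepFlux jh jv x y = jh (x - Pi.single 0 1) := by
      unfold stepFlux; split_ifs <;> first | omega | rfl
    rw [hval]
    refine key (x - Pi.single 0 1) _ _ (fun u hu => ?_) ?_ (fun hu => by simp [(hS _ hu).1])
    · have hh : hCross u x y = 0 := by unfold hCross; split_ifs <;> omega
      have hv : vCross u x y = 0 := by
        unfold vCross
        have : ¬ (x 0 = u 0 + 1 ∧ x 1 = u 1 ∧ y 0 = u 0 + 1 ∧ y 1 = u 1 + 1) := by
          rintro ⟨e0, e1, -, -⟩
          exact hu (by ext i; fin_cases i <;> simp <;> omega)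
        split_ifs <;> omega
      simp [hv, hh]
    · have c0 : (x - Pi.single 0 1 : Site 2) 0 = x 0 - 1 := by simp
      have c1 : (x - Pi.single 0 1 : Site 2) 1 = x 1 := by simp
      have hh : hCross (x - Pi.single 0 1) x y = 0 := by
        unfold hCross; rw [c0, c1]; split_ifs <;> omega
      have hv : vCross (x - Pi.single 0 1) x y = 1 := by
        unfold vCross; rw [c0, c1]; split_ifs <;> omega
      simp [hv, hh]
  · -- down step
    have hval : stepFlux jh jv x y = -jh (y - Pi.single 0 1) := by
      unfold stepFlux; split_ifs <;> first | omega | rfl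
    rw [hval]
    refine key (y - Pi.single 0 1) _ _ (fun u hu => ?_) ?_ (fun hu => by simp [(hS _ hu).1])
    · have hh : hCross u x y = 0 := by unfold hCross; split_ifs <;> omega
      have hv : vCross u x y = 0 := by
        unfold vCross
        have : ¬ (y 0 = u 0 + 1 ∧ y 1 = u 1 ∧ x 0 = u 0 + 1 ∧ x 1 = u 1 + 1) := by
          rintro ⟨e0, e1, -, -⟩
          exact hu (by ext i; fin_cases i <;> simp <;> omega)
        split_ifs <;> omega
      simp [hv, hh]
    · have c0 : (y - Pi.single 0 1 : Site 2) 0 = y 0 - 1 := by simp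
      have c1 : (y - Pi.single 0 1 : Site 2) 1 = y 1 := by simp
      have hh : hCross (y - Pi.single 0 1) x y = 0 := by
        unfold hCross; rw [c0, c1]; split_ifs <;> omega
      have hv : vCross (y - Pi.single 0 1) x y = -1 := by
        unfold vCross; rw [c0, c1]; split_ifs <;> omega
      simp [hv, hh]

/-- The flux of a walk of squares as a sum against the traversal counts of the crossed primal
edges. [folklore] -/
theorem walkFlux_eq_sum_cross {jh jv : Site 2 → ℝ} {S : Finset (Site 2)}
    (hS : ∀ u ∉ S, jh u = 0 ∧ jv u = 0) (Λ : (zdGraph 2).Walk a b) :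
    walkFlux jh jv Λ = ∑ u ∈ S, (((Λ.darts.map fun d => vCross u d.fst d.snd).sum : ℝ) * jh u -
      ((Λ.darts.map fun d => hCross u d.fst d.snd).sum : ℝ) * jv u) := by
  induction Λ with
  | nil => simp
  | cons h p ih =>
    rw [walkFlux_cons, ih, stepFlux_eq_sum hS (stepKind_of_adj h), ← Finset.sum_add_distrib]
    refine Finset.sum_congr rfl fun u _ => ?_
    simp only [Walk.darts_cons, List.map_cons, List.sum_cons, Int.cast_add]
    ring

/-- **Discrete divergence theorem for closed walks of squares** (edge form): the flux through a
closed walk of squares is the sum, over the primal edges, of the current times the jump of the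
winding number across the edge. [folklore] -/
theorem walkFlux_eq_sum_winding_sub {jh jv : Site 2 → ℝ} {S : Finset (Site 2)}
    (hS : ∀ u ∉ S, jh u = 0 ∧ jv u = 0) (Λ : (zdGraph 2).Walk a a) :
    walkFlux jh jv Λ = ∑ u ∈ S, (((walkWinding Λ u - walkWinding Λ (u + Pi.single 0 1) : ℤ) : ℝ) * jh u +
      ((walkWinding Λ u - walkWinding Λ (u + Pi.single 1 1) : ℤ) : ℝ) * jv u) := by
  rw [walkFlux_eq_sum_cross hS Λ]
  refine Finset.sum_congr rfl fun u _ => ?_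
  rw [walkWinding_sub_walkWinding_right Λ u, walkWinding_sub_walkWinding_up Λ u]
  simp only [sub_self, neg_zero, zero_sub, Int.cast_neg]
  ring

/-- The divergence at the lattice point `u + (1,1)` of the currents `jh`, `jv` (outflow minus
inflow over its four primal edges). [folklore] -/
def divAt (jh jv : Site 2 → ℝ) (u : Site 2) : ℝ :=
  jh u + jv u - jh (u - Pi.single 0 1) - jv (u - Pi.single 1 1)

/-- **Discrete divergence theorem for closed walks of squares**: the flux through a closed walk
of squares equals `Σ_u wind(u) · div(u)`, the winding numbers weighting the divergences of the
current at the lattice points. `S` is any finite set off which the currents vanish together with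
their translates by `-e₀`, `-e₁`. [folklore] -/
theorem walkFlux_eq_sum_winding_mul_divAt {jh jv : Site 2 → ℝ} {S : Finset (Site 2)}
    (hS : ∀ u ∉ S, jh u = 0 ∧ jv u = 0)
    (hS' : ∀ u ∉ S, jh (u - Pi.single 0 1) = 0 ∧ jv (u - Pi.single 1 1) = 0)
    (Λ : (zdGraph 2).Walk a a) :
    walkFlux jh jv Λ = ∑ u ∈ S, (walkWinding Λ u : ℝ) * divAt jh jv u := by
  rw [walkFlux_eq_sum_winding_sub hS Λ]
  -- reindex a shifted sum `Σ_{u ∈ S} W(u + e) g(u) = Σ_{u ∈ S} W(u) g(u - e)`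
  have shift : ∀ (e : Site 2) (g : Site 2 → ℝ), (∀ u ∉ S, g u = 0) → (∀ u ∉ S, g (u - e) = 0) →
      ∑ u ∈ S, (walkWinding Λ (u + e) : ℝ) * g u = ∑ u ∈ S, (walkWinding Λ u : ℝ) * g (u - e) := by
    intro e g hg hg'
    have h1 : ∑ u ∈ S, (walkWinding Λ (u + e) : ℝ) * g u =
        ∑ v ∈ S.map (addRightEmbedding e), (walkWinding Λ v : ℝ) * g (v - e) := by
      rw [Finset.sum_map]
      simp
    rw [h1]
    have hA : ∑ v ∈ S.map (addRightEmbedding e), (walkWinding Λ v : ℝ) * g (v - e) =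
        ∑ v ∈ S ∪ S.map (addRightEmbedding e), (walkWinding Λ v : ℝ) * g (v - e) := by
      refine Finset.sum_subset Finset.subset_union_right fun v _ hv => ?_
      have : v - e ∉ S := fun h => hv (Finset.mem_map.2 ⟨v - e, h, by simp⟩)
      simp [hg _ this]
    have hB : ∑ v ∈ S, (walkWinding Λ v : ℝ) * g (v - e) =
        ∑ v ∈ S ∪ S.map (addRightEmbedding e), (walkWinding Λ v : ℝ) * g (v - e) := by
      refine Finset.sum_subset Finset.subset_union_left fun v _ hv => ?_
      simp [hg' _ hv]
    rw [hA, hB]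
  have eH := shift (Pi.single 0 1) jh (fun u hu => (hS u hu).1) (fun u hu => (hS' u hu).1)
  have eV := shift (Pi.single 1 1) jv (fun u hu => (hS u hu).2) (fun u hu => (hS' u hu).2)
  have lhs : ∑ u ∈ S, ((((walkWinding Λ u - walkWinding Λ (u + Pi.single 0 1) : ℤ)) : ℝ) * jh u +
      (((walkWinding Λ u - walkWinding Λ (u + Pi.single 1 1) : ℤ)) : ℝ) * jv u) =
      (∑ u ∈ S, (walkWinding Λ u : ℝ) * jh u - ∑ u ∈ S, (walkWinding Λ (u + Pi.single 0 1) : ℝ) * jh u) +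
      (∑ u ∈ S, (walkWinding Λ u : ℝ) * jv u - ∑ u ∈ S, (walkWinding Λ (u + Pi.single 1 1) : ℝ) * jv u) := by
    simp only [Int.cast_sub, ← Finset.sum_sub_distrib, ← Finset.sum_add_distrib]
    refine Finset.sum_congr rfl fun u _ => by ring
  rw [lhs, eH, eV, ← Finset.sum_sub_distrib, ← Finset.sum_sub_distrib, ← Finset.sum_add_distrib]
  refine Finset.sum_congr rfl fun u _ => ?_
  simp only [divAt]
  ring

/-- In particular: if the winding number of the closed walk of squares vanishes at every lattice
point of non-zero divergence, the flux through it is zero. [folklore] -/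
theorem walkFlux_eq_zero_of_winding {jh jv : Site 2 → ℝ} {S : Finset (Site 2)}
    (hS : ∀ u ∉ S, jh u = 0 ∧ jv u = 0)
    (hS' : ∀ u ∉ S, jh (u - Pi.single 0 1) = 0 ∧ jv (u - Pi.single 1 1) = 0)
    (Λ : (zdGraph 2).Walk a a) (h0 : ∀ u ∈ S, divAt jh jv u ≠ 0 → walkWinding Λ u = 0) :
    walkFlux jh jv Λ = 0 := by
  rw [walkFlux_eq_sum_winding_mul_divAt hS hS' Λ]
  refine Finset.sum_eq_zero fun u hu => ?_
  by_cases hd : divAt jh jv u = 0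
  · simp [hd]
  · simp [h0 u hu hd]

end DualFlux

/-! ### §D1. Inner squares, the dual graph, and winding numbers of walks of squares -/

section InnerSquares

variable {Ω : Set ℂ} {δ : ℝ}

/-- The unit square of `ℤ²` with lower-left corner `p` is an **inner square** of `Ω_n` at mesh
`δ` when its four sides are edges of the graph `Ω_n = domainGraph Ω δ` ([GP19], §3.1: the
bounded faces of the plane graph `Ω_n` are exactly these squares). [cite: GeorgakopoulosPanagiotis2019, §3.1] -/
def IsInnerSq (Ω : Set ℂ) (δ : ℝ) (p : Site 2) : Prop :=
  (domainGraph Ω δ).Adj p (p + Pi.single 0 1) ∧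
  (domainGraph Ω δ).Adj (p + Pi.single 1 1) (p + Pi.single 1 1 + Pi.single 0 1) ∧
  (domainGraph Ω δ).Adj p (p + Pi.single 1 1) ∧
  (domainGraph Ω δ).Adj (p + Pi.single 0 1) (p + Pi.single 0 1 + Pi.single 1 1)

/-- The **dual graph** of `Ω_n`: two lattice-adjacent inner squares are joined (across their
common side, which is an edge of `Ω_n`). [cite: GeorgakopoulosPanagiotis2019, §3.1] -/
def dualGraph (Ω : Set ℂ) (δ : ℝ) : SimpleGraph (Site 2) :=
  SimpleGraph.fromRel fun p p' => (zdGraph 2).Adj p p' ∧ IsInnerSq Ω δ p ∧ IsInnerSq Ω δ p'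

/-- Adjacency in the dual graph. [folklore] -/
theorem dualGraph_adj_iff {p p' : Site 2} :
    (dualGraph Ω δ).Adj p p' ↔ (zdGraph 2).Adj p p' ∧ IsInnerSq Ω δ p ∧ IsInnerSq Ω δ p' := by
  simp only [dualGraph, SimpleGraph.fromRel_adj, ne_eq]
  constructor
  · rintro ⟨-, ⟨h, h1, h2⟩ | ⟨h, h1, h2⟩⟩
    · exact ⟨h, h1, h2⟩
    · exact ⟨h.symm, h2, h1⟩
  · rintro ⟨h, h1, h2⟩
    exact ⟨h.ne, Or.inl ⟨h, h1, h2⟩⟩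

/-- The dual graph is a subgraph of the lattice `ℤ²` (on square indices). [folklore] -/
theorem dualGraph_le_zdGraph : dualGraph Ω δ ≤ zdGraph 2 := fun _ _ h => (dualGraph_adj_iff.1 h).1

/-- Vertices on a non-trivial walk of the dual graph are inner squares. [folklore] -/
theorem isInnerSq_of_mem_support {a b : Site 2} (Λ : (dualGraph Ω δ).Walk a b) (hab : a ≠ b ∨ 0 < Λ.length)
    {q : Site 2} (hq : q ∈ Λ.support) : IsInnerSq Ω δ q := by
  induction Λ with
  | nil => rcases hab with h | h <;> simp at h
  | cons h p ih =>
    rename_i x y z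
    rw [Walk.support_cons, List.mem_cons] at hq
    rcases hq with rfl | hq
    · exact (dualGraph_adj_iff.1 h).2.1
    · cases p with
      | nil => simp only [Walk.support_nil, List.mem_singleton] at hq; subst hq
               exact (dualGraph_adj_iff.1 h).2.2
      | cons h' p' => exact ih (Or.inr (by simp)) hq

/-- The two squares having the horizontal lattice edge `{x, x + e₀}` as a side are `x - e₁`
(below) and `x` (above); if that edge is not an edge of `Ω_n`, neither square is inner. [folklore] -/
theorem not_isInnerSq_of_not_adj_right {x : Site 2} (h : ¬ (domainGraph Ω δ).Adj x (x + Pi.single 0 1)) :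
    ¬ IsInnerSq Ω δ x ∧ ¬ IsInnerSq Ω δ (x - Pi.single 1 1) := by
  refine ⟨fun hI => h hI.1, fun hI => h ?_⟩
  have := hI.2.1
  simpa using this

/-- Vertical version: the squares `x - e₀` (left) and `x` (right) of the edge `{x, x + e₁}`. [folklore] -/
theorem not_isInnerSq_of_not_adj_up {x : Site 2} (h : ¬ (domainGraph Ω δ).Adj x (x + Pi.single 1 1)) :
    ¬ IsInnerSq Ω δ x ∧ ¬ IsInnerSq Ω δ (x - Pi.single 0 1) := by
  refine ⟨fun hI => h hI.2.2.1, fun hI => h ?_⟩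
  have := hI.2.2.2
  simpa using this

end InnerSquares

section DualWinding

variable {a : Site 2}

/-- For a CLOSED lattice walk, the winding numbers at the faces `u` and `u + e₁` agree when the
walk does not traverse the edge between them (no boundary term). [folklore] -/
theorem walkWinding_closed_eq_up {Λ : (zdGraph 2).Walk a a} {u : Site 2}
    (h : s(u + Pi.single 1 1, u + Pi.single 1 1 + Pi.single 0 1) ∉ Λ.edges) :
    walkWinding Λ u = walkWinding Λ (u + Pi.single 1 1) := by
  have hsum : (Λ.darts.map fun d => hCross u d.fst d.snd).sum = 0 := by
    refine List.sum_eq_zero fun t ht => ?_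
    obtain ⟨d, hd, rfl⟩ := List.mem_map.1 ht
    refine hCross_eq_zero_of_ne fun heq => h ?_
    rw [← heq]
    exact List.mem_map.2 ⟨d, hd, rfl⟩
  have key := walkWinding_sub_walkWinding_up Λ u
  rw [hsum] at key
  simp only [sub_self, neg_zero] at key
  linarith

/-- Dictionary between faces of a walk of squares and lattice points: the winding number of a
walk `Λ` of squares (indexed by lower-left corners) at the face `x - 1` is its winding number
about the lattice point `x`; the edge separating the faces `x - 1` and `x - 1 + e₀` is the pair of
squares `{x - e₁, x}` below and above the primal edge `{x, x + e₀}`. [folklore] -/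
theorem sepEdge_sub_one_right (x : Site 2) :
    sepEdge (x - 1) (x - 1 + Pi.single 0 1) = s(x - Pi.single 1 1, x) := by
  rw [sepEdge_right]
  congr 1 <;> ext i <;> fin_cases i <;> simp

/-- Vertical version of the dictionary: the faces `x - 1`, `x - 1 + e₁` are separated by the pair
of squares `{x - e₀, x}` left and right of the primal edge `{x, x + e₁}`. [folklore] -/
theorem sepEdge_sub_one_up (x : Site 2) :
    sepEdge (x - 1) (x - 1 + Pi.single 1 1) = s(x - Pi.single 0 1, x) := by
  rw [sepEdge_up]
  congr 1 <;> ext i <;> fin_cases i <;> simp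

/-- If the walk of squares `Λ` visits neither of the two squares adjacent to the primal edge
`{x, y}`, its winding numbers about `x` and `y` agree. [folklore] -/
theorem walkWinding_sub_one_eq_of_adj (Λ : (zdGraph 2).Walk a a) {x y : Site 2} (hxy : (zdGraph 2).Adj x y)
    (h : ∀ q ∈ Λ.support, ¬ (x ∈ ({q, q + Pi.single 0 1, q + Pi.single 1 1, q + Pi.single 0 1 + Pi.single 1 1} : Set (Site 2)) ∧
      y ∈ ({q, q + Pi.single 0 1, q + Pi.single 1 1, q + Pi.single 0 1 + Pi.single 1 1} : Set (Site 2)))) :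
    walkWinding Λ (x - 1) = walkWinding Λ (y - 1) := by
  -- an edge of `Λ` between the two squares adjacent to `{x, y}` would put `x`, `y` among the
  -- corners of a visited square
  have notEdge : ∀ {q q' : Site 2}, (x ∈ ({q, q + Pi.single 0 1, q + Pi.single 1 1, q + Pi.single 0 1 + Pi.single 1 1} : Set (Site 2)) ∧
      y ∈ ({q, q + Pi.single 0 1, q + Pi.single 1 1, q + Pi.single 0 1 + Pi.single 1 1} : Set (Site 2))) →
      s(q, q') ∉ Λ.edges := fun hq he => h _ (Walk.fst_mem_support_of_mem_edges Λ he) hq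
  rcases stepKind_of_adj hxy with ⟨h0, h1⟩ | ⟨h0, h1⟩ | ⟨h1, h0⟩ | ⟨h1, h0⟩
  · have hyeq : y = x + Pi.single 0 1 := by simp [Site.eq_iff_two, h0, h1]
    have e : y - 1 = x - 1 + Pi.single 0 1 := by rw [hyeq]; abel
    rw [e]
    refine walkWinding_eq_walkWinding_right ?_
    rw [← sepEdge_right, sepEdge_sub_one_right]
    refine notEdge ⟨?_, ?_⟩
    · simp
    · have : y = x - Pi.single 1 1 + Pi.single 0 1 + Pi.single 1 1 := by rw [hyeq]; abel
      rw [this]; simp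
  · have hxeq : x = y + Pi.single 0 1 := by simp [Site.eq_iff_two, h0, h1]
    have e : x - 1 = y - 1 + Pi.single 0 1 := by rw [hxeq]; abel
    rw [e]
    refine (walkWinding_eq_walkWinding_right ?_).symm
    rw [← sepEdge_right, sepEdge_sub_one_right]
    refine notEdge ⟨?_, ?_⟩
    · have : x = y - Pi.single 1 1 + Pi.single 0 1 + Pi.single 1 1 := by rw [hxeq]; abel
      rw [this]; simp
    · simp
  · have hyeq : y = x + Pi.single 1 1 := by simp [Site.eq_iff_two, h0, h1]
    have e : y - 1 = x - 1 + Pi.single 1 1 := by rw [hyeq]; abel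
    rw [e]
    refine walkWinding_closed_eq_up ?_
    rw [← sepEdge_up, sepEdge_sub_one_up]
    refine notEdge ⟨?_, ?_⟩
    · simp
    · rw [hyeq]; simp
  · have hxeq : x = y + Pi.single 1 1 := by simp [Site.eq_iff_two, h0, h1]
    have e : x - 1 = y - 1 + Pi.single 1 1 := by rw [hxeq]; abel
    rw [e]
    refine (walkWinding_closed_eq_up ?_).symm
    rw [← sepEdge_up, sepEdge_sub_one_up]
    refine notEdge ⟨?_, ?_⟩
    · rw [hxeq]; simp
    · simp

end DualWinding

section CornerRoutes

variable {a : Site 2}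

/-- The four corners of the unit square with lower-left corner `q`. [folklore] -/
def corners (q : Site 2) : Set (Site 2) :=
  {q, q + Pi.single 0 1, q + Pi.single 1 1, q + Pi.single 0 1 + Pi.single 1 1}

/-- Corners in coordinates. [folklore] -/
theorem mem_corners_iff {q c : Site 2} :
    c ∈ corners q ↔ (c 0 = q 0 ∨ c 0 = q 0 + 1) ∧ (c 1 = q 1 ∨ c 1 = q 1 + 1) := by
  simp only [corners, Set.mem_insert_iff, Set.mem_singleton_iff, Site.eq_iff_two, Pi.add_apply,
    Pi.single_apply]
  simp
  omega

/-- The supremum of two squares at sup-distance `≤ 1` is a common corner. [folklore] -/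
theorem sup_mem_corners {q q' : Site 2} (h0 : |q 0 - q' 0| ≤ 1) (h1 : |q 1 - q' 1| ≤ 1) :
    q ⊔ q' ∈ corners q ∧ q ⊔ q' ∈ corners q' := by
  rw [abs_le] at h0 h1
  simp only [mem_corners_iff, Pi.sup_apply]
  omega

/-- A closed walk of squares avoiding the square `q` winds equally about the four corners of
`q` (one can walk around `q` along its sides, none of which is crossed). [folklore] -/
theorem walkWinding_eq_of_mem_corners (Λ : (zdGraph 2).Walk a a) {q : Site 2} (hq : q ∉ Λ.support)
    {c : Site 2} (hc : c ∈ corners q) : walkWinding Λ (c - 1) = walkWinding Λ (q - 1) := by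
  have notEdge : ∀ q' : Site 2, s(q, q') ∉ Λ.edges ∧ s(q', q) ∉ Λ.edges := fun q' =>
    ⟨fun he => hq (Walk.fst_mem_support_of_mem_edges Λ he),
      fun he => hq (Walk.snd_mem_support_of_mem_edges Λ he)⟩
  -- bottom side `{q, q + e₀}`: squares `q - e₁`, `q`
  have h1 : walkWinding Λ (q - 1) = walkWinding Λ (q + Pi.single 0 1 - 1) := by
    have e : q + Pi.single 0 1 - 1 = q - 1 + Pi.single 0 1 := by abel
    rw [e]
    refine walkWinding_eq_walkWinding_right ?_
    rw [← sepEdge_right, sepEdge_sub_one_right]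
    exact (notEdge _).2
  -- left side `{q, q + e₁}`: squares `q - e₀`, `q`
  have h2 : walkWinding Λ (q - 1) = walkWinding Λ (q + Pi.single 1 1 - 1) := by
    have e : q + Pi.single 1 1 - 1 = q - 1 + Pi.single 1 1 := by abel
    rw [e]
    refine walkWinding_closed_eq_up ?_
    rw [← sepEdge_up, sepEdge_sub_one_up]
    exact (notEdge _).2
  -- right side `{q + e₀, q + e₀ + e₁}`: squares `q`, `q + e₀`
  have h3 : walkWinding Λ (q + Pi.single 0 1 - 1) = walkWinding Λ (q + Pi.single 0 1 + Pi.single 1 1 - 1) := by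
    have e : q + Pi.single 0 1 + Pi.single 1 1 - 1 = q + Pi.single 0 1 - 1 + Pi.single 1 1 := by abel
    rw [e]
    refine walkWinding_closed_eq_up ?_
    rw [← sepEdge_up, sepEdge_sub_one_up]
    have e' : q + Pi.single 0 1 - Pi.single 0 1 = q := by abel
    rw [e']
    exact (notEdge _).1
  rcases (show c = q ∨ c = q + Pi.single 0 1 ∨ c = q + Pi.single 1 1 ∨ c = q + Pi.single 0 1 + Pi.single 1 1 by
    simpa [corners] using hc) with rfl | rfl | rfl | rfl
  · rfl
  · exact h1.symm
  · exact h2.symm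
  · exact h3.symm.trans h1.symm

/-- **Corner routes.** Along a chain of squares avoided by the closed walk of squares `Λ`, any
two consecutive ones sharing a corner, the winding number of `Λ` about the corners is constant. [folklore] -/
theorem walkWinding_eq_of_cornerChain (Λ : (zdGraph 2).Walk a a) :
    ∀ (l : List (Site 2)) (q₀ : Site 2), (∀ q ∈ q₀ :: l, q ∉ Λ.support) →
      List.IsChain (fun q q' => ∃ c, c ∈ corners q ∧ c ∈ corners q') (q₀ :: l) →
      ∀ c ∈ corners q₀, ∀ c' ∈ corners ((q₀ :: l).getLast (by simp)),
        walkWinding Λ (c - 1) = walkWinding Λ (c' - 1) := by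
  intro l
  induction l with
  | nil =>
    intro q₀ hq _ c hc c' hc'
    simp only [List.getLast_singleton] at hc'
    rw [walkWinding_eq_of_mem_corners Λ (hq q₀ (by simp)) hc,
      walkWinding_eq_of_mem_corners Λ (hq q₀ (by simp)) hc']
  | cons q₁ l ih =>
    intro q₀ hq hchain c hc c' hc'
    rw [List.isChain_cons_cons] at hchain
    obtain ⟨⟨d, hd₀, hd₁⟩, hchain'⟩ := hchain
    have hq₀ : q₀ ∉ Λ.support := hq q₀ (by simp)
    have step : walkWinding Λ (c - 1) = walkWinding Λ (d - 1) := by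
      rw [walkWinding_eq_of_mem_corners Λ hq₀ hc, walkWinding_eq_of_mem_corners Λ hq₀ hd₀]
    rw [step]
    have hlast : (q₀ :: q₁ :: l).getLast (by simp) = (q₁ :: l).getLast (by simp) := by
      simp [List.getLast_cons]
    rw [hlast] at hc'
    exact ih q₁ (fun q hq' => hq q (by simp [hq'])) hchain' d hd₁ c' hc'

end CornerRoutes

/-! ### §D3. Squares in the plane: closed squares, floor squares, king chains of paths -/

section SquareGeometry

variable {δ : ℝ}

/-- The closed unit square of the mesh `δℤ²` with lower-left lattice corner `q`. [folklore] -/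
def closedSq (δ : ℝ) (q : Site 2) : Set ℂ :=
  {z | δ * q 0 ≤ z.re ∧ z.re ≤ δ * (q 0 + 1) ∧ δ * q 1 ≤ z.im ∧ z.im ≤ δ * (q 1 + 1)}

/-- The square of the mesh containing `z` (coordinatewise floor). [folklore] -/
def floorSq (δ : ℝ) (z : ℂ) : Site 2 := ![⌊z.re / δ⌋, ⌊z.im / δ⌋]

/-- First coordinate of the floor square. [folklore] -/
@[simp] theorem floorSq_zero (δ : ℝ) (z : ℂ) : floorSq δ z 0 = ⌊z.re / δ⌋ := rfl
/-- Second coordinate of the floor square. [folklore] -/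
@[simp] theorem floorSq_one (δ : ℝ) (z : ℂ) : floorSq δ z 1 = ⌊z.im / δ⌋ := rfl

/-- A point lies in the closed square of its floor square. [folklore] -/
theorem mem_closedSq_floorSq (hδ : 0 < δ) (z : ℂ) : z ∈ closedSq δ (floorSq δ z) := by
  have h0 := Int.floor_le (z.re / δ)
  have h0' := (Int.lt_floor_add_one (z.re / δ)).le
  have h1 := Int.floor_le (z.im / δ)
  have h1' := (Int.lt_floor_add_one (z.im / δ)).le
  rw [div_le_iff₀ hδ] at h0' h1'
  rw [le_div_iff₀ hδ] at h0 h1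
  simp only [closedSq, mem_setOf_eq, floorSq_zero, floorSq_one]
  refine ⟨by linarith, by linarith, by linarith, by linarith⟩

/-- Two points at distance `< δ` have floor squares at sup-distance `≤ 1`. [folklore] -/
theorem abs_floorSq_sub_le (hδ : 0 < δ) {z w : ℂ} (h : dist z w < δ) (i : Fin 2) :
    |floorSq δ z i - floorSq δ w i| ≤ 1 := by
  have hre : |z.re - w.re| < δ := (Complex.abs_re_le_norm (z - w)).trans_lt (by rwa [← Complex.dist_eq])
  have him : |z.im - w.im| < δ := (Complex.abs_im_le_norm (z - w)).trans_lt (by rwa [← Complex.dist_eq])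
  have key : ∀ a b : ℝ, |a - b| < δ → |⌊a / δ⌋ - ⌊b / δ⌋| ≤ 1 := by
    intro a b hab
    have h : |a / δ - b / δ| < 1 := by
      rw [← sub_div, abs_div, abs_of_pos hδ, div_lt_one hδ]; exact hab
    rw [abs_lt] at h
    have h1 := Int.floor_le (a / δ)
    have h2 := Int.lt_floor_add_one (a / δ)
    have h3 := Int.floor_le (b / δ)
    have h4 := Int.lt_floor_add_one (b / δ)
    rw [abs_le]
    constructor
    · have : (⌊b / δ⌋ : ℝ) < ⌊a / δ⌋ + 2 := by linarith
      have : ⌊b / δ⌋ < ⌊a / δ⌋ + 2 := by exact_mod_cast this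
      omega
    · have : (⌊a / δ⌋ : ℝ) < ⌊b / δ⌋ + 2 := by linarith
      have : ⌊a / δ⌋ < ⌊b / δ⌋ + 2 := by exact_mod_cast this
      omega
  fin_cases i
  · simpa using key z.re w.re (by simpa [Complex.sub_re] using hre)
  · simpa using key z.im w.im (by simpa [Complex.sub_im] using him)

/-- A point of the closed square `q` within `δ/2` of `w`: the floor square of `w` is at
sup-distance `≤ 1` from `q`. [folklore] -/
theorem abs_sub_floorSq_le_of_mem_closedSq (hδ : 0 < δ) {q : Site 2} {z w : ℂ} (hz : z ∈ closedSq δ q)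
    (h : dist z w < δ / 2) (i : Fin 2) : |q i - floorSq δ w i| ≤ 1 := by
  obtain ⟨h0, h0', h1, h1'⟩ := hz
  have hre : |z.re - w.re| < δ / 2 := (Complex.abs_re_le_norm (z - w)).trans_lt (by rwa [← Complex.dist_eq])
  have him : |z.im - w.im| < δ / 2 := (Complex.abs_im_le_norm (z - w)).trans_lt (by rwa [← Complex.dist_eq])
  have key : ∀ (a b : ℝ) (k : ℤ), δ * k ≤ a → a ≤ δ * (k + 1) → |a - b| < δ / 2 → |k - ⌊b / δ⌋| ≤ 1 := by
    intro a b k hk hk' hab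
    rw [abs_lt] at hab
    have h3 := Int.floor_le (b / δ)
    have h4 := Int.lt_floor_add_one (b / δ)
    rw [le_div_iff₀ hδ] at h3
    rw [div_lt_iff₀ hδ] at h4
    rw [abs_le]
    constructor
    · have : δ * ⌊b / δ⌋ < δ * (k + 2) := by nlinarith
      have : (⌊b / δ⌋ : ℝ) < k + 2 := lt_of_mul_lt_mul_left this hδ.le
      have : ⌊b / δ⌋ < k + 2 := by exact_mod_cast this
      omega
    · have : δ * k < δ * (⌊b / δ⌋ + 2) := by nlinarith
      have : (k : ℝ) < ⌊b / δ⌋ + 2 := lt_of_mul_lt_mul_left this hδ.le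
      have : k < ⌊b / δ⌋ + 2 := by exact_mod_cast this
      omega
  fin_cases i
  · simpa using key z.re w.re (q 0) h0 h0' hre
  · simpa using key z.im w.im (q 1) h1 h1' him

/-- **King chains of paths.** A continuous path is shadowed by a chain of squares of the mesh,
consecutive ones sharing a corner, each meeting the path, from the floor square of the initial
point to a square containing the end point. [folklore] -/
theorem exists_kingChain_of_path (hδ : 0 < δ) {γ : ℝ → ℂ} (hγ : ContinuousOn γ (Icc 0 1)) :
    ∃ l : List (Site 2),
      List.IsChain (fun q q' => ∃ c, c ∈ corners q ∧ c ∈ corners q') (floorSq δ (γ 0) :: l) ∧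
      (∀ q ∈ floorSq δ (γ 0) :: l, ∃ t ∈ Icc (0 : ℝ) 1, γ t ∈ closedSq δ q) ∧
      γ 1 ∈ closedSq δ ((floorSq δ (γ 0) :: l).getLast (by simp)) := by
  -- uniform continuity on `[0,1]`
  obtain ⟨η, hη, hU⟩ := Metric.uniformContinuousOn_iff.1
    (isCompact_Icc.uniformContinuousOn_of_continuous hγ) δ hδ
  obtain ⟨N, hN⟩ := exists_nat_gt (1 / η)
  have hNpos : 0 < N := by
    have : (0 : ℝ) < N := (one_div_pos.2 hη).trans hN
    exact_mod_cast this
  have hNr : (0 : ℝ) < N := by exact_mod_cast hNpos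
  have hstep : 1 / (N : ℝ) < η := by
    rw [one_div_lt hNr hη]; exact hN
  -- the chain `k ↦ floorSq (γ (k/N))`, `k = j, …, N`
  set Q : ℕ → Site 2 := fun k => floorSq δ (γ (k / N)) with hQ
  have hmemI : ∀ k : ℕ, k ≤ N → ((k : ℝ) / N) ∈ Icc (0 : ℝ) 1 := fun k hk =>
    ⟨by positivity, (div_le_one hNr).2 (by exact_mod_cast hk)⟩
  have hadj : ∀ k : ℕ, k + 1 ≤ N → ∃ c, c ∈ corners (Q k) ∧ c ∈ corners (Q (k + 1)) := by
    intro k hk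
    have hd : dist (γ (k / N)) (γ ((k + 1 : ℕ) / N)) < δ := by
      refine hU _ (hmemI k (by omega)) _ (hmemI (k + 1) hk) ?_
      rw [Real.dist_eq, show ((k : ℝ) / N - ((k + 1 : ℕ) : ℝ) / N) = -(1 / N) by push_cast; ring,
        abs_neg, abs_of_pos (by positivity)]
      exact hstep
    exact ⟨_, sup_mem_corners (abs_floorSq_sub_le hδ hd 0) (abs_floorSq_sub_le hδ hd 1)⟩
  -- lists `L j = [Q j, …, Q N]` built downwards
  have build : ∀ m : ℕ, ∀ j : ℕ, j + m = N → ∃ l : List (Site 2),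
      List.IsChain (fun q q' => ∃ c, c ∈ corners q ∧ c ∈ corners q') (Q j :: l) ∧
      (∀ q ∈ Q j :: l, ∃ k : ℕ, k ≤ N ∧ q = Q k) ∧ (Q j :: l).getLast (by simp) = Q N := by
    intro m
    induction m with
    | zero =>
      intro j hj
      refine ⟨[], List.isChain_singleton _, fun q hq => ⟨j, by omega, by simpa using hq⟩, ?_⟩
      simp [show j = N by omega]
    | succ m ih =>
      intro j hj
      obtain ⟨l, hl, hmem, hlast⟩ := ih (j + 1) (by omega)
      refine ⟨Q (j + 1) :: l, List.isChain_cons_cons.2 ⟨hadj j (by omega), hl⟩, fun q hq => ?_, ?_⟩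
      · rw [List.mem_cons] at hq
        rcases hq with rfl | hq
        · exact ⟨j, by omega, rfl⟩
        · exact hmem q hq
      · rw [List.getLast_cons (by simp)]
        exact hlast
  obtain ⟨l, hl, hmem, hlast⟩ := build N 0 (by simp)
  have hQ0 : Q 0 = floorSq δ (γ 0) := by simp [hQ]
  refine ⟨l, by simpa [hQ0] using hl, fun q hq => ?_, ?_⟩
  · rw [← hQ0] at hq
    obtain ⟨k, hk, rfl⟩ := hmem q hq
    exact ⟨k / N, hmemI k hk, mem_closedSq_floorSq hδ _⟩
  · have : ((floorSq δ (γ 0)) :: l).getLast (by simp) = Q N := by simpa [hQ0] using hlast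
    rw [this, hQ]
    simpa [div_self hNr.ne'] using mem_closedSq_floorSq hδ (γ 1)

end SquareGeometry

/-! ### §D3b. Walks of inner squares do not wind around boundary vertices -/

section NoWindingAtBoundary

open WeakBeurling

variable {δ : ℝ}

/-- The closed square `q` is convex. [folklore] -/
theorem convex_closedSq (δ : ℝ) (q : Site 2) : Convex ℝ (closedSq δ q) := by
  have e : closedSq δ q = {z : ℂ | δ * q 0 ≤ z.re} ∩ {z | z.re ≤ δ * (q 0 + 1)} ∩ {z | δ * q 1 ≤ z.im} ∩
      {z | z.im ≤ δ * (q 1 + 1)} := by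
    ext z; simp [closedSq, and_assoc]
  rw [e]
  exact (((convex_halfSpace_re_ge _).inter (convex_halfSpace_re_le _)).inter
    (convex_halfSpace_im_ge _)).inter (convex_halfSpace_im_le _)

/-- A lattice point whose coordinates exceed those of `q` by `0` or `1` has its mesh point in the
closed square `q`. [folklore] -/
theorem meshPoint_mem_closedSq (hδ : 0 ≤ δ) {q x : Site 2} (h0 : x 0 = q 0 ∨ x 0 = q 0 + 1)
    (h1 : x 1 = q 1 ∨ x 1 = q 1 + 1) : meshPoint δ x ∈ closedSq δ q := by
  simp only [closedSq, mem_setOf_eq, meshPoint_re, meshPoint_im]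
  rcases h0 with h0 | h0 <;> rcases h1 with h1 | h1 <;> simp only [h0, h1] <;> push_cast <;>
    refine ⟨by nlinarith, by nlinarith, by nlinarith, by nlinarith⟩

/-- The closed lattice edge between two neighbours `x`, `y` lies in the closed square `x ⊓ y`
(of which it is a side). [folklore] -/
theorem segment_subset_closedSq_inf (hδ : 0 ≤ δ) {x y : Site 2} (hxy : (zdGraph 2).Adj x y) :
    segment ℝ (meshPoint δ x) (meshPoint δ y) ⊆ closedSq δ (x ⊓ y) := by
  refine (convex_closedSq δ _).segment_subset ?_ ?_ <;>
    refine meshPoint_mem_closedSq hδ ?_ ?_ <;>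
    rcases stepKind_of_adj hxy with ⟨h0, h1⟩ | ⟨h0, h1⟩ | ⟨h1, h0⟩ | ⟨h1, h0⟩ <;>
    simp only [Pi.inf_apply] <;> omega

/-- `x` is a corner of the square `x ⊓ y` for a neighbour `y`. [folklore] -/
theorem mem_corners_inf (x : Site 2) {y : Site 2} (hxy : (zdGraph 2).Adj x y) : x ∈ corners (x ⊓ y) := by
  rw [mem_corners_iff]
  rcases stepKind_of_adj hxy with ⟨h0, h1⟩ | ⟨h0, h1⟩ | ⟨h1, h0⟩ | ⟨h1, h0⟩ <;>
    simp only [Pi.inf_apply] <;> omega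

/-- If the lattice edge `{x, y}` is not an edge of `Ω_n`, the square `x ⊓ y` (of which it is a
side) is not inner. [folklore] -/
theorem not_isInnerSq_inf {Ω : Set ℂ} {x y : Site 2} (hxy : (zdGraph 2).Adj x y)
    (h : ¬ (domainGraph Ω δ).Adj x y) : ¬ IsInnerSq Ω δ (x ⊓ y) := by
  rcases stepKind_of_adj hxy with ⟨h0, h1⟩ | ⟨h0, h1⟩ | ⟨h1, h0⟩ | ⟨h1, h0⟩
  · have hq : x ⊓ y = x := by ext i; fin_cases i <;> simp <;> omega
    have hy : y = x + Pi.single 0 1 := by simp [Site.eq_iff_two, h0, h1]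
    rw [hq]; rw [hy] at h
    exact (not_isInnerSq_of_not_adj_right h).1
  · have hq : x ⊓ y = y := by ext i; fin_cases i <;> simp <;> omega
    have hx : x = y + Pi.single 0 1 := by simp [Site.eq_iff_two, h0, h1]
    rw [hq]; rw [hx] at h
    exact (not_isInnerSq_of_not_adj_right fun h' => h h'.symm).1
  · have hq : x ⊓ y = x := by ext i; fin_cases i <;> simp <;> omega
    have hy : y = x + Pi.single 1 1 := by simp [Site.eq_iff_two, h0, h1]
    rw [hq]; rw [hy] at h
    exact (not_isInnerSq_of_not_adj_up h).1
  · have hq : x ⊓ y = y := by ext i; fin_cases i <;> simp <;> omega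
    have hx : x = y + Pi.single 1 1 := by simp [Site.eq_iff_two, h0, h1]
    rw [hq]; rw [hx] at h
    exact (not_isInnerSq_of_not_adj_up fun h' => h h'.symm).1

/-- **Inner squares lie in the domain** (Jordan curve theorem: the four sides lie in `Ω`, hence
the open square does, `JordanDomain.openRect_subset_of_sides_subset_closure`). [folklore] -/
theorem closedSq_subset_of_isInnerSq (R : RandomPlanarGeometry.ConformalRectangle) (hδ : 0 < δ)
    {q : Site 2} (hq : IsInnerSq R.carrier δ q) : closedSq δ q ⊆ R.carrier := by
  obtain ⟨hB, hT, hL, hR⟩ := hq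
  have segB := (innerGraph_adj_iff.1 (domainGraph_adj_iff.1 hB).1).2
  have segT := (innerGraph_adj_iff.1 (domainGraph_adj_iff.1 hT).1).2
  have segL := (innerGraph_adj_iff.1 (domainGraph_adj_iff.1 hL).1).2
  have segR := (innerGraph_adj_iff.1 (domainGraph_adj_iff.1 hR).1).2
  -- the four sides
  have hbot : ∀ X : ℝ, δ * q 0 ≤ X → X ≤ δ * (q 0 + 1) → (⟨X, δ * q 1⟩ : ℂ) ∈ R.carrier := by
    intro X h0 h1
    refine segB ?_
    have e1 : meshPoint δ q = ⟨δ * q 0, δ * q 1⟩ := Complex.ext (by simp) (by simp)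
    have e2 : meshPoint δ (q + Pi.single 0 1) = ⟨δ * (q 0 + 1), δ * q 1⟩ :=
      Complex.ext (by simp) (by simp)
    rw [e1, e2]
    exact mem_segment_horizontal h0 h1 (by nlinarith)
  have htop : ∀ X : ℝ, δ * q 0 ≤ X → X ≤ δ * (q 0 + 1) → (⟨X, δ * (q 1 + 1)⟩ : ℂ) ∈ R.carrier := by
    intro X h0 h1
    refine segT ?_
    have e1 : meshPoint δ (q + Pi.single 1 1) = ⟨δ * q 0, δ * (q 1 + 1)⟩ :=
      Complex.ext (by simp) (by simp)
    have e2 : meshPoint δ (q + Pi.single 1 1 + Pi.single 0 1) = ⟨δ * (q 0 + 1), δ * (q 1 + 1)⟩ :=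
      Complex.ext (by simp) (by simp)
    rw [e1, e2]
    exact mem_segment_horizontal h0 h1 (by nlinarith)
  have hleft : ∀ Y : ℝ, δ * q 1 ≤ Y → Y ≤ δ * (q 1 + 1) → (⟨δ * q 0, Y⟩ : ℂ) ∈ R.carrier := by
    intro Y h0 h1
    refine segL ?_
    have e1 : meshPoint δ q = ⟨δ * q 0, δ * q 1⟩ := Complex.ext (by simp) (by simp)
    have e2 : meshPoint δ (q + Pi.single 1 1) = ⟨δ * q 0, δ * (q 1 + 1)⟩ :=
      Complex.ext (by simp) (by simp)
    rw [e1, e2]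
    exact mem_segment_vertical h0 h1 (by nlinarith)
  have hright : ∀ Y : ℝ, δ * q 1 ≤ Y → Y ≤ δ * (q 1 + 1) → (⟨δ * (q 0 + 1), Y⟩ : ℂ) ∈ R.carrier := by
    intro Y h0 h1
    refine segR ?_
    have e1 : meshPoint δ (q + Pi.single 0 1) = ⟨δ * (q 0 + 1), δ * q 1⟩ :=
      Complex.ext (by simp) (by simp)
    have e2 : meshPoint δ (q + Pi.single 0 1 + Pi.single 1 1) = ⟨δ * (q 0 + 1), δ * (q 1 + 1)⟩ :=
      Complex.ext (by simp) (by simp)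
    rw [e1, e2]
    exact mem_segment_vertical h0 h1 (by nlinarith)
  -- the open square, by the Jordan curve theorem
  have hopen : (Ioo (δ * q 0) (δ * (q 0 + 1)) ×ℂ Ioo (δ * q 1) (δ * (q 1 + 1))) ⊆ R.carrier := by
    refine R.openRect_subset_of_sides_subset_closure (fun z hz h0 h1 => subset_closure ?_)
      (fun z hz h0 h1 => subset_closure ?_)
    · rcases hz with hz | hz
      · have : z = ⟨δ * q 0, z.im⟩ := Complex.ext hz rfl
        rw [this]; exact hleft _ h0 h1
      · have : z = ⟨δ * (q 0 + 1), z.im⟩ := Complex.ext hz rfl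
        rw [this]; exact hright _ h0 h1
    · rcases hz with hz | hz
      · have : z = ⟨z.re, δ * q 1⟩ := Complex.ext rfl hz
        rw [this]; exact hbot _ h0 h1
      · have : z = ⟨z.re, δ * (q 1 + 1)⟩ := Complex.ext rfl hz
        rw [this]; exact htop _ h0 h1
  intro z hz
  obtain ⟨h0, h0', h1, h1'⟩ := hz
  rcases h0.eq_or_lt with e | l0
  · have : z = ⟨δ * q 0, z.im⟩ := Complex.ext e.symm rfl
    rw [this]; exact hleft _ h1 h1'
  rcases h0'.eq_or_lt with e | l0'
  · have : z = ⟨δ * (q 0 + 1), z.im⟩ := Complex.ext e rfl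
    rw [this]; exact hright _ h1 h1'
  rcases h1.eq_or_lt with e | l1
  · have : z = ⟨z.re, δ * q 1⟩ := Complex.ext rfl e.symm
    rw [this]; exact hbot _ h0 h0'
  rcases h1'.eq_or_lt with e | l1'
  · have : z = ⟨z.re, δ * (q 1 + 1)⟩ := Complex.ext rfl e
    rw [this]; exact htop _ h0 h0'
  exact hopen ⟨⟨l0, l0'⟩, ⟨l1, l1'⟩⟩

/-- A square containing a point outside the domain is not inner. [folklore] -/
theorem not_isInnerSq_of_mem_closedSq (R : RandomPlanarGeometry.ConformalRectangle) (hδ : 0 < δ)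
    {q : Site 2} {z : ℂ} (hz : z ∈ closedSq δ q) (hzΩ : z ∉ R.carrier) : ¬ IsInnerSq R.carrier δ q :=
  fun hq => hzΩ (closedSq_subset_of_isInnerSq R hδ hq hz)

/-- Inner squares have their index in a box of size `⌈r₀/δ⌉` when `Ω ⊆ B̄(0, r₀)`. [folklore] -/
theorem mem_sqBox_of_isInnerSq {Ω : Set ℂ} (h0 : (0 : ℂ) ∈ Ω) {r₀ : ℝ} (hΩ : Ω ⊆ closedBall 0 r₀)
    (hδ : 0 < δ) {q : Site 2} (hq : IsInnerSq Ω δ q) : q ∈ sqBox 0 ⌈r₀ / δ⌉ := by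
  have hqd : q ∈ domain Ω δ := (domainGraph_adj_iff.1 hq.1).2.1
  have hqΩ : meshPoint δ q ∈ Ω := (mem_meshVertices_iff.1 (domain_subset_meshVertices h0 hqd))
  have hn : ‖meshPoint δ q‖ ≤ r₀ := by simpa using hΩ hqΩ
  have hc : r₀ / δ ≤ ⌈r₀ / δ⌉ := Int.le_ceil _
  rw [div_le_iff₀ hδ] at hc
  have key : ∀ i : Fin 2, |(q i : ℝ)| * δ ≤ r₀ := by
    intro i
    have h1 : |δ * (q i : ℝ)| ≤ ‖meshPoint δ q‖ := by
      fin_cases i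
      · simpa using Complex.abs_re_le_norm (meshPoint δ q)
      · simpa using Complex.abs_im_le_norm (meshPoint δ q)
    rw [abs_mul, abs_of_pos hδ] at h1
    linarith
  rw [mem_sqBox]
  constructor <;> [have := key 0; have := key 1] <;>
  · simp only [Pi.zero_apply, sub_zero]
    have : (|q _| : ℝ) ≤ ⌈r₀ / δ⌉ := le_of_mul_le_mul_right (by nlinarith) hδ
    exact_mod_cast this

/-- **Walks of inner squares do not wind around boundary vertices.** For a conformal rectangle
(Jordan domain `Ω` with `0 ∈ Ω`), a closed walk in the dual graph of `Ω_n`, and a vertex `x` of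
`∂Ω_n` (incident to a lattice edge meeting `∂Ω`): the winding number about `x` vanishes. Route:
`x` is a corner of the non-inner square on its boundary edge, which shares a corner with a
square containing an exterior point, from which a path in the (connected, unbounded) exterior,
shadowed by a king chain of non-inner squares, leads outside the bounding box of the walk. [folklore] -/
theorem walkWinding_eq_zero_of_mem_boundary (R : RandomPlanarGeometry.ConformalRectangle)
    (h0 : (0 : ℂ) ∈ R.carrier) (hδ : 0 < δ) {a : Site 2} (ha : IsInnerSq R.carrier δ a)
    (Λ : (dualGraph R.carrier δ).Walk a a) {x : Site 2} (hx : x ∈ boundary R.carrier δ) :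
    walkWinding (Λ.map (Hom.ofLE dualGraph_le_zdGraph)) (x - 1) = 0 := by
  -- the support consists of inner squares
  have hsupp : ∀ q ∈ (Λ.map (Hom.ofLE dualGraph_le_zdGraph)).support, IsInnerSq R.carrier δ q := by
    intro q hq
    rw [Walk.support_map, List.mem_map] at hq
    obtain ⟨q', hq', rfl⟩ := hq
    by_cases hlen : Λ.length = 0
    · have hs : Λ.support = [a] := Walk.nil_iff_support_eq.mp (Walk.length_eq_zero_iff.mp hlen)
      rw [hs, List.mem_singleton] at hq'
      subst hq'
      exact ha
    · exact isInnerSq_of_mem_support Λ (Or.inr (Nat.pos_of_ne_zero hlen)) hq'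
  -- the boundary edge at `x` and the non-inner square `Q₁ = x ⊓ y`
  obtain ⟨-, y, hxy, j, hjseg, hjf⟩ := hx
  have hjΩ : j ∉ R.carrier := fun h => (R.disjoint_carrier_frontier.ne_of_mem h hjf) rfl
  have hnadj : ¬ (domainGraph R.carrier δ).Adj x y := fun h =>
    hjΩ ((innerGraph_adj_iff.1 (domainGraph_adj_iff.1 h).1).2 hjseg)
  have hQ₁ : ¬ IsInnerSq R.carrier δ (x ⊓ y) := not_isInnerSq_inf hxy hnadj
  have hjQ₁ : j ∈ closedSq δ (x ⊓ y) := segment_subset_closedSq_inf hδ.le hxy hjseg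
  -- an exterior point near `j` and its square `Q'`
  obtain ⟨e', he', hje'⟩ := Metric.mem_closure_iff.1 (R.frontier_subset_closure_exterior' hjf) (δ / 2)
    (by positivity)
  have hQ' : ∃ c, c ∈ corners (x ⊓ y) ∧ c ∈ corners (floorSq δ e') :=
    ⟨_, sup_mem_corners (abs_sub_floorSq_le_of_mem_closedSq hδ hjQ₁ hje' 0)
      (abs_sub_floorSq_le_of_mem_closedSq hδ hjQ₁ hje' 1)⟩
  -- a far exterior point and an exterior path to it
  obtain ⟨r₀, hr₀⟩ := (isBounded_iff_subset_closedBall (0 : ℂ)).1 R.isBounded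
  have hr₀nn : 0 ≤ r₀ := by simpa using hr₀ h0
  set N : ℤ := ⌈r₀ / δ⌉ with hN
  have hNnn : 0 ≤ (N : ℝ) := (div_nonneg hr₀nn hδ.le).trans (Int.le_ceil _)
  set X : ℝ := r₀ + 1 + δ * (N + 4) with hX
  have hX0 : 0 < X := by rw [hX]; nlinarith
  have hXr : r₀ < X := by rw [hX]; nlinarith
  have hfar : (X : ℂ) ∈ (closure R.carrier)ᶜ := by
    intro hmem
    have : (X : ℂ) ∈ closedBall (0 : ℂ) r₀ := closure_minimal hr₀ isClosed_closedBall hmem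
    have h1 : ‖(X : ℂ)‖ ≤ r₀ := by simpa using this
    rw [Complex.norm_real, Real.norm_eq_abs, abs_of_pos hX0] at h1
    linarith
  have hpath : JoinedIn (closure R.carrier)ᶜ e' (X : ℂ) :=
    ((R.isOpen_exterior.isConnected_iff_isPathConnected).1 R.isConnected_exterior).joinedIn
      e' he' _ hfar
  have hγc : ContinuousOn (fun t : ℝ => hpath.somePath.extend t) (Icc 0 1) :=
    hpath.somePath.continuous_extend.continuousOn
  have hγE : ∀ t ∈ Icc (0 : ℝ) 1, hpath.somePath.extend t ∈ (closure R.carrier)ᶜ := fun t ht => by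
    rw [Path.extend_extends' hpath.somePath ⟨t, ht⟩]
    exact hpath.somePath_mem _
  obtain ⟨l, hchain, hmeet, hlast⟩ := exists_kingChain_of_path hδ hγc
  simp only [Path.extend_zero, Path.extend_one] at hchain hmeet hlast
  -- none of the squares of the chain `Q₁ :: Q' :: l` is visited
  have hnot : ∀ q ∈ (x ⊓ y) :: floorSq δ e' :: l, q ∉ (Λ.map (Hom.ofLE dualGraph_le_zdGraph)).support := by
    intro q hq hqs
    have hqI := hsupp q hqs
    rw [List.mem_cons] at hq
    rcases hq with rfl | hq
    · exact hQ₁ hqI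
    · obtain ⟨t, ht, hγt⟩ := hmeet q hq
      exact not_isInnerSq_of_mem_closedSq R hδ hγt (fun h => hγE t ht (subset_closure h)) hqI
  have hchain' : List.IsChain (fun q q' => ∃ c, c ∈ corners q ∧ c ∈ corners q')
      ((x ⊓ y) :: floorSq δ e' :: l) :=
    List.isChain_cons_cons.2 ⟨hQ', hchain⟩
  -- transport the winding number along the chain and conclude outside the bounding box
  have hW := walkWinding_eq_of_cornerChain (Λ.map (Hom.ofLE dualGraph_le_zdGraph)) (floorSq δ e' :: l)
    (x ⊓ y) hnot hchain' x (mem_corners_inf x hxy) (((x ⊓ y) :: floorSq δ e' :: l).getLast (by simp))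
    (by rw [corners]; simp)
  rw [hW]
  have hqN' : ((x ⊓ y) :: floorSq δ e' :: l).getLast (by simp) = (floorSq δ e' :: l).getLast (by simp) := by
    simp [List.getLast_cons]
  have hXq : (X : ℂ) ∈ closedSq δ (((x ⊓ y) :: floorSq δ e' :: l).getLast (by simp)) := by
    rw [hqN']; exact hlast
  refine walkWinding_eq_zero_of_not_mem_sqBox (p₀ := 0) (n := N) (fun z hz => ?_) ?_
  · exact mem_sqBox_of_isInnerSq h0 hr₀ hδ (hsupp z hz)
  · obtain ⟨-, hq0, -, -⟩ := hXq
    simp only [Complex.ofReal_re] at hq0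
    rw [mem_sqBox, not_and_or]
    left
    simp only [Pi.sub_apply, Pi.one_apply, Pi.zero_apply, sub_zero, not_le]
    have h1 : δ * (N + 4) < δ * (((((x ⊓ y) :: floorSq δ e' :: l).getLast (by simp)) 0 : ℝ) + 1) := by
      rw [hX] at hq0; linarith
    have h2 : (N : ℝ) + 4 < (((x ⊓ y) :: floorSq δ e' :: l).getLast (by simp)) 0 + 1 :=
      lt_of_mul_lt_mul_left h1 hδ.le
    have h3 : N + 4 < (((x ⊓ y) :: floorSq δ e' :: l).getLast (by simp)) 0 + 1 := by exact_mod_cast h2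
    rw [lt_abs]
    left
    omega

end NoWindingAtBoundary

/-! ### §D4. The discrete conjugate `h'` on the dual component of the base square -/

section Conjugate

open WeakBeurling

variable {Ω : Set ℂ} {δ : ℝ}

open Classical in
/-- The current of the potential `h` along the directed lattice edge `x → y` of `Ω_n` (zero on
non-edges): `i(x → y) = h x - h y` ([GP19], §2.3). [cite: GeorgakopoulosPanagiotis2019, §2.3] -/
def cur (Ω : Set ℂ) (δ : ℝ) (h : Site 2 → ℝ) (x y : Site 2) : ℝ :=
  if (domainGraph Ω δ).Adj x y then h x - h y else 0

/-- The current along the horizontal edge from the lattice point `u + (1,1)` rightwards, in the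
indexing of `stepFlux`. [folklore] -/
def curH (Ω : Set ℂ) (δ : ℝ) (h : Site 2 → ℝ) (u : Site 2) : ℝ := cur Ω δ h (u + 1) (u + 1 + Pi.single 0 1)

/-- The current along the vertical edge from the lattice point `u + (1,1)` upwards. [folklore] -/
def curV (Ω : Set ℂ) (δ : ℝ) (h : Site 2 → ℝ) (u : Site 2) : ℝ := cur Ω δ h (u + 1) (u + 1 + Pi.single 1 1)

/-- The current is antisymmetric. [folklore] -/
theorem cur_antisymm (h : Site 2 → ℝ) (x y : Site 2) : cur Ω δ h y x = -cur Ω δ h x y := by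
  unfold cur
  by_cases hxy : (domainGraph Ω δ).Adj x y
  · rw [if_pos hxy, if_pos hxy.symm]; ring
  · rw [if_neg hxy, if_neg fun h' => hxy h'.symm]; ring

/-- The current along an edge of `Ω_n`. [folklore] -/
theorem cur_of_adj {h : Site 2 → ℝ} {x y : Site 2} (hxy : (domainGraph Ω δ).Adj x y) :
    cur Ω δ h x y = h x - h y := if_pos hxy

/-- No current off the edges of `Ω_n`. [folklore] -/
theorem cur_of_not_adj {h : Site 2 → ℝ} {x y : Site 2} (hxy : ¬ (domainGraph Ω δ).Adj x y) :
    cur Ω δ h x y = 0 := if_neg hxy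

open Classical in
/-- The divergence of the current at the lattice point `x` is minus the harmonicity defect of
`h` at `x` for the graph `Ω_n`. [folklore] -/
theorem divAt_cur (h : Site 2 → ℝ) (x : Site 2) :
    divAt (curH Ω δ h) (curV Ω δ h) (x - 1) =
      -∑ y ∈ ((zdGraph 2).neighborFinset x).filter (fun y => (domainGraph Ω δ).Adj x y), (h y - h x) := by
  rw [Finset.sum_filter, sum_neighborFinset_zdGraph, Fin.sum_univ_two]
  have e1 : x - 1 + 1 = x := by abel
  have e2 : x - 1 - Pi.single 0 1 + 1 = x - Pi.single 0 1 := by abel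
  have e3 : x - 1 - Pi.single 1 1 + 1 = x - Pi.single 1 1 := by abel
  have e4 : x - Pi.single 0 1 + Pi.single 0 1 = x := by abel
  have e5 : x - Pi.single 1 1 + Pi.single 1 1 = x := by abel
  simp only [divAt, curH, curV, e1, e2, e3, e4, e5]
  rw [cur_antisymm h x (x - Pi.single 0 1), cur_antisymm h x (x - Pi.single 1 1)]
  simp only [cur]
  split_ifs <;> ring

open Classical in
/-- If `h` is harmonic for `Ω_n` at every vertex off `T ∪ B` (as the potential of
`exists_potential` is), the divergence of its current vanishes off `T ∪ B`. [folklore] -/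
theorem divAt_cur_eq_zero {h : Site 2 → ℝ} {T B : Set (Site 2)}
    (hharm : ∀ x, x ∉ T → x ∉ B →
      ∑ y ∈ ((zdGraph 2).neighborFinset x).filter (fun y => (domainGraph Ω δ).Adj x y), (h y - h x) = 0)
    {u : Site 2} (hT : u + 1 ∉ T) (hB : u + 1 ∉ B) : divAt (curH Ω δ h) (curV Ω δ h) u = 0 := by
  have := divAt_cur (Ω := Ω) (δ := δ) h (u + 1)
  rw [show u + 1 - 1 = u by abel] at this
  rw [this, hharm _ hT hB, neg_zero]

/-- The currents vanish off a box: if `Ω ⊆ B̄(0, r₀)` and `0 ∈ Ω`, `curH`, `curV` and their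
translates vanish at `u ∉ sqBox 0 (⌈r₀/δ⌉ + 1)`. [folklore] -/
theorem cur_eq_zero_of_not_mem_sqBox (h0 : (0 : ℂ) ∈ Ω) {r₀ : ℝ} (hΩ : Ω ⊆ closedBall 0 r₀) (hδ : 0 < δ)
    (h : Site 2 → ℝ) {u : Site 2} (hu : u ∉ sqBox 0 (⌈r₀ / δ⌉ + 1)) :
    (curH Ω δ h u = 0 ∧ curV Ω δ h u = 0) ∧
      (curH Ω δ h (u - Pi.single 0 1) = 0 ∧ curV Ω δ h (u - Pi.single 1 1) = 0) := by
  -- every vertex of an edge of `Ω_n` is in the box `⌈r₀/δ⌉`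
  have key : ∀ x y : Site 2, (domainGraph Ω δ).Adj x y → x ∈ sqBox 0 ⌈r₀ / δ⌉ := by
    intro x y hxy
    have hxd : x ∈ domain Ω δ := (domainGraph_adj_iff.1 hxy).2.1
    have hxΩ : meshPoint δ x ∈ Ω := mem_meshVertices_iff.1 (domain_subset_meshVertices h0 hxd)
    have hn : ‖meshPoint δ x‖ ≤ r₀ := by simpa using hΩ hxΩ
    have hc : r₀ / δ ≤ ⌈r₀ / δ⌉ := Int.le_ceil _
    rw [div_le_iff₀ hδ] at hc
    have kk : ∀ i : Fin 2, |(x i : ℝ)| * δ ≤ r₀ := by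
      intro i
      have h1 : |δ * (x i : ℝ)| ≤ ‖meshPoint δ x‖ := by
        fin_cases i
        · simpa using Complex.abs_re_le_norm (meshPoint δ x)
        · simpa using Complex.abs_im_le_norm (meshPoint δ x)
      rw [abs_mul, abs_of_pos hδ] at h1
      linarith
    rw [mem_sqBox]
    constructor <;> [have := kk 0; have := kk 1] <;>
    · simp only [Pi.zero_apply, sub_zero]
      have : (|x _| : ℝ) ≤ ⌈r₀ / δ⌉ := le_of_mul_le_mul_right (by nlinarith) hδ
      exact_mod_cast this
  have out : ∀ v : Site 2, (|v 0 - u 0| ≤ 1 ∧ |v 1 - u 1| ≤ 1) → ∀ y, ¬ (domainGraph Ω δ).Adj v y := by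
    intro v hv y hvy
    have hb := key v y hvy
    rw [mem_sqBox] at hb hu
    simp only [Pi.zero_apply, sub_zero] at hb hu
    rw [abs_le, abs_le] at hb hv
    rw [not_and_or, not_le, not_le, lt_abs, lt_abs] at hu
    omega
  refine ⟨⟨cur_of_not_adj (out _ ⟨?_, ?_⟩ _), cur_of_not_adj (out _ ⟨?_, ?_⟩ _)⟩,
    ⟨cur_of_not_adj (out _ ⟨?_, ?_⟩ _), cur_of_not_adj (out _ ⟨?_, ?_⟩ _)⟩⟩ <;> simp

open Classical in
/-- **Closed walks of inner squares carry no flux.** For a conformal rectangle with `0 ∈ Ω` and a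
potential `h` harmonic for `Ω_n` off subsets `T, B ⊆ ∂Ω_n` (e.g. the potential of
`exists_potential`), the flux of the current of `h` through every closed walk of the dual graph
(based at an inner square) is zero: divergence sits on `∂Ω_n`, around which such walks do not
wind. ([GP19], §3.1: the conjugate function is well defined on the faces.) [cite: GeorgakopoulosPanagiotis2019, §3.1] -/
theorem walkFlux_eq_zero_of_closed (R : RandomPlanarGeometry.ConformalRectangle) (h0 : (0 : ℂ) ∈ R.carrier)
    (hδ : 0 < δ) {h : Site 2 → ℝ} {T B : Set (Site 2)} (hT : T ⊆ boundary R.carrier δ) (hB : B ⊆ boundary R.carrier δ)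
    (hharm : ∀ x, x ∉ T → x ∉ B →
      ∑ y ∈ ((zdGraph 2).neighborFinset x).filter (fun y => (domainGraph R.carrier δ).Adj x y), (h y - h x) = 0)
    {a : Site 2} (ha : IsInnerSq R.carrier δ a) (Λ : (dualGraph R.carrier δ).Walk a a) :
    walkFlux (curH R.carrier δ h) (curV R.carrier δ h) (Λ.map (Hom.ofLE dualGraph_le_zdGraph)) = 0 := by
  classical
  obtain ⟨r₀, hr₀⟩ := (isBounded_iff_subset_closedBall (0 : ℂ)).1 R.isBounded
  set S : Finset (Site 2) := (sqBox_finite 0 (⌈r₀ / δ⌉ + 1)).toFinset with hS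
  have hmemS : ∀ u, u ∉ S → u ∉ sqBox 0 (⌈r₀ / δ⌉ + 1) := fun u hu h => hu (by simpa [hS] using h)
  refine walkFlux_eq_zero_of_winding (S := S)
    (fun u hu => (cur_eq_zero_of_not_mem_sqBox h0 hr₀ hδ h (hmemS u hu)).1)
    (fun u hu => (cur_eq_zero_of_not_mem_sqBox h0 hr₀ hδ h (hmemS u hu)).2) _ fun u _ hdiv => ?_
  -- non-zero divergence at `u + 1` forces `u + 1 ∈ T ∪ B ⊆ ∂Ω_n`
  have hTB : u + 1 ∈ T ∨ u + 1 ∈ B := by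
    by_contra hc
    rw [not_or] at hc
    exact hdiv (divAt_cur_eq_zero hharm hc.1 hc.2)
  have hbd : u + 1 ∈ boundary R.carrier δ := hTB.elim (fun h => hT h) (fun h => hB h)
  have := walkWinding_eq_zero_of_mem_boundary R h0 hδ ha Λ hbd
  rwa [show u + 1 - 1 = u by abel] at this

open Classical in
/-- **The discrete conjugate** `h'` of the potential `h` on the squares, normalised at the base
square `p₀`: the flux of the current of `h` through any walk of the dual graph from `p₀` (zero
off the dual component of `p₀`). ([GP19], §3.1–3.2, the potential of the dual current.)
[cite: GeorgakopoulosPanagiotis2019, §3.1] -/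
def dualPot (Ω : Set ℂ) (δ : ℝ) (h : Site 2 → ℝ) (p₀ p : Site 2) : ℝ :=
  if hp : (dualGraph Ω δ).Reachable p₀ p then
    walkFlux (curH Ω δ h) (curV Ω δ h) (hp.some.map (Hom.ofLE dualGraph_le_zdGraph))
  else 0

open Classical in
/-- `h'` is computed by any walk of the dual graph from the base square. [folklore] -/
theorem dualPot_eq_walkFlux (R : RandomPlanarGeometry.ConformalRectangle) (h0 : (0 : ℂ) ∈ R.carrier)
    (hδ : 0 < δ) {h : Site 2 → ℝ} {T B : Set (Site 2)} (hT : T ⊆ boundary R.carrier δ) (hB : B ⊆ boundary R.carrier δ)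
    (hharm : ∀ x, x ∉ T → x ∉ B →
      ∑ y ∈ ((zdGraph 2).neighborFinset x).filter (fun y => (domainGraph R.carrier δ).Adj x y), (h y - h x) = 0)
    {p₀ p : Site 2} (hp₀ : IsInnerSq R.carrier δ p₀) (W : (dualGraph R.carrier δ).Walk p₀ p) :
    dualPot R.carrier δ h p₀ p = walkFlux (curH R.carrier δ h) (curV R.carrier δ h) (W.map (Hom.ofLE dualGraph_le_zdGraph)) := by
  have hp : (dualGraph R.carrier δ).Reachable p₀ p := ⟨W⟩
  rw [dualPot, dif_pos hp]
  have key := walkFlux_eq_zero_of_closed R h0 hδ hT hB hharm hp₀ (hp.some.append W.reverse)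
  rw [Walk.map_append, walkFlux_append, ← Walk.reverse_map, walkFlux_reverse] at key
  linarith

open Classical in
/-- **Discrete Cauchy–Riemann identity** ([GP19], (CRd)): across the common side of two adjacent
squares of the dual component of the base square, `h'` jumps by the current of `h` through that
side (from the left of the step to its right). [cite: GeorgakopoulosPanagiotis2019, §4.1 (CRd)] -/
theorem dualPot_sub_dualPot_of_adj (R : RandomPlanarGeometry.ConformalRectangle) (h0 : (0 : ℂ) ∈ R.carrier)
    (hδ : 0 < δ) {h : Site 2 → ℝ} {T B : Set (Site 2)} (hT : T ⊆ boundary R.carrier δ) (hB : B ⊆ boundary R.carrier δ)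
    (hharm : ∀ x, x ∉ T → x ∉ B →
      ∑ y ∈ ((zdGraph 2).neighborFinset x).filter (fun y => (domainGraph R.carrier δ).Adj x y), (h y - h x) = 0)
    {p₀ p p' : Site 2} (hp₀ : IsInnerSq R.carrier δ p₀) (hp : (dualGraph R.carrier δ).Reachable p₀ p)
    (hpp' : (dualGraph R.carrier δ).Adj p p') :
    dualPot R.carrier δ h p₀ p' - dualPot R.carrier δ h p₀ p = stepFlux (curH R.carrier δ h) (curV R.carrier δ h) p p' := by
  obtain ⟨W⟩ := hp
  rw [dualPot_eq_walkFlux R h0 hδ hT hB hharm hp₀ W,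
    dualPot_eq_walkFlux R h0 hδ hT hB hharm hp₀ (W.append (Walk.cons hpp' Walk.nil)),
    Walk.map_append, walkFlux_append]
  simp [walkFlux_cons]

/-- The four CR-increments around an inner square sum to zero (the circulation of `dh` around
the square): `h'` is harmonic on the dual lattice at every square of the component once each
side not leading into the component is given the virtual value `h'(p) + stepFlux`. [folklore] -/
theorem sum_stepFlux_eq_zero_of_isInnerSq {Ω : Set ℂ} {h : Site 2 → ℝ} {p : Site 2} (hp : IsInnerSq Ω δ p) :
    stepFlux (curH Ω δ h) (curV Ω δ h) p (p + Pi.single 0 1) +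
      stepFlux (curH Ω δ h) (curV Ω δ h) p (p - Pi.single 0 1) +
      stepFlux (curH Ω δ h) (curV Ω δ h) p (p + Pi.single 1 1) +
      stepFlux (curH Ω δ h) (curV Ω δ h) p (p - Pi.single 1 1) = 0 := by
  obtain ⟨hB, hT, hL, hR⟩ := hp
  have s1 : stepFlux (curH Ω δ h) (curV Ω δ h) p (p + Pi.single 0 1) = -curV Ω δ h (p - Pi.single 1 1) := by
    unfold stepFlux
    have c0 : (p + Pi.single 0 1 : Site 2) 0 = p 0 + 1 := by simp
    have c1 : (p + Pi.single 0 1 : Site 2) 1 = p 1 := by simp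
    simp [c0, c1]
  have s2 : stepFlux (curH Ω δ h) (curV Ω δ h) p (p - Pi.single 0 1) = curV Ω δ h (p - Pi.single 0 1 - Pi.single 1 1) := by
    unfold stepFlux
    have c0 : (p - Pi.single 0 1 : Site 2) 0 = p 0 - 1 := by simp
    have c1 : (p - Pi.single 0 1 : Site 2) 1 = p 1 := by simp
    simp [c0, c1]
    omega
  have s3 : stepFlux (curH Ω δ h) (curV Ω δ h) p (p + Pi.single 1 1) = curH Ω δ h (p - Pi.single 0 1) := by
    unfold stepFlux
    have c0 : (p + Pi.single 1 1 : Site 2) 0 = p 0 := by simp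
    have c1 : (p + Pi.single 1 1 : Site 2) 1 = p 1 + 1 := by simp
    simp [c0, c1]
  have s4 : stepFlux (curH Ω δ h) (curV Ω δ h) p (p - Pi.single 1 1) = -curH Ω δ h (p - Pi.single 1 1 - Pi.single 0 1) := by
    unfold stepFlux
    have c0 : (p - Pi.single 1 1 : Site 2) 0 = p 0 := by simp
    have c1 : (p - Pi.single 1 1 : Site 2) 1 = p 1 - 1 := by simp
    simp [c0, c1]
    omega
  rw [s1, s2, s3, s4]
  have e1 : p - Pi.single 1 1 + 1 = p + Pi.single 0 1 := by
    ext i; fin_cases i <;> simp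
  have e2 : p - Pi.single 0 1 - Pi.single 1 1 + 1 = p := by
    ext i; fin_cases i <;> simp
  have e3 : p - Pi.single 0 1 + 1 = p + Pi.single 1 1 := by
    ext i; fin_cases i <;> simp
  have e4 : p - Pi.single 1 1 - Pi.single 0 1 + 1 = p := by
    ext i; fin_cases i <;> simp
  simp only [curH, curV, e1, e2, e3, e4]
  rw [cur_of_adj hR, cur_of_adj hL, cur_of_adj hB,
    show p + Pi.single 1 1 + Pi.single 0 1 = p + Pi.single 0 1 + Pi.single 1 1 by abel,
    cur_of_adj (show (domainGraph Ω δ).Adj (p + Pi.single 1 1) (p + Pi.single 0 1 + Pi.single 1 1) by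
      simpa [add_comm, add_left_comm, add_assoc] using hT)]
  ring

end Conjugate

/-! ### §D3c. Exterior paths avoiding a small ball about a boundary point -/

section ExteriorAvoidance

open Literature.Topology.PlaneTopology Literature.Probability.RandomPlanarGeometry

/-- **Exterior paths avoid small balls about boundary points.** For a Jordan domain `D` and
`ε > 0` there is `ρ > 0` such that any two exterior points at distance `≥ ε` from a boundary
point `q` are joined by a path in the exterior avoiding `B̄(q, ρ)`. Proof: by uniform continuity
of the boundary loop and of its inverse, the boundary points in `B̄(q, ρ)` lie on a sub-arc `A`
of diameter `< ε/2`; neither `J = ∂D` (the exterior is connected) nor the compact set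
`A ∪ B̄(q, ρ) ⊆ B(q, ε/2)` (whose complement contains the connected set `{dist(·, q) > ε/2}`)
separates the two points, and `(A ∪ B̄(q, ρ)) ∩ J = A` is connected, so by Janiszewski's theorem
`J ∪ B̄(q, ρ)` does not separate them. [folklore] -/
theorem JordanDomain.exists_joinedIn_exterior_diff_closedBall (D : JordanDomain) {ε : ℝ} (hε : 0 < ε) :
    ∃ ρ > 0, ∀ (s₀ : ℝ) (e y : ℂ), e ∈ (closure D.carrier)ᶜ → y ∈ (closure D.carrier)ᶜ →
      ε ≤ dist e (D.boundary s₀) → ε ≤ dist y (D.boundary s₀) →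
      JoinedIn ((closure D.carrier)ᶜ \ closedBall (D.boundary s₀) ρ) e y := by
  obtain ⟨τ, hτ, hτ2, hτε⟩ := D.exists_forall_dist_boundary_lt (half_pos hε)
  obtain ⟨m, hm, hmd⟩ := D.exists_pos_le_dist_boundary hτ hτ2
  refine ⟨min (m / 2) (ε / 4), by positivity, fun s₀ e y he hy hεe hεy => ?_⟩
  set ρ := min (m / 2) (ε / 4) with hρ
  set q := D.boundary s₀ with hq
  set A : Set ℂ := D.boundary '' Icc (s₀ - τ) (s₀ + τ) with hA
  -- boundary points in `B̄(q, ρ)` lie on the short arc `A`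
  have hJρ : frontier D.carrier ∩ closedBall q ρ ⊆ A := by
    rintro z ⟨hzJ, hzρ⟩
    rw [← D.range_boundary] at hzJ
    obtain ⟨t, rfl⟩ := hzJ
    obtain ⟨t', ht', htt'⟩ := D.periodic_boundary.exists_mem_Ico one_pos t (s₀ - 1 / 2)
    rw [htt'] at hzρ ⊢
    refine ⟨t', ?_, rfl⟩
    by_contra hout
    rw [mem_Icc, not_and_or, not_le, not_le] at hout
    rw [mem_closedBall] at hzρ
    have hρm : ρ < m := by rw [hρ]; linarith [min_le_left (m / 2) (ε / 4)]
    rcases hout with h1 | h1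
    · -- `t' < s₀ - τ`: apply the separation bound to `(t', s₀)`
      have := hmd t' s₀ (by linarith) (by linarith [ht'.1])
      rw [← hq] at this
      linarith
    · have := hmd s₀ t' (by linarith) (by linarith [ht'.2])
      rw [← hq, _root_.dist_comm] at this
      linarith
  -- the arc is within `ε/2` of `q`
  have hAq : A ⊆ ball q (ε / 2) := by
    rintro _ ⟨t, ht, rfl⟩
    rw [Metric.mem_ball, hq]
    exact hτε t s₀ (by rw [abs_le]; constructor <;> linarith [ht.1, ht.2])
  have hAc : IsCompact A := isCompact_Icc.image_of_continuousOn D.continuous_boundary.continuousOn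
  have hApre : IsPreconnected A :=
    (isPreconnected_Icc.image _ D.continuous_boundary.continuousOn)
  -- Janiszewski with `𝒜 = A ∪ B̄(q, ρ)` and `ℬ = J`
  set 𝒜 : Set ℂ := A ∪ closedBall q ρ with h𝒜
  have h𝒜c : IsCompact 𝒜 := hAc.union (isCompact_closedBall q ρ)
  have hJc : IsCompact (frontier D.carrier) :=
    Metric.isCompact_of_isClosed_isBounded isClosed_frontier
      (D.isBounded.closure.subset frontier_subset_closure)
  have h𝒜J : 𝒜 ∩ frontier D.carrier = A := by
    apply Subset.antisymm
    · rintro z ⟨hz | hz, hzJ⟩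
      · exact hz
      · exact hJρ ⟨hzJ, hz⟩
    · rintro z hz
      refine ⟨Or.inl hz, ?_⟩
      obtain ⟨t, -, rfl⟩ := hz
      exact D.boundary_mem_frontier t
  have h𝒜sub : 𝒜 ⊆ ball q (ε / 2) := union_subset hAq (closedBall_subset_ball (by
    rw [hρ]; linarith [min_le_right (m / 2) (ε / 4)]))
  -- the complement of `B(q, ε/2)`-closure… : the far region `{ε/2 < dist z q}` is connected
  have hfar : IsConnected {z : ℂ | ε / 2 < dist z q} := by
    have := (isConnected_setOf_lt_norm (half_pos hε).le).image (fun z => z + q) (by fun_prop)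
    convert this using 1
    ext z
    simp only [mem_setOf_eq, mem_image, dist_eq_norm]
    constructor
    · intro hz; exact ⟨z - q, by simpa using hz, by abel⟩
    · rintro ⟨w, hw, rfl⟩; simpa using hw
  have hS𝒜 : ∃ S ⊆ 𝒜ᶜ, IsPreconnected S ∧ e ∈ S ∧ y ∈ S := by
    refine ⟨{z : ℂ | ε / 2 < dist z q}, fun z hz hz𝒜 => ?_, hfar.isPreconnected, ?_, ?_⟩
    · have := h𝒜sub hz𝒜
      rw [Metric.mem_ball] at this
      exact lt_asymm hz this
    · show ε / 2 < dist e q; linarith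
    · show ε / 2 < dist y q; linarith
  have hSJ : ∃ S ⊆ (frontier D.carrier)ᶜ, IsPreconnected S ∧ e ∈ S ∧ y ∈ S :=
    ⟨(closure D.carrier)ᶜ, fun z hz hzJ => hz (frontier_subset_closure hzJ),
      D.isConnected_exterior.isPreconnected, he, hy⟩
  obtain ⟨S, hS, hSpre, heS, hyS⟩ := janiszewski' h𝒜c hJc (by rw [h𝒜J]; exact hApre) hS𝒜 hSJ
  -- `S` lies in the exterior and misses the ball
  have hSE : S ⊆ (closure D.carrier)ᶜ :=
    D.subset_exterior_of_isPreconnected hSpre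
      (Set.disjoint_left.2 fun z hz hzJ => hS hz (Or.inr hzJ)) ⟨e, heS, he⟩
  have hSU : S ⊆ (closure D.carrier)ᶜ \ closedBall q ρ := fun z hz =>
    ⟨hSE hz, fun hzρ => hS hz (Or.inl (Or.inr hzρ))⟩
  exact joinedIn_of_isPreconnected (D.isOpen_exterior.sdiff isClosed_closedBall) hSpre hSU heS hyS

end ExteriorAvoidance

/-! ### §D3d. Justified shadows: walks of squares along a path outside `Ω` -/

section JustifiedShadow

variable {δ : ℝ}

/-- Closed squares are closed. [folklore] -/
theorem isClosed_closedSq (δ : ℝ) (q : Site 2) : IsClosed (closedSq δ q) := by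
  have e : closedSq δ q = {z : ℂ | δ * q 0 ≤ z.re} ∩ {z | z.re ≤ δ * (q 0 + 1)} ∩ {z | δ * q 1 ≤ z.im} ∩
      {z | z.im ≤ δ * (q 1 + 1)} := by
    ext z; simp [closedSq, and_assoc]
  rw [e]
  refine ((IsClosed.inter ?_ ?_).inter ?_).inter ?_
  · exact isClosed_le continuous_const Complex.continuous_re
  · exact isClosed_le Complex.continuous_re continuous_const
  · exact isClosed_le continuous_const Complex.continuous_im
  · exact isClosed_le Complex.continuous_im continuous_const

/-- Two closed squares of the mesh with a common point are at sup-distance `≤ 1`. [folklore] -/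
theorem abs_sub_le_one_of_mem_closedSq (hδ : 0 < δ) {Q Q' : Site 2} {z : ℂ} (hz : z ∈ closedSq δ Q)
    (hz' : z ∈ closedSq δ Q') (i : Fin 2) : |Q' i - Q i| ≤ 1 := by
  obtain ⟨h0, h0', h1, h1'⟩ := hz
  obtain ⟨g0, g0', g1, g1'⟩ := hz'
  have key : ∀ (a : ℝ) (k k' : ℤ), δ * k ≤ a → a ≤ δ * (k + 1) → δ * k' ≤ a → a ≤ δ * (k' + 1) → |k' - k| ≤ 1 := by
    intro a k k' hk hk1 hk' hk'1
    have e1 : δ * k ≤ δ * (k' + 1) := by linarith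
    have e2 : δ * k' ≤ δ * (k + 1) := by linarith
    have f1 : (k : ℝ) ≤ k' + 1 := le_of_mul_le_mul_left e1 hδ
    have f2 : (k' : ℝ) ≤ k + 1 := le_of_mul_le_mul_left e2 hδ
    have g1 : k ≤ k' + 1 := by exact_mod_cast f1
    have g2 : k' ≤ k + 1 := by exact_mod_cast f2
    rw [abs_le]; omega
  fin_cases i
  · exact key z.re _ _ h0 h0' g0 g0'
  · exact key z.im _ _ h1 h1' g1 g1'

/-- The side crossed by the step `x → y` of a walk of squares, as a closed segment of the plane:
the primal edge `sepEdge x y` rescaled by `δ`. [folklore] -/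
def sideSeg (δ : ℝ) (x y : Site 2) : Set ℂ :=
  segment ℝ (meshPoint δ (sepLo x y)) (meshPoint δ (sepHi x y))

/-- A common point of a square and its right neighbour lies on the common side. [folklore] -/
theorem mem_sideSeg_right (hδ : 0 < δ) {Q : Site 2} {z : ℂ} (hz : z ∈ closedSq δ Q)
    (hz' : z ∈ closedSq δ (Q + Pi.single 0 1)) : z ∈ sideSeg δ Q (Q + Pi.single 0 1) := by
  obtain ⟨h0, h0', h1, h1'⟩ := hz
  obtain ⟨g0, -, -, -⟩ := hz'
  simp only [Pi.add_apply, Pi.single_eq_same, Int.cast_add, Int.cast_one] at g0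
  have hre : z.re = δ * (Q 0 + 1) := le_antisymm h0' g0
  rw [sideSeg, sepLo_add_e0, sepHi_add_e0]
  have e1 : meshPoint δ (Q + Pi.single 0 1) = ⟨δ * (Q 0 + 1), δ * Q 1⟩ := Complex.ext (by simp) (by simp)
  have e2 : meshPoint δ (Q + Pi.single 0 1 + Pi.single 1 1) = ⟨δ * (Q 0 + 1), δ * (Q 1 + 1)⟩ :=
    Complex.ext (by simp) (by simp)
  have ez : z = ⟨δ * (Q 0 + 1), z.im⟩ := Complex.ext hre rfl
  rw [e1, e2, ez]
  exact mem_segment_vertical h1 h1' (by nlinarith)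

/-- A common point of a square and its upper neighbour lies on the common side. [folklore] -/
theorem mem_sideSeg_up (hδ : 0 < δ) {Q : Site 2} {z : ℂ} (hz : z ∈ closedSq δ Q)
    (hz' : z ∈ closedSq δ (Q + Pi.single 1 1)) : z ∈ sideSeg δ Q (Q + Pi.single 1 1) := by
  obtain ⟨h0, h0', h1, h1'⟩ := hz
  obtain ⟨-, -, g1, -⟩ := hz'
  simp only [Pi.add_apply, Pi.single_eq_same, Int.cast_add, Int.cast_one] at g1
  have him : z.im = δ * (Q 1 + 1) := le_antisymm h1' g1
  rw [sideSeg, sepLo_add_e1, sepHi_add_e1]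
  have e1 : meshPoint δ (Q + Pi.single 1 1) = ⟨δ * Q 0, δ * (Q 1 + 1)⟩ := Complex.ext (by simp) (by simp)
  have e2 : meshPoint δ (Q + Pi.single 1 1 + Pi.single 0 1) = ⟨δ * (Q 0 + 1), δ * (Q 1 + 1)⟩ :=
    Complex.ext (by simp) (by simp)
  have ez : z = ⟨z.re, δ * (Q 1 + 1)⟩ := Complex.ext rfl him
  rw [e1, e2, ez]
  exact mem_segment_horizontal h0 h0' (by nlinarith)

/-- The crossed side does not depend on the direction of the step. [folklore] -/
theorem sideSeg_comm (δ : ℝ) (x y : Site 2) : sideSeg δ y x = sideSeg δ x y := by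
  rw [sideSeg, sideSeg, sepLo_comm, sepHi_comm]

/-- **Static connection.** Two squares of the mesh containing a common point `z ∉ Ω`… more
generally any common point `z`: there is a walk of squares of length `≤ 2` from one to the other
all of whose crossed sides contain `z` and all of whose squares contain `z`. [folklore] -/
theorem exists_walk_of_mem_closedSq (hδ : 0 < δ) {Q Q' : Site 2} {z : ℂ} (hz : z ∈ closedSq δ Q)
    (hz' : z ∈ closedSq δ Q') :
    ∃ ω : (zdGraph 2).Walk Q Q', (∀ d ∈ ω.darts, z ∈ sideSeg δ d.fst d.snd) ∧
      ∀ q ∈ ω.support, z ∈ closedSq δ q := by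
  have ha := abs_sub_le_one_of_mem_closedSq hδ hz hz' 0
  have hb := abs_sub_le_one_of_mem_closedSq hδ hz hz' 1
  rw [abs_le] at ha hb
  -- one-step connections
  have step : ∀ {P P' : Site 2}, z ∈ closedSq δ P → z ∈ closedSq δ P' →
      (P' = P + Pi.single 0 1 ∨ P' = P + Pi.single 1 1 ∨ P = P' + Pi.single 0 1 ∨ P = P' + Pi.single 1 1) →
      ∃ ω : (zdGraph 2).Walk P P', (∀ d ∈ ω.darts, z ∈ sideSeg δ d.fst d.snd) ∧
        ∀ q ∈ ω.support, z ∈ closedSq δ q := by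
    intro P P' hP hP' hdir
    have hadj : (zdGraph 2).Adj P P' := by
      rcases hdir with rfl | rfl | rfl | rfl
      · exact adj_of_stepKind (.right (by simp) (by simp))
      · exact adj_of_stepKind (.up (by simp) (by simp))
      · exact adj_of_stepKind (.left (by simp) (by simp))
      · exact adj_of_stepKind (.down (by simp) (by simp))
    refine ⟨Walk.cons hadj Walk.nil, ?_, ?_⟩
    · intro d hd
      simp only [Walk.darts_cons, Walk.darts_nil, List.mem_singleton] at hd
      subst hd
      rcases hdir with rfl | rfl | rfl | rfl
      · exact mem_sideSeg_right hδ hP hP'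
      · exact mem_sideSeg_up hδ hP hP'
      · change z ∈ sideSeg δ (P' + Pi.single 0 1) P'
        rw [sideSeg_comm]
        exact mem_sideSeg_right hδ hP' hP
      · change z ∈ sideSeg δ (P' + Pi.single 1 1) P'
        rw [sideSeg_comm]
        exact mem_sideSeg_up hδ hP' hP
    · intro q hq
      simp only [Walk.support_cons, Walk.support_nil, List.mem_cons, List.not_mem_nil,
        or_false] at hq
      rcases hq with rfl | rfl
      · exact hP
      · exact hP'
  -- coordinates of `z`
  obtain ⟨h0, h0', h1, h1'⟩ := hz
  obtain ⟨g0, g0', g1, g1'⟩ := hz'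
  -- the intermediate square `M = (Q' 0, Q 1)` contains `z`
  set M : Site 2 := ![Q' 0, Q 1] with hM
  have hzM : z ∈ closedSq δ M := by
    refine ⟨by simp [hM]; exact g0, by simp [hM]; exact g0', by simp [hM]; exact h1, by simp [hM]; exact h1'⟩
  have hzQ : z ∈ closedSq δ Q := ⟨h0, h0', h1, h1'⟩
  have hzQ' : z ∈ closedSq δ Q' := ⟨g0, g0', g1, g1'⟩
  -- `Q → M` (horizontal or trivial) then `M → Q'` (vertical or trivial)
  have hQM : Q = M ∨ (M = Q + Pi.single 0 1 ∨ M = Q + Pi.single 1 1 ∨ Q = M + Pi.single 0 1 ∨ Q = M + Pi.single 1 1) := by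
    rcases (show Q' 0 - Q 0 = 0 ∨ Q' 0 - Q 0 = 1 ∨ Q' 0 - Q 0 = -1 by omega) with e | e | e
    · left; (ext i; fin_cases i <;> simp [hM]); omega
    · right; left; (ext i; fin_cases i <;> simp [hM]); omega
    · right; right; right; left; (ext i; fin_cases i <;> simp [hM]); omega
  have hMQ' : M = Q' ∨ (Q' = M + Pi.single 0 1 ∨ Q' = M + Pi.single 1 1 ∨ M = Q' + Pi.single 0 1 ∨ M = Q' + Pi.single 1 1) := by
    rcases (show Q' 1 - Q 1 = 0 ∨ Q' 1 - Q 1 = 1 ∨ Q' 1 - Q 1 = -1 by omega) with e | e | e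
    · left; (ext i; fin_cases i <;> simp [hM]); omega
    · right; right; left; (ext i; fin_cases i <;> simp [hM]); omega
    · right; right; right; right; (ext i; fin_cases i <;> simp [hM]); omega
  obtain ⟨ω₁, hω₁, hω₁s⟩ : ∃ ω : (zdGraph 2).Walk Q M, (∀ d ∈ ω.darts, z ∈ sideSeg δ d.fst d.snd) ∧
      ∀ q ∈ ω.support, z ∈ closedSq δ q := by
    rcases hQM with e | hdir
    · exact ⟨Walk.nil.copy rfl e, by simp, by simpa using hzQ⟩
    · exact step hzQ hzM hdir
  obtain ⟨ω₂, hω₂, hω₂s⟩ : ∃ ω : (zdGraph 2).Walk M Q', (∀ d ∈ ω.darts, z ∈ sideSeg δ d.fst d.snd) ∧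
      ∀ q ∈ ω.support, z ∈ closedSq δ q := by
    rcases hMQ' with e | hdir
    · exact ⟨Walk.nil.copy rfl e, by simp, by simpa using hzM⟩
    · exact step hzM hzQ' hdir
  refine ⟨ω₁.append ω₂, fun d hd => ?_, fun q hq => ?_⟩
  · rw [Walk.darts_append, List.mem_append] at hd
    exact hd.elim (hω₁ d) (hω₂ d)
  · rw [Walk.mem_support_append_iff] at hq
    exact hq.elim (hω₁s q) (hω₂s q)

end JustifiedShadow

section JustifiedShadow2

variable {δ : ℝ}

/-- **Last-exit construction inside one window.** If on `[t₀, v]` the path stays in the union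
of the closed squares of a finite set `A`, and `γ t₀` lies in the square `Q ∈ A`, there is a
walk of squares from `Q` to a square containing `γ v`, every step crossing a side at a point of
the path and every square containing a point of the path (induction on `|A|`: leave `Q` for the
last time, pass to a square containing that point, never come back). [folklore] -/
theorem exists_walk_window (hδ : 0 < δ) {γ : ℝ → ℂ} {u v : ℝ} (hγ : ContinuousOn γ (Icc u v)) :
    ∀ (A : Finset (Site 2)) (t₀ : ℝ) (Q : Site 2), t₀ ∈ Icc u v → Q ∈ A → γ t₀ ∈ closedSq δ Q →
      (∀ t ∈ Icc t₀ v, ∃ Q' ∈ A, γ t ∈ closedSq δ Q') →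
      ∃ (Qe : Site 2) (ω : (zdGraph 2).Walk Q Qe), γ v ∈ closedSq δ Qe ∧
        (∀ d ∈ ω.darts, ∃ t ∈ Icc u v, γ t ∈ sideSeg δ d.fst d.snd) ∧
        ∀ q ∈ ω.support, ∃ t ∈ Icc u v, γ t ∈ closedSq δ q := by
  classical
  intro A
  induction A using Finset.strongInduction with
  | H A ih =>
  intro t₀ Q ht₀ hQA hQ hcover
  -- the last time in `Q`
  set Z : Set ℝ := Icc t₀ v ∩ γ ⁻¹' closedSq δ Q with hZ
  have hZc : IsClosed Z :=
    (hγ.mono (Icc_subset_Icc ht₀.1 le_rfl)).preimage_isClosed_of_isClosed isClosed_Icc (isClosed_closedSq δ Q)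
  have ht₀v : t₀ ≤ v := ht₀.2
  have ht₀Z : t₀ ∈ Z := ⟨⟨le_rfl, ht₀v⟩, hQ⟩
  have hZbdd : BddAbove Z := ⟨v, fun t ht => ht.1.2⟩
  set t₁ := sSup Z with ht₁
  have ht₁Z : t₁ ∈ Z := hZc.csSup_mem ⟨t₀, ht₀Z⟩ hZbdd
  have ht₁I : t₁ ∈ Icc u v := ⟨ht₀.1.trans ht₁Z.1.1, ht₁Z.1.2⟩
  rcases ht₁Z.1.2.eq_or_lt with hv | hlt
  · -- the path ends inside `Q`
    refine ⟨Q, Walk.nil, ?_, by simp, fun q hq => ?_⟩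
    · rw [← hv]; exact ht₁Z.2
    · simp only [Walk.support_nil, List.mem_singleton] at hq
      subst hq
      exact ⟨t₀, ht₀, hQ⟩
  · -- after `t₁` the path is in the other squares
    have hafter : ∀ t ∈ Ioc t₁ v, ∃ Q' ∈ A.erase Q, γ t ∈ closedSq δ Q' := by
      intro t ht
      have htI : t ∈ Icc t₀ v := ⟨ht₁Z.1.1.trans ht.1.le, ht.2⟩
      obtain ⟨Q', hQ'A, hQ'⟩ := hcover t htI
      refine ⟨Q', Finset.mem_erase.2 ⟨?_, hQ'A⟩, hQ'⟩
      rintro rfl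
      have : t ≤ t₁ := le_csSup hZbdd ⟨htI, hQ'⟩
      linarith [ht.1]
    set U : Set ℂ := ⋃ Q' ∈ A.erase Q, closedSq δ Q' with hU
    have hUc : IsClosed U := isClosed_biUnion_finset fun Q' _ => isClosed_closedSq δ Q'
    have hZ'c : IsClosed (Icc t₁ v ∩ γ ⁻¹' U) :=
      (hγ.mono (Icc_subset_Icc ht₁I.1 le_rfl)).preimage_isClosed_of_isClosed isClosed_Icc hUc
    have hsub : Ioc t₁ v ⊆ Icc t₁ v ∩ γ ⁻¹' U := fun t ht => by
      obtain ⟨Q', hQ', hγt⟩ := hafter t ht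
      exact ⟨⟨ht.1.le, ht.2⟩, mem_biUnion hQ' hγt⟩
    have ht₁U : t₁ ∈ Icc t₁ v ∩ γ ⁻¹' U := by
      have := (hZ'c.closure_subset_iff.2 hsub)
      rw [closure_Ioc hlt.ne] at this
      exact this ⟨le_rfl, hlt.le⟩
    obtain ⟨Q'', hQ''A, hQ''⟩ : ∃ Q'' ∈ A.erase Q, γ t₁ ∈ closedSq δ Q'' := by
      simpa [hU] using ht₁U.2
    -- static connection `Q → Q''` at the point `γ t₁`
    obtain ⟨ω₁, hω₁, hω₁s⟩ := exists_walk_of_mem_closedSq hδ ht₁Z.2 hQ''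
    -- recursive call on `A.erase Q`
    have hsub' : A.erase Q ⊂ A := Finset.erase_ssubset hQA
    obtain ⟨Qe, ω₂, hQe, hω₂, hω₂s⟩ := ih (A.erase Q) hsub' t₁ Q'' ht₁I hQ''A hQ'' fun t ht => by
      rcases ht.1.eq_or_lt with h | h
      · exact ⟨Q'', hQ''A, h ▸ hQ''⟩
      · exact hafter t ⟨h, ht.2⟩
    refine ⟨Qe, ω₁.append ω₂, hQe, fun d hd => ?_, fun q hq => ?_⟩
    · rw [Walk.darts_append, List.mem_append] at hd
      rcases hd with hd | hd
      · exact ⟨t₁, ht₁I, hω₁ d hd⟩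
      · exact hω₂ d hd
    · rw [Walk.mem_support_append_iff] at hq
      rcases hq with hq | hq
      · exact ⟨t₁, ht₁I, hω₁s q hq⟩
      · exact hω₂s q hq

/-- The floor squares of points within `δ/4` of `w` lie in the `2 × 2` block with lower-left
square `floorSq δ (w - δ/4 (1 + i))`. [folklore] -/
theorem floorSq_mem_block (hδ : 0 < δ) {w z : ℂ} (h : dist z w < δ / 4) :
    ∃ a b : ℤ, (a = 0 ∨ a = 1) ∧ (b = 0 ∨ b = 1) ∧
      floorSq δ z = floorSq δ (w - (δ / 4 : ℝ) * (1 + Complex.I)) + ![a, b] := by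
  have hre : |z.re - w.re| < δ / 4 := (Complex.abs_re_le_norm (z - w)).trans_lt (by rwa [← Complex.dist_eq])
  have him : |z.im - w.im| < δ / 4 := (Complex.abs_im_le_norm (z - w)).trans_lt (by rwa [← Complex.dist_eq])
  have key : ∀ x y : ℝ, |x - y| < δ / 4 → ⌊x / δ⌋ = ⌊(y - δ / 4) / δ⌋ ∨ ⌊x / δ⌋ = ⌊(y - δ / 4) / δ⌋ + 1 := by
    intro x y hxy
    rw [abs_lt] at hxy
    set q := ⌊(y - δ / 4) / δ⌋ with hq
    have h1 := Int.floor_le ((y - δ / 4) / δ)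
    have h2 := Int.lt_floor_add_one ((y - δ / 4) / δ)
    rw [le_div_iff₀ hδ] at h1
    rw [div_lt_iff₀ hδ] at h2
    have lo : q ≤ ⌊x / δ⌋ := by
      rw [Int.le_floor, le_div_iff₀ hδ]; linarith
    have hi : ⌊x / δ⌋ < q + 2 := by
      rw [Int.floor_lt, div_lt_iff₀ hδ]; push_cast; nlinarith
    omega
  obtain ha := key z.re w.re hre
  obtain hb := key z.im w.im him
  rcases ha with ha | ha <;> rcases hb with hb | hb
  · exact ⟨0, 0, Or.inl rfl, Or.inl rfl, by ext i; fin_cases i <;> simp [floorSq, ha, hb]⟩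
  · exact ⟨0, 1, Or.inl rfl, Or.inr rfl, by ext i; fin_cases i <;> simp [floorSq, ha, hb]⟩
  · exact ⟨1, 0, Or.inr rfl, Or.inl rfl, by ext i; fin_cases i <;> simp [floorSq, ha, hb]⟩
  · exact ⟨1, 1, Or.inr rfl, Or.inr rfl, by ext i; fin_cases i <;> simp [floorSq, ha, hb]⟩

/-- **Justified shadow of a path.** A path, continuous on `[a, b]`, from a point of the closed
square `P` to a point of the closed square `P'` is shadowed by a walk of squares from `P` to `P'`
each of whose steps crosses a side of the mesh AT A POINT OF THE PATH, every square visited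
containing a point of the path. (When the path avoids `Ω`, no crossed side is an edge of `Ω_n`.) [folklore] -/
theorem exists_dualWalk_of_path (hδ : 0 < δ) {γ : ℝ → ℂ} {a b : ℝ} (hab : a ≤ b) (hγ : ContinuousOn γ (Icc a b))
    {P P' : Site 2} (hP : γ a ∈ closedSq δ P) (hP' : γ b ∈ closedSq δ P') :
    ∃ ω : (zdGraph 2).Walk P P', (∀ d ∈ ω.darts, ∃ t ∈ Icc a b, γ t ∈ sideSeg δ d.fst d.snd) ∧
      ∀ q ∈ ω.support, ∃ t ∈ Icc a b, γ t ∈ closedSq δ q := by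
  classical
  -- uniform continuity: windows on which the path moves by `< δ/4`
  obtain ⟨η, hη, hU⟩ := Metric.uniformContinuousOn_iff.1 (isCompact_Icc.uniformContinuousOn_of_continuous hγ)
    (δ / 4) (by positivity)
  obtain ⟨N, hN⟩ := exists_nat_gt ((b - a) / η)
  have hNpos : 0 < N := by
    have : (0 : ℝ) < N := lt_of_le_of_lt (div_nonneg (sub_nonneg.2 hab) hη.le) hN
    exact_mod_cast this
  have hNr : (0 : ℝ) < N := by exact_mod_cast hNpos
  set L : ℝ := (b - a) / N with hL
  have hL0 : 0 ≤ L := div_nonneg (sub_nonneg.2 hab) hNr.le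
  have hLη : L < η := by rw [hL, div_lt_iff₀ hNr]; rw [div_lt_iff₀ hη] at hN; linarith
  set τ : ℕ → ℝ := fun k => a + k * L with hτ
  have hτ0 : τ 0 = a := by simp [hτ]
  have hτN : τ N = b := by simp only [hτ, hL]; field_simp; ring
  have hτmono : ∀ k k' : ℕ, k ≤ k' → τ k ≤ τ k' := fun k k' h => by
    simp only [hτ]; have : (k : ℝ) ≤ k' := by exact_mod_cast h
    nlinarith
  have hτI : ∀ k : ℕ, k ≤ N → τ k ∈ Icc a b := fun k hk =>
    ⟨by rw [← hτ0]; exact hτmono 0 k (Nat.zero_le _), by rw [← hτN]; exact hτmono k N hk⟩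
  -- one window
  have window : ∀ k : ℕ, k + 1 ≤ N →
      ∃ ω : (zdGraph 2).Walk (floorSq δ (γ (τ k))) (floorSq δ (γ (τ (k + 1)))),
        (∀ d ∈ ω.darts, ∃ t ∈ Icc a b, γ t ∈ sideSeg δ d.fst d.snd) ∧
        ∀ q ∈ ω.support, ∃ t ∈ Icc a b, γ t ∈ closedSq δ q := by
    intro k hk
    have hkI := hτI k (by omega)
    have hk1I := hτI (k + 1) hk
    have hkk1 : τ k ≤ τ (k + 1) := hτmono k (k + 1) (by omega)
    have hIsub : Icc (τ k) (τ (k + 1)) ⊆ Icc a b := Icc_subset_Icc hkI.1 hk1I.2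
    have hnear : ∀ t ∈ Icc (τ k) (τ (k + 1)), dist (γ t) (γ (τ k)) < δ / 4 := by
      intro t ht
      refine hU t (hIsub ht) (τ k) hkI ?_
      rw [Real.dist_eq, abs_of_nonneg (by linarith [ht.1])]
      have : τ (k + 1) - τ k = L := by simp only [hτ]; push_cast; ring
      linarith [ht.2]
    -- the block
    set Q₀ := floorSq δ (γ (τ k) - (δ / 4 : ℝ) * (1 + Complex.I)) with hQ₀
    set A : Finset (Site 2) := {Q₀, Q₀ + ![0, 1], Q₀ + ![1, 0], Q₀ + ![1, 1]} with hA
    have h00 : (![0, 0] : Site 2) = 0 := by ext i; fin_cases i <;> rfl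
    have hmemA : ∀ a' b' : ℤ, (a' = 0 ∨ a' = 1) → (b' = 0 ∨ b' = 1) → Q₀ + ![a', b'] ∈ A := by
      intro a' b' ha' hb'
      rw [hA]
      rcases ha' with rfl | rfl <;> rcases hb' with rfl | rfl <;> simp [h00]
    have hcover : ∀ t ∈ Icc (τ k) (τ (k + 1)), ∃ Q' ∈ A, γ t ∈ closedSq δ Q' := by
      intro t ht
      obtain ⟨a', b', ha', hb', he⟩ := floorSq_mem_block hδ (hnear t ht)
      refine ⟨floorSq δ (γ t), ?_, mem_closedSq_floorSq hδ _⟩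
      rw [he]
      exact hmemA a' b' ha' hb'
    -- we start from `floorSq (γ (τ k))`, which is in `A`
    have hstartA : floorSq δ (γ (τ k)) ∈ A := by
      obtain ⟨a', b', ha', hb', he⟩ := floorSq_mem_block hδ (hnear (τ k) ⟨le_rfl, hkk1⟩)
      rw [he]
      exact hmemA a' b' ha' hb'
    obtain ⟨Qe, ω₁, hQe, hω₁, hω₁s⟩ := exists_walk_window hδ (hγ.mono hIsub) A (τ k) (floorSq δ (γ (τ k)))
      ⟨le_rfl, hkk1⟩ hstartA (mem_closedSq_floorSq hδ _) hcover
    obtain ⟨ω₂, hω₂, hω₂s⟩ := exists_walk_of_mem_closedSq hδ hQe (mem_closedSq_floorSq hδ (γ (τ (k + 1))))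
    refine ⟨ω₁.append ω₂, fun d hd => ?_, fun q hq => ?_⟩
    · rw [Walk.darts_append, List.mem_append] at hd
      rcases hd with hd | hd
      · obtain ⟨t, ht, h⟩ := hω₁ d hd; exact ⟨t, hIsub ht, h⟩
      · exact ⟨τ (k + 1), hk1I, hω₂ d hd⟩
    · rw [Walk.mem_support_append_iff] at hq
      rcases hq with hq | hq
      · obtain ⟨t, ht, h⟩ := hω₁s q hq; exact ⟨t, hIsub ht, h⟩
      · exact ⟨τ (k + 1), hk1I, hω₂s q hq⟩
  -- chain the windows
  have chain : ∀ m : ℕ, m ≤ N → ∃ ω : (zdGraph 2).Walk (floorSq δ (γ (τ 0))) (floorSq δ (γ (τ m))),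
      (∀ d ∈ ω.darts, ∃ t ∈ Icc a b, γ t ∈ sideSeg δ d.fst d.snd) ∧
      ∀ q ∈ ω.support, ∃ t ∈ Icc a b, γ t ∈ closedSq δ q := by
    intro m
    induction m with
    | zero =>
      intro _
      exact ⟨Walk.nil, by simp, fun q hq => by
        simp only [Walk.support_nil, List.mem_singleton] at hq
        subst hq
        exact ⟨τ 0, hτI 0 (Nat.zero_le _), mem_closedSq_floorSq hδ _⟩⟩
    | succ m ihm =>
      intro hm
      obtain ⟨ω₁, hω₁, hω₁s⟩ := ihm (by omega)
      obtain ⟨ω₂, hω₂, hω₂s⟩ := window m hm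
      refine ⟨ω₁.append ω₂, fun d hd => ?_, fun q hq => ?_⟩
      · rw [Walk.darts_append, List.mem_append] at hd
        exact hd.elim (hω₁ d) (hω₂ d)
      · rw [Walk.mem_support_append_iff] at hq
        exact hq.elim (hω₁s q) (hω₂s q)
  obtain ⟨ωm, hωm, hωms⟩ := chain N le_rfl
  set ωm' : (zdGraph 2).Walk (floorSq δ (γ a)) (floorSq δ (γ b)) := ωm.copy (by rw [hτ0]) (by rw [hτN]) with hωm'
  -- and the two ends
  obtain ⟨ω₀, hω₀, hω₀s⟩ := exists_walk_of_mem_closedSq hδ hP (mem_closedSq_floorSq hδ (γ a))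
  obtain ⟨ω₃, hω₃, hω₃s⟩ := exists_walk_of_mem_closedSq hδ (mem_closedSq_floorSq hδ (γ b)) hP'
  have haI : a ∈ Icc a b := ⟨le_rfl, hab⟩
  have hbI : b ∈ Icc a b := ⟨hab, le_rfl⟩
  refine ⟨ω₀.append (ωm'.append ω₃), fun d hd => ?_, fun q hq => ?_⟩
  · simp only [Walk.darts_append, List.mem_append, hωm', Walk.darts_copy] at hd
    rcases hd with hd | hd | hd
    · exact ⟨a, haI, hω₀ d hd⟩
    · exact hωm d hd
    · exact ⟨b, hbI, hω₃ d hd⟩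
  · simp only [Walk.mem_support_append_iff, hωm', Walk.support_copy] at hq
    rcases hq with hq | hq | hq
    · exact ⟨a, haI, hω₀s q hq⟩
    · exact hωms q hq
    · exact ⟨b, hbI, hω₃s q hq⟩

end JustifiedShadow2

/-! ### §D5. Exits of the dual component and their virtual values -/

section Exits

open WeakBeurling

variable {Ω : Set ℂ} {δ : ℝ}

/-- Two points of a closed square of the mesh are within `2δ`. [folklore] -/
theorem dist_le_of_mem_closedSq {Q : Site 2} {z w : ℂ} (hz : z ∈ closedSq δ Q)
    (hw : w ∈ closedSq δ Q) : dist z w ≤ 2 * δ := by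
  obtain ⟨h0, h0', h1, h1'⟩ := hz
  obtain ⟨g0, g0', g1, g1'⟩ := hw
  rw [Complex.dist_eq]
  refine (Complex.norm_le_abs_re_add_abs_im _).trans ?_
  simp only [Complex.sub_re, Complex.sub_im]
  have : |z.re - w.re| ≤ δ := by rw [abs_le]; constructor <;> linarith
  have : |z.im - w.im| ≤ δ := by rw [abs_le]; constructor <;> linarith
  linarith

/-- A step of a walk of squares whose crossed side contains a point outside `Ω` carries no
current. [folklore] -/
theorem stepFlux_eq_zero_of_mem_sideSeg (h : Site 2 → ℝ) {x y : Site 2} (hxy : (zdGraph 2).Adj x y)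
    {w : ℂ} (hw : w ∈ sideSeg δ x y) (hwΩ : w ∉ Ω) :
    stepFlux (curH Ω δ h) (curV Ω δ h) x y = 0 := by
  -- the crossed primal edge is not an edge of `Ω_n`
  have key : ∀ a b : Site 2, sideSeg δ x y = segment ℝ (meshPoint δ a) (meshPoint δ b) →
      cur Ω δ h a b = 0 := by
    intro a b hab
    refine cur_of_not_adj fun hadj => hwΩ ?_
    have hseg := (innerGraph_adj_iff.1 (domainGraph_adj_iff.1 hadj).1).2
    exact hseg (by rw [← hab]; exact hw)
  rcases stepKind_of_adj hxy with ⟨h0, h1⟩ | ⟨h0, h1⟩ | ⟨h1, h0⟩ | ⟨h1, h0⟩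
  · -- right step: crosses the right side of `x`, the vertical edge from `x + e₀`
    have hy : y = x + Pi.single 0 1 := by simp [Site.eq_iff_two, h0, h1]
    subst hy
    have hval : stepFlux (curH Ω δ h) (curV Ω δ h) x (x + Pi.single 0 1) = -curV Ω δ h (x - Pi.single 1 1) := by
      unfold stepFlux
      have c0 : (x + Pi.single 0 1 : Site 2) 0 = x 0 + 1 := by simp
      have c1 : (x + Pi.single 0 1 : Site 2) 1 = x 1 := by simp
      simp [c0, c1]
    rw [hval, curV, key]
    · simp
    · rw [sideSeg, sepLo_add_e0, sepHi_add_e0]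
      congr 2 <;> ext i <;> fin_cases i <;> simp
  · have hx : x = y + Pi.single 0 1 := by simp [Site.eq_iff_two, h0, h1]
    subst hx
    have hval : stepFlux (curH Ω δ h) (curV Ω δ h) (y + Pi.single 0 1) y = curV Ω δ h (y - Pi.single 1 1) := by
      unfold stepFlux
      have c0 : (y + Pi.single 0 1 : Site 2) 0 = y 0 + 1 := by simp
      have c1 : (y + Pi.single 0 1 : Site 2) 1 = y 1 := by simp
      simp [c0, c1]
      omega
    rw [hval, curV, key]
    rw [sideSeg, sepLo_comm, sepHi_comm, sepLo_add_e0, sepHi_add_e0]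
    congr 2 <;> ext i <;> fin_cases i <;> simp
  · have hy : y = x + Pi.single 1 1 := by simp [Site.eq_iff_two, h0, h1]
    subst hy
    have hval : stepFlux (curH Ω δ h) (curV Ω δ h) x (x + Pi.single 1 1) = curH Ω δ h (x - Pi.single 0 1) := by
      unfold stepFlux
      have c0 : (x + Pi.single 1 1 : Site 2) 0 = x 0 := by simp
      have c1 : (x + Pi.single 1 1 : Site 2) 1 = x 1 + 1 := by simp
      simp [c0, c1]
    rw [hval, curH, key]
    rw [sideSeg, sepLo_add_e1, sepHi_add_e1]
    congr 2 <;> ext i <;> fin_cases i <;> simp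
  · have hx : x = y + Pi.single 1 1 := by simp [Site.eq_iff_two, h0, h1]
    subst hx
    have hval : stepFlux (curH Ω δ h) (curV Ω δ h) (y + Pi.single 1 1) y = -curH Ω δ h (y - Pi.single 0 1) := by
      unfold stepFlux
      have c0 : (y + Pi.single 1 1 : Site 2) 0 = y 0 := by simp
      have c1 : (y + Pi.single 1 1 : Site 2) 1 = y 1 + 1 := by simp
      simp [c0, c1]
      omega
    rw [hval, curH, key]
    · simp
    · rw [sideSeg, sepLo_comm, sepHi_comm, sepLo_add_e1, sepHi_add_e1]
      congr 2 <;> ext i <;> fin_cases i <;> simp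

/-- A walk of squares all of whose steps cross sides containing points outside `Ω` carries no
flux. [folklore] -/
theorem walkFlux_eq_zero_of_sideSeg (h : Site 2 → ℝ) {a b : Site 2} (ω : (zdGraph 2).Walk a b)
    (hω : ∀ d ∈ ω.darts, ∃ w ∈ sideSeg δ d.fst d.snd, w ∉ Ω) :
    walkFlux (curH Ω δ h) (curV Ω δ h) ω = 0 := by
  induction ω with
  | nil => rfl
  | cons hxy p ih =>
    rw [walkFlux_cons, ih fun d hd => hω d (by simp [hd]), add_zero]
    obtain ⟨w, hw, hwΩ⟩ := hω ⟨(_, _), hxy⟩ (by simp)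
    exact stepFlux_eq_zero_of_mem_sideSeg h hxy hw hwΩ

/-- The **virtual value** of `h'` across the side of the square `p` towards its lattice
neighbour `p'`: `h'(p)` plus the CR-increment. When `p'` is an inner square of the component
this is `h'(p')` (`dualPot_sub_dualPot_of_adj`); when `p'` is not inner, `(p, p')` is an EXIT of
the component and this is the value at the corresponding vertex of the outer face in the planar
dual of [GP19], §3.1. [cite: GeorgakopoulosPanagiotis2019, §3.1] -/
def exitVal (Ω : Set ℂ) (δ : ℝ) (h : Site 2 → ℝ) (p₀ p p' : Site 2) : ℝ :=
  dualPot Ω δ h p₀ p + stepFlux (curH Ω δ h) (curV Ω δ h) p p'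

/-- **Walks of squares do not wind around far boundary vertices** (general form of
`walkWinding_eq_zero_of_mem_boundary`): a closed walk of squares each of which is inner or
contains a point within `ρ - 4δ` of the boundary point `q` does not wind around a vertex `x` of
`∂Ω_n` at distance `≥ ε + 3δ` from `q`, where `ρ ≤ ε` is a radius such that exterior points at
distance `≥ ε` from `q` are joined in the exterior off `B̄(q, ρ)`
(`JordanDomain.exists_joinedIn_exterior_diff_closedBall`). [folklore] -/
theorem walkWinding_eq_zero_of_mem_boundary' (R : RandomPlanarGeometry.ConformalRectangle)
    (h0 : (0 : ℂ) ∈ R.carrier) (hδ : 0 < δ) {a : Site 2} (Λ : (zdGraph 2).Walk a a) {s₀ ε ρ : ℝ}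
    (hε : 0 < ε) (hρε : ρ ≤ ε)
    (hρ : ∀ e y : ℂ, e ∈ (closure R.carrier)ᶜ → y ∈ (closure R.carrier)ᶜ →
      ε ≤ dist e (R.boundary s₀) → ε ≤ dist y (R.boundary s₀) →
      JoinedIn ((closure R.carrier)ᶜ \ closedBall (R.boundary s₀) ρ) e y)
    (hsupp : ∀ Q ∈ Λ.support, IsInnerSq R.carrier δ Q ∨ ∃ w ∈ closedSq δ Q, dist w (R.boundary s₀) < ρ - 4 * δ)
    {x : Site 2} (hx : x ∈ boundary R.carrier δ) (hxq : ε + 3 * δ ≤ dist (meshPoint δ x) (R.boundary s₀)) :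
    walkWinding Λ (x - 1) = 0 := by
  set q := R.boundary s₀ with hq
  -- a square containing a point at distance `≥ ρ - 2δ` from `q` is not "near"
  have notnear : ∀ {Q : Site 2} {z : ℂ}, z ∈ closedSq δ Q → ρ - 2 * δ ≤ dist z q →
      ¬ ∃ w ∈ closedSq δ Q, dist w q < ρ - 4 * δ := by
    rintro Q z hz hzq ⟨w, hw, hwq⟩
    have := dist_le_of_mem_closedSq hz hw
    linarith [dist_triangle z w q]
  -- the boundary edge at `x` and the non-inner square `Q₁ = x ⊓ y`
  obtain ⟨-, y, hxy, j, hjseg, hjf⟩ := hx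
  have hjΩ : j ∉ R.carrier := fun h => (R.disjoint_carrier_frontier.ne_of_mem h hjf) rfl
  have hnadj : ¬ (domainGraph R.carrier δ).Adj x y := fun h =>
    hjΩ ((innerGraph_adj_iff.1 (domainGraph_adj_iff.1 h).1).2 hjseg)
  have hQ₁ : ¬ IsInnerSq R.carrier δ (x ⊓ y) := not_isInnerSq_inf hxy hnadj
  have hjQ₁ : j ∈ closedSq δ (x ⊓ y) := segment_subset_closedSq_inf hδ.le hxy hjseg
  have hxQ₁ : meshPoint δ x ∈ closedSq δ (x ⊓ y) := by
    refine meshPoint_mem_closedSq hδ.le ?_ ?_ <;>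
      rcases stepKind_of_adj hxy with ⟨e0, e1⟩ | ⟨e0, e1⟩ | ⟨e1, e0⟩ | ⟨e1, e0⟩ <;>
      simp only [Pi.inf_apply] <;> omega
  have hjx : dist (meshPoint δ x) j ≤ 2 * δ := dist_le_of_mem_closedSq hxQ₁ hjQ₁
  -- an exterior point near `j` and its square `Q'`
  obtain ⟨e', he', hje'⟩ := Metric.mem_closure_iff.1 (R.frontier_subset_closure_exterior' hjf) (δ / 2)
    (by positivity)
  have hQ' : ∃ c, c ∈ corners (x ⊓ y) ∧ c ∈ corners (floorSq δ e') :=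
    ⟨_, sup_mem_corners (abs_sub_floorSq_le_of_mem_closedSq hδ hjQ₁ hje' 0)
      (abs_sub_floorSq_le_of_mem_closedSq hδ hjQ₁ hje' 1)⟩
  have he'q : ε + δ / 2 ≤ dist e' q := by
    have h1 := dist_triangle (meshPoint δ x) j q
    have h2 := dist_triangle j e' q
    have h3 : dist j e' < δ / 2 := hje'
    linarith
  -- a far exterior point and an exterior path to it avoiding the ball
  obtain ⟨r₀, hr₀⟩ := (isBounded_iff_subset_closedBall (0 : ℂ)).1 R.isBounded
  have hr₀nn : 0 ≤ r₀ := by simpa using hr₀ h0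
  have hqr : ‖q‖ ≤ r₀ := by
    have : q ∈ closedBall (0 : ℂ) r₀ :=
      closure_minimal hr₀ isClosed_closedBall (frontier_subset_closure (R.boundary_mem_frontier s₀))
    simpa using this
  have hεpos : 0 ≤ ε := hε.le
  set N : ℤ := ⌈r₀ / δ⌉ with hN
  have hNnn : 0 ≤ (N : ℝ) := (div_nonneg hr₀nn hδ.le).trans (Int.le_ceil _)
  set X : ℝ := 2 * r₀ + 1 + ε + δ * (N + 4) with hX
  have hX0 : 0 < X := by rw [hX]; nlinarith
  have hXr : r₀ < X := by rw [hX]; nlinarith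
  have hfar : (X : ℂ) ∈ (closure R.carrier)ᶜ := by
    intro hmem
    have : (X : ℂ) ∈ closedBall (0 : ℂ) r₀ := closure_minimal hr₀ isClosed_closedBall hmem
    have h1 : ‖(X : ℂ)‖ ≤ r₀ := by simpa using this
    rw [Complex.norm_real, Real.norm_eq_abs, abs_of_pos hX0] at h1
    linarith
  have hXq : ε ≤ dist (X : ℂ) q := by
    have h1 : ‖(X : ℂ)‖ - ‖q‖ ≤ dist (X : ℂ) q := by
      rw [dist_eq_norm]; exact norm_sub_norm_le _ _
    rw [Complex.norm_real, Real.norm_eq_abs, abs_of_pos hX0] at h1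
    nlinarith
  have hpath : JoinedIn ((closure R.carrier)ᶜ \ closedBall q ρ) e' (X : ℂ) :=
    hρ e' X he' hfar (by linarith) hXq
  have hγc : ContinuousOn (fun t : ℝ => hpath.somePath.extend t) (Icc 0 1) :=
    hpath.somePath.continuous_extend.continuousOn
  have hγE : ∀ t ∈ Icc (0 : ℝ) 1, hpath.somePath.extend t ∈ (closure R.carrier)ᶜ \ closedBall q ρ := fun t ht => by
    rw [Path.extend_extends' hpath.somePath ⟨t, ht⟩]
    exact hpath.somePath_mem _
  obtain ⟨l, hchain, hmeet, hlast⟩ := exists_kingChain_of_path hδ hγc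
  simp only [Path.extend_zero, Path.extend_one] at hchain hmeet hlast
  -- none of the squares of the chain `Q₁ :: Q' :: l` is visited by `Λ`
  have hnot : ∀ Q ∈ (x ⊓ y) :: floorSq δ e' :: l, Q ∉ Λ.support := by
    intro Q hQ hQs
    rcases hsupp Q hQs with hQI | hQnear
    · rw [List.mem_cons] at hQ
      rcases hQ with rfl | hQ
      · exact hQ₁ hQI
      · obtain ⟨t, ht, hγt⟩ := hmeet Q hQ
        exact not_isInnerSq_of_mem_closedSq R hδ hγt (fun h => (hγE t ht).1 (subset_closure h)) hQI
    · rw [List.mem_cons] at hQ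
      rcases hQ with rfl | hQ
      · exact notnear hxQ₁ (by linarith) hQnear
      · rw [List.mem_cons] at hQ
        rcases hQ with rfl | hQ
        · refine notnear (mem_closedSq_floorSq hδ e') (by linarith) hQnear
        · obtain ⟨t, ht, hγt⟩ := hmeet Q (List.mem_cons_of_mem _ hQ)
          have hout := (hγE t ht).2
          rw [mem_closedBall, not_le] at hout
          exact notnear hγt (by linarith) hQnear
  have hchain' : List.IsChain (fun Q Q' => ∃ c, c ∈ corners Q ∧ c ∈ corners Q')
      ((x ⊓ y) :: floorSq δ e' :: l) :=
    List.isChain_cons_cons.2 ⟨hQ', hchain⟩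
  have hW := walkWinding_eq_of_cornerChain Λ (floorSq δ e' :: l) (x ⊓ y) hnot hchain' x (mem_corners_inf x hxy)
    (((x ⊓ y) :: floorSq δ e' :: l).getLast (by simp)) (by rw [corners]; simp)
  rw [hW]
  have hqN' : ((x ⊓ y) :: floorSq δ e' :: l).getLast (by simp) = (floorSq δ e' :: l).getLast (by simp) := by
    simp [List.getLast_cons]
  have hXQ : (X : ℂ) ∈ closedSq δ (((x ⊓ y) :: floorSq δ e' :: l).getLast (by simp)) := by
    rw [hqN']; exact hlast
  -- bounding box of `Λ`: inner squares in `sqBox 0 N`, near squares in the box `N + 1`… all in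
  -- `sqBox 0 (2N + stuff)`; we use the box of the whole disc `B̄(0, 2 r₀ + ε + 1)`
  refine walkWinding_eq_zero_of_not_mem_sqBox (p₀ := 0) (n := ⌈(2 * r₀ + 1 + ε) / δ⌉ + 1) (fun z hz => ?_) ?_
  · -- every visited square has a point of norm `≤ 2 r₀ + ε`, hence index in the box
    have hpt : ∃ w ∈ closedSq δ z, ‖w‖ ≤ 2 * r₀ + ε := by
      rcases hsupp z hz with hzI | ⟨w, hw, hwq⟩
      · have hzd : z ∈ domain R.carrier δ := (domainGraph_adj_iff.1 hzI.1).2.1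
        have hzΩ : meshPoint δ z ∈ R.carrier := mem_meshVertices_iff.1 (domain_subset_meshVertices h0 hzd)
        refine ⟨meshPoint δ z, meshPoint_mem_closedSq hδ.le (Or.inl rfl) (Or.inl rfl), ?_⟩
        have : ‖meshPoint δ z‖ ≤ r₀ := by simpa using hr₀ hzΩ
        linarith
      · refine ⟨w, hw, ?_⟩
        have : ‖w‖ ≤ ‖q‖ + dist w q := by
          rw [dist_eq_norm]; linarith [norm_le_norm_add_norm_sub' w q, norm_sub_rev w q]
        have hρr : ρ ≤ r₀ + ε + 4 * δ := by linarith
        nlinarith [dist_nonneg (x := w) (y := q)]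
    obtain ⟨w, ⟨hw0, hw0', hw1, hw1'⟩, hwn⟩ := hpt
    have hre := (Complex.abs_re_le_norm w).trans hwn
    have him := (Complex.abs_im_le_norm w).trans hwn
    rw [abs_le] at hre him
    have hc : (2 * r₀ + 1 + ε) / δ ≤ ⌈(2 * r₀ + 1 + ε) / δ⌉ := Int.le_ceil _
    rw [div_le_iff₀ hδ] at hc
    rw [mem_sqBox]
    simp only [Pi.zero_apply, sub_zero]
    constructor
    · rw [abs_le]
      constructor
      · have h1 : δ * (-(⌈(2 * r₀ + 1 + ε) / δ⌉ + 1) : ℝ) < δ * z 0 := by nlinarith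
        have h2 := lt_of_mul_lt_mul_left h1 hδ.le
        have h3 : (-(⌈(2 * r₀ + 1 + ε) / δ⌉ + 1) : ℤ) < z 0 := by exact_mod_cast h2
        omega
      · have h1 : δ * (z 0 : ℝ) < δ * (⌈(2 * r₀ + 1 + ε) / δ⌉ + 1) := by nlinarith
        have h2 := lt_of_mul_lt_mul_left h1 hδ.le
        have h3 : z 0 < ⌈(2 * r₀ + 1 + ε) / δ⌉ + 1 := by exact_mod_cast h2
        omega
    · rw [abs_le]
      constructor
      · have h1 : δ * (-(⌈(2 * r₀ + 1 + ε) / δ⌉ + 1) : ℝ) < δ * z 1 := by nlinarith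
        have h2 := lt_of_mul_lt_mul_left h1 hδ.le
        have h3 : (-(⌈(2 * r₀ + 1 + ε) / δ⌉ + 1) : ℤ) < z 1 := by exact_mod_cast h2
        omega
      · have h1 : δ * (z 1 : ℝ) < δ * (⌈(2 * r₀ + 1 + ε) / δ⌉ + 1) := by nlinarith
        have h2 := lt_of_mul_lt_mul_left h1 hδ.le
        have h3 : z 1 < ⌈(2 * r₀ + 1 + ε) / δ⌉ + 1 := by exact_mod_cast h2
        omega
  · obtain ⟨-, hq0, -, -⟩ := hXQ
    simp only [Complex.ofReal_re] at hq0
    rw [mem_sqBox, not_and_or]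
    left
    simp only [Pi.sub_apply, Pi.one_apply, Pi.zero_apply, sub_zero, not_le]
    have hc : (⌈(2 * r₀ + 1 + ε) / δ⌉ : ℝ) < (2 * r₀ + 1 + ε) / δ + 1 := Int.ceil_lt_add_one _
    rw [div_add_one hδ.ne', lt_div_iff₀ hδ] at hc
    have h1 : δ * (⌈(2 * r₀ + 1 + ε) / δ⌉ + 3) < δ * (((((x ⊓ y) :: floorSq δ e' :: l).getLast (by simp)) 0 : ℝ) + 1) := by
      rw [hX] at hq0; nlinarith
    have h2 := lt_of_mul_lt_mul_left h1 hδ.le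
    have h3 : ⌈(2 * r₀ + 1 + ε) / δ⌉ + 3 < (((x ⊓ y) :: floorSq δ e' :: l).getLast (by simp)) 0 + 1 := by
      exact_mod_cast h2
    rw [lt_abs]
    left
    omega

end Exits

section ExitEquality

open WeakBeurling

variable {δ : ℝ}

/-- Squares on a walk of the dual graph from an inner square are inner. [folklore] -/
theorem isInnerSq_of_mem_support' {Ω : Set ℂ} {p₀ p q : Site 2} (hp₀ : IsInnerSq Ω δ p₀)
    (W : (dualGraph Ω δ).Walk p₀ p) (hq : q ∈ W.support) : IsInnerSq Ω δ q := by
  by_cases hlen : W.length = 0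
  · have hs : W.support = [p₀] := by
      have hnil : W.Nil := Walk.length_eq_zero_iff.mp hlen
      exact Walk.nil_iff_support_eq.mp hnil
    rw [hs, List.mem_singleton] at hq
    subst hq; exact hp₀
  · exact isInnerSq_of_mem_support W (Or.inr (Nat.pos_of_ne_zero hlen)) hq

/-- **Short boundary arcs near a boundary point.** Given a boundary point `q = boundary s₀` and
`r' > 0` there is `r > 0` such that any two boundary points in `B(q, r)` are the end-points of a
boundary arc staying in `B(q, r')` (uniform continuity of the boundary loop and of its inverse). [folklore] -/
theorem exists_short_boundary_arc (D : RandomPlanarGeometry.JordanDomain) {r' : ℝ} (hr' : 0 < r') :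
    ∃ r > 0, ∀ (s₀ : ℝ) (j j' : ℂ), j ∈ frontier D.carrier → j' ∈ frontier D.carrier →
      dist j (D.boundary s₀) < r → dist j' (D.boundary s₀) < r →
      ∃ a a' : ℝ, a ≤ a' ∧ ((D.boundary a = j ∧ D.boundary a' = j') ∨ (D.boundary a = j' ∧ D.boundary a' = j)) ∧
        ∀ t ∈ Icc a a', dist (D.boundary t) (D.boundary s₀) < r' := by
  obtain ⟨τ, hτ, hτ2, hτε⟩ := D.exists_forall_dist_boundary_lt hr'
  obtain ⟨m, hm, hmd⟩ := D.exists_pos_le_dist_boundary hτ hτ2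
  refine ⟨m, hm, fun s₀ j j' hj hj' hjq hj'q => ?_⟩
  -- parameters within `τ` of `s₀`
  have param : ∀ z ∈ frontier D.carrier, dist z (D.boundary s₀) < m →
      ∃ t ∈ Icc (s₀ - τ) (s₀ + τ), D.boundary t = z := by
    intro z hz hzq
    rw [← D.range_boundary] at hz
    obtain ⟨t, rfl⟩ := hz
    obtain ⟨t', ht', htt'⟩ := D.periodic_boundary.exists_mem_Ico one_pos t (s₀ - 1 / 2)
    refine ⟨t', ?_, htt'.symm⟩
    rw [htt'] at hzq
    by_contra hout
    rw [mem_Icc, not_and_or, not_le, not_le] at hout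
    rcases hout with h1 | h1
    · have := hmd t' s₀ (by linarith) (by linarith [ht'.1])
      linarith
    · have := hmd s₀ t' (by linarith) (by linarith [ht'.2])
      rw [_root_.dist_comm] at this
      linarith
  obtain ⟨t, ht, rfl⟩ := param j hj hjq
  obtain ⟨t', ht', rfl⟩ := param j' hj' hj'q
  have key : ∀ u ∈ Icc (min t t') (max t t'), dist (D.boundary u) (D.boundary s₀) < r' := by
    intro u hu
    refine hτε u s₀ ?_
    rw [abs_le]
    constructor <;> linarith [hu.1, hu.2, le_min ht.1 ht'.1, max_le ht.2 ht'.2]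
  rcases le_total t t' with h | h
  · exact ⟨t, t', h, Or.inl ⟨rfl, rfl⟩, fun u hu => key u (by rwa [min_eq_left h, max_eq_right h])⟩
  · exact ⟨t', t, h, Or.inr ⟨rfl, rfl⟩, fun u hu => key u (by rwa [min_eq_right h, max_eq_left h])⟩

open Classical in
/-- **Exits near a boundary point away from `T ∪ B` have equal virtual values.** Let `h` be
harmonic for `Ω_n` off `T ∪ B ⊆ ∂Ω_n` and `h'` its conjugate based at the inner square `p₀`. Let
`q` be a boundary point, `ρ ≤ ε` radii as in `JordanDomain.exists_joinedIn_exterior_diff_closedBall`,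
and suppose all vertices of `T ∪ B` are at distance `≥ ε + 3δ` from `q`. Then two exits
`(p, p')`, `(p̃, p̃')` of the component of `p₀` whose outer squares contain the end-points of a
boundary arc staying within `ρ - 6δ` of `q` have the same virtual value: the loop "out through one
exit, along the arc (no current crosses it), back in through the other, home through the
component" has flux `E(p̃,p̃') - E(p,p')`, and winds around no vertex of `T ∪ B`. [folklore] -/
theorem exitVal_eq_exitVal (R : RandomPlanarGeometry.ConformalRectangle) (h0 : (0 : ℂ) ∈ R.carrier)
    (hδ : 0 < δ) {h : Site 2 → ℝ} {T B : Set (Site 2)} (hT : T ⊆ boundary R.carrier δ) (hB : B ⊆ boundary R.carrier δ)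
    (hharm : ∀ x, x ∉ T → x ∉ B →
      ∑ y ∈ ((zdGraph 2).neighborFinset x).filter (fun y => (domainGraph R.carrier δ).Adj x y), (h y - h x) = 0)
    {p₀ : Site 2} (hp₀ : IsInnerSq R.carrier δ p₀) {s₀ ε ρ : ℝ} (hε : 0 < ε) (hρε : ρ ≤ ε)
    (hρ : ∀ e y : ℂ, e ∈ (closure R.carrier)ᶜ → y ∈ (closure R.carrier)ᶜ →
      ε ≤ dist e (R.boundary s₀) → ε ≤ dist y (R.boundary s₀) →
      JoinedIn ((closure R.carrier)ᶜ \ closedBall (R.boundary s₀) ρ) e y)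
    (hfar : ∀ x ∈ T ∪ B, ε + 3 * δ ≤ dist (meshPoint δ x) (R.boundary s₀))
    {p p' q₁ q₁' : Site 2} (hp : (dualGraph R.carrier δ).Reachable p₀ p) (hpp' : (zdGraph 2).Adj p p')
    (hq₁ : (dualGraph R.carrier δ).Reachable p₀ q₁) (hqq' : (zdGraph 2).Adj q₁ q₁')
    {a a' : ℝ} (haa' : a ≤ a') (hja : R.boundary a ∈ closedSq δ p') (hja' : R.boundary a' ∈ closedSq δ q₁')
    (harc : ∀ t ∈ Icc a a', dist (R.boundary t) (R.boundary s₀) < ρ - 6 * δ) :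
    exitVal R.carrier δ h p₀ p p' = exitVal R.carrier δ h p₀ q₁ q₁' := by
  -- the justified walk along the arc, from `p'` to `q₁'`
  obtain ⟨ω, hω, hωs⟩ := exists_dualWalk_of_path hδ haa' (R.continuous_boundary.continuousOn) hja hja'
  have hωflux : walkFlux (curH R.carrier δ h) (curV R.carrier δ h) ω = 0 :=
    walkFlux_eq_zero_of_sideSeg h ω fun d hd => by
      obtain ⟨t, -, ht⟩ := hω d hd
      exact ⟨_, ht, fun hmem => (R.disjoint_carrier_frontier.ne_of_mem hmem (R.boundary_mem_frontier t)) rfl⟩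
  -- the walk through the component, from `p` to `q₁`
  obtain ⟨Wp⟩ := hp
  obtain ⟨Wq⟩ := hq₁
  have hπflux : walkFlux (curH R.carrier δ h) (curV R.carrier δ h)
      ((Wp.reverse.append Wq).map (Hom.ofLE dualGraph_le_zdGraph)) =
      dualPot R.carrier δ h p₀ q₁ - dualPot R.carrier δ h p₀ p := by
    rw [dualPot_eq_walkFlux R h0 hδ hT hB hharm hp₀ Wp, dualPot_eq_walkFlux R h0 hδ hT hB hharm hp₀ Wq,
      Walk.map_append, walkFlux_append, ← Walk.reverse_map, walkFlux_reverse]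
    ring
  -- the loop
  let Λ : (zdGraph 2).Walk p p := ((Wp.reverse.append Wq).map (Hom.ofLE dualGraph_le_zdGraph)).append
    (Walk.cons hqq' (ω.reverse.append (Walk.cons hpp'.symm Walk.nil)))
  have hΛflux : walkFlux (curH R.carrier δ h) (curV R.carrier δ h) Λ =
      exitVal R.carrier δ h p₀ q₁ q₁' - exitVal R.carrier δ h p₀ p p' := by
    show walkFlux (curH R.carrier δ h) (curV R.carrier δ h) (((Wp.reverse.append Wq).map (Hom.ofLE dualGraph_le_zdGraph)).append
      (Walk.cons hqq' (ω.reverse.append (Walk.cons hpp'.symm Walk.nil)))) = _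
    rw [walkFlux_append, walkFlux_cons, walkFlux_append, walkFlux_reverse, walkFlux_cons, walkFlux_nil,
      hπflux, hωflux, stepFlux_antisymm _ _ (stepKind_of_adj hpp'), exitVal, exitVal]
    simp only [Hom.coe_ofLE, id_eq]
    ring
  -- its squares are inner or near `q`
  have hsupp : ∀ Q ∈ Λ.support, IsInnerSq R.carrier δ Q ∨ ∃ w ∈ closedSq δ Q, dist w (R.boundary s₀) < ρ - 4 * δ := by
    intro Q hQ
    have hQ' : Q ∈ ((Wp.reverse.append Wq).map (Hom.ofLE dualGraph_le_zdGraph)).support ∨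
        Q ∈ (Walk.cons hqq' (ω.reverse.append (Walk.cons hpp'.symm Walk.nil))).support :=
      (Walk.mem_support_append_iff _ _).1 hQ
    have near_of_ω : Q ∈ ω.support → IsInnerSq R.carrier δ Q ∨ ∃ w ∈ closedSq δ Q, dist w (R.boundary s₀) < ρ - 4 * δ := by
      intro hQω
      obtain ⟨t, ht, hγt⟩ := hωs Q hQω
      exact Or.inr ⟨_, hγt, by linarith [harc t ht]⟩
    rcases hQ' with hQπ | hQr
    · left
      rw [Walk.support_map, List.mem_map] at hQπ
      obtain ⟨Q', hQ', rfl⟩ := hQπ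
      rw [Walk.mem_support_append_iff, Walk.support_reverse, List.mem_reverse] at hQ'
      rcases hQ' with hQ' | hQ'
      · exact isInnerSq_of_mem_support' hp₀ Wp hQ'
      · exact isInnerSq_of_mem_support' hp₀ Wq hQ'
    · rw [Walk.support_cons, List.mem_cons, Walk.mem_support_append_iff, Walk.support_reverse, List.mem_reverse,
        Walk.support_cons, Walk.support_nil] at hQr
      rcases hQr with h1 | hQω | hQ2
      · left; rw [h1]; exact isInnerSq_of_mem_support' hp₀ Wq (Walk.end_mem_support _)
      · exact near_of_ω hQω
      · simp only [List.mem_cons, List.not_mem_nil, or_false] at hQ2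
        rcases hQ2 with h2 | h2
        · exact near_of_ω (h2 ▸ Walk.start_mem_support ω)
        · left; rw [h2]; exact isInnerSq_of_mem_support' hp₀ Wp (Walk.end_mem_support _)
  -- zero flux by the divergence theorem
  obtain ⟨r₀, hr₀⟩ := (isBounded_iff_subset_closedBall (0 : ℂ)).1 R.isBounded
  set S : Finset (Site 2) := (sqBox_finite 0 (⌈r₀ / δ⌉ + 1)).toFinset with hS
  have hmemS : ∀ u, u ∉ S → u ∉ sqBox 0 (⌈r₀ / δ⌉ + 1) := fun u hu h => hu (by simpa [hS] using h)
  have hzero : walkFlux (curH R.carrier δ h) (curV R.carrier δ h) Λ = 0 := by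
    refine walkFlux_eq_zero_of_winding (S := S)
      (fun u hu => (cur_eq_zero_of_not_mem_sqBox h0 hr₀ hδ h (hmemS u hu)).1)
      (fun u hu => (cur_eq_zero_of_not_mem_sqBox h0 hr₀ hδ h (hmemS u hu)).2) _ fun u _ hdiv => ?_
    have hTB : u + 1 ∈ T ∨ u + 1 ∈ B := by
      by_contra hc
      rw [not_or] at hc
      exact hdiv (divAt_cur_eq_zero hharm hc.1 hc.2)
    have hbd : u + 1 ∈ boundary R.carrier δ := hTB.elim (fun h => hT h) (fun h => hB h)
    have := walkWinding_eq_zero_of_mem_boundary' R h0 hδ Λ hε hρε hρ hsupp hbd (hfar _ hTB)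
    rwa [show u + 1 - 1 = u by abel] at this
  linarith

end ExitEquality


/-! ### §D6. A local bound for the conjugate near boundary points (no global planar structure) -/

section LocalSupBound

open WeakBeurling

variable {Ω : Set ℂ} {δ : ℝ}

/-- A preconnected set meeting a set and its complement meets its frontier. [folklore] -/
theorem _root_.IsPreconnected.inter_frontier_nonempty' {X : Type*} [TopologicalSpace X] {c t : Set X}
    (hc : IsPreconnected c) (h1 : (c ∩ t).Nonempty) (h2 : (c ∩ tᶜ).Nonempty) : (c ∩ frontier t).Nonempty := by
  by_contra h
  rw [not_nonempty_iff_eq_empty] at h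
  have hsub : c ⊆ interior t ∪ (closure t)ᶜ := by
    intro z hz
    by_cases hz1 : z ∈ closure t
    · rw [closure_eq_interior_union_frontier] at hz1
      rcases hz1 with h' | h'
      · exact Or.inl h'
      · have : z ∈ c ∩ frontier t := ⟨hz, h'⟩
        rw [h] at this
        exact this.elim
    · exact Or.inr hz1
  obtain ⟨a, ha, hat⟩ := h1
  obtain ⟨b, hb, hbt⟩ := h2
  have ha' : a ∈ interior t := by
    rcases hsub ha with h' | h'
    · exact h'
    · exact (h' (subset_closure hat)).elim
  have hb' : b ∈ (closure t)ᶜ := by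
    rcases hsub hb with h' | h'
    · exact (hbt (interior_subset h')).elim
    · exact h'
  have hdisj : Disjoint (interior t) (closure t)ᶜ :=
    Set.disjoint_left.2 fun z hz hz' => hz' (interior_subset_closure hz)
  rcases hc.subset_or_subset isOpen_interior isClosed_closure.isOpen_compl hdisj hsub with h' | h'
  · exact hdisj.ne_of_mem (h' hb) hb' rfl
  · exact (h' ha) (interior_subset_closure ha')

/-- The four sides of the square `p` lie in the closed square. [folklore] -/
theorem side_subset_closedSq (hδ : 0 ≤ δ) {p x y : Site 2} (hx : (x 0 = p 0 ∨ x 0 = p 0 + 1) ∧ (x 1 = p 1 ∨ x 1 = p 1 + 1))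
    (hy : (y 0 = p 0 ∨ y 0 = p 0 + 1) ∧ (y 1 = p 1 ∨ y 1 = p 1 + 1)) :
    segment ℝ (meshPoint δ x) (meshPoint δ y) ⊆ closedSq δ p :=
  (convex_closedSq δ p).segment_subset (meshPoint_mem_closedSq hδ hx.1 hx.2) (meshPoint_mem_closedSq hδ hy.1 hy.2)

/-- A square all of whose sides lie in `Ω` and one of whose corners is a vertex of `Ω_n` is
inner. [folklore] -/
theorem isInnerSq_of_sides_subset {p : Site 2}
    (hB : segment ℝ (meshPoint δ p) (meshPoint δ (p + Pi.single 0 1)) ⊆ Ω)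
    (hT : segment ℝ (meshPoint δ (p + Pi.single 1 1)) (meshPoint δ (p + Pi.single 1 1 + Pi.single 0 1)) ⊆ Ω)
    (hL : segment ℝ (meshPoint δ p) (meshPoint δ (p + Pi.single 1 1)) ⊆ Ω)
    (hR : segment ℝ (meshPoint δ (p + Pi.single 0 1)) (meshPoint δ (p + Pi.single 0 1 + Pi.single 1 1)) ⊆ Ω)
    (hc : p ∈ domain Ω δ ∨ p + Pi.single 0 1 ∈ domain Ω δ ∨ p + Pi.single 1 1 ∈ domain Ω δ ∨
      p + Pi.single 0 1 + Pi.single 1 1 ∈ domain Ω δ) : IsInnerSq Ω δ p := by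
  have aB : (innerGraph Ω δ).Adj p (p + Pi.single 0 1) :=
    innerGraph_adj_iff.2 ⟨adj_of_stepKind (.right (by simp) (by simp)), hB⟩
  have aT : (innerGraph Ω δ).Adj (p + Pi.single 1 1) (p + Pi.single 1 1 + Pi.single 0 1) :=
    innerGraph_adj_iff.2 ⟨adj_of_stepKind (.right (by simp) (by simp)), hT⟩
  have aL : (innerGraph Ω δ).Adj p (p + Pi.single 1 1) :=
    innerGraph_adj_iff.2 ⟨adj_of_stepKind (.up (by simp) (by simp)), hL⟩
  have aR : (innerGraph Ω δ).Adj (p + Pi.single 0 1) (p + Pi.single 0 1 + Pi.single 1 1) :=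
    innerGraph_adj_iff.2 ⟨adj_of_stepKind (.up (by simp) (by simp)), hR⟩
  have e : p + Pi.single 1 1 + Pi.single 0 1 = p + Pi.single 0 1 + Pi.single 1 1 := by abel
  rw [e] at aT
  -- all four corners are vertices of `Ω_n`
  have hp : p ∈ domain Ω δ := by
    rcases hc with h | h | h | h
    · exact h
    · exact mem_domain_of_adj h aB.symm
    · exact mem_domain_of_adj h aL.symm
    · exact mem_domain_of_adj (mem_domain_of_adj h aR.symm) aB.symm
  have h1 := mem_domain_of_adj hp aB
  have h2 := mem_domain_of_adj hp aL
  have h3 := mem_domain_of_adj h1 aR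
  refine ⟨domainGraph_adj_iff.2 ⟨aB, hp, h1⟩, ?_, domainGraph_adj_iff.2 ⟨aL, hp, h2⟩, domainGraph_adj_iff.2 ⟨aR, h1, h3⟩⟩
  rw [e]
  exact domainGraph_adj_iff.2 ⟨aT, h2, h3⟩

/-- **The outer square of an exit meets the boundary curve.** If `p` is inner and its lattice
neighbour `p'` is not, the closed square `p'` contains a point of `∂Ω` (it contains the common
side, inside `Ω`, and is not contained in `Ω`). [folklore] -/
theorem exists_mem_frontier_of_adj_not_isInnerSq (R : RandomPlanarGeometry.ConformalRectangle) (hδ : 0 < δ)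
    {p p' : Site 2} (hp : IsInnerSq R.carrier δ p) (hpp' : (zdGraph 2).Adj p p') (hp' : ¬ IsInnerSq R.carrier δ p') :
    ∃ j ∈ closedSq δ p', j ∈ frontier R.carrier := by
  -- a point of `Ω` in the closed square `p'`: the corner `p ⊔ p'` (a vertex of `Ω_n`)
  have hcorner : p ⊔ p' ∈ domain R.carrier δ ∧ meshPoint δ (p ⊔ p') ∈ closedSq δ p' ∧
      meshPoint δ (p ⊔ p') ∈ R.carrier := by
    obtain ⟨aB, aT, aL, aR⟩ := hp
    have sB := (innerGraph_adj_iff.1 (domainGraph_adj_iff.1 aB).1).2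
    have sL := (innerGraph_adj_iff.1 (domainGraph_adj_iff.1 aL).1).2
    rcases stepKind_of_adj hpp' with ⟨h0, h1⟩ | ⟨h0, h1⟩ | ⟨h1, h0⟩ | ⟨h1, h0⟩
    · have e : p ⊔ p' = p + Pi.single 0 1 := by ext i; fin_cases i <;> simp <;> omega
      rw [e]
      exact ⟨(domainGraph_adj_iff.1 aB).2.2, meshPoint_mem_closedSq hδ.le (Or.inl (by simp [h0])) (Or.inl (by simp [h1])),
        sB (right_mem_segment _ _ _)⟩
    · have e : p ⊔ p' = p := by ext i; fin_cases i <;> simp <;> omega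
      rw [e]
      exact ⟨(domainGraph_adj_iff.1 aB).2.1, meshPoint_mem_closedSq hδ.le (Or.inr h0) (Or.inl h1.symm),
        sB (left_mem_segment _ _ _)⟩
    · have e : p ⊔ p' = p + Pi.single 1 1 := by ext i; fin_cases i <;> simp <;> omega
      rw [e]
      exact ⟨(domainGraph_adj_iff.1 aL).2.2, meshPoint_mem_closedSq hδ.le (Or.inl (by simp [h0])) (Or.inl (by simp [h1])),
        sL (right_mem_segment _ _ _)⟩
    · have e : p ⊔ p' = p := by ext i; fin_cases i <;> simp <;> omega
      rw [e]
      exact ⟨(domainGraph_adj_iff.1 aL).2.1, meshPoint_mem_closedSq hδ.le (Or.inl h0.symm) (Or.inr h1),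
        sL (left_mem_segment _ _ _)⟩
  have h1 : (closedSq δ p' ∩ R.carrier).Nonempty := ⟨_, hcorner.2.1, hcorner.2.2⟩
  -- a point of the closed square outside `Ω`
  have h2 : (closedSq δ p' ∩ R.carrierᶜ).Nonempty := by
    by_contra hne
    rw [not_nonempty_iff_eq_empty] at hne
    have hne : closedSq δ p' ⊆ R.carrier := fun z hz => by
      by_contra hz'
      have : z ∈ closedSq δ p' ∩ R.carrierᶜ := ⟨hz, hz'⟩
      rw [hne] at this
      exact this.elim
    refine hp' (isInnerSq_of_sides_subset ?_ ?_ ?_ ?_ ?_)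
    · exact (side_subset_closedSq hδ.le ⟨Or.inl rfl, Or.inl rfl⟩ ⟨Or.inr (by simp), Or.inl (by simp)⟩).trans hne
    · exact (side_subset_closedSq hδ.le ⟨Or.inl (by simp), Or.inr (by simp)⟩ ⟨Or.inr (by simp), Or.inr (by simp)⟩).trans hne
    · exact (side_subset_closedSq hδ.le ⟨Or.inl rfl, Or.inl rfl⟩ ⟨Or.inl (by simp), Or.inr (by simp)⟩).trans hne
    · exact (side_subset_closedSq hδ.le ⟨Or.inr (by simp), Or.inl (by simp)⟩ ⟨Or.inr (by simp), Or.inr (by simp)⟩).trans hne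
    · -- the corner `p ⊔ p'` of `p'` is a vertex of `Ω_n`
      rcases stepKind_of_adj hpp' with ⟨h0, h1⟩ | ⟨h0, h1⟩ | ⟨h1, h0⟩ | ⟨h1, h0⟩
      · left; convert hcorner.1 using 1; ext i; fin_cases i <;> simp <;> omega
      · right; left; convert hcorner.1 using 1; ext i; fin_cases i <;> simp <;> omega
      · left; convert hcorner.1 using 1; ext i; fin_cases i <;> simp <;> omega
      · right; right; left; convert hcorner.1 using 1; ext i; fin_cases i <;> simp <;> omega
  obtain ⟨j, hj, hjf⟩ := (convex_closedSq δ p').isPreconnected.inter_frontier_nonempty' h1 h2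
  exact ⟨j, hj, hjf⟩

/-- Currents of a `[0,1]`-valued potential are at most `1` in absolute value. [folklore] -/
theorem abs_cur_le_one {h : Site 2 → ℝ} (h01 : ∀ x, h x ∈ Icc (0 : ℝ) 1) (x y : Site 2) : |cur Ω δ h x y| ≤ 1 := by
  unfold cur
  split_ifs
  · have := h01 x; have := h01 y
    simp only [mem_Icc] at *
    rw [abs_le]; constructor <;> linarith
  · simp

/-- Step fluxes of a `[0,1]`-valued potential are at most `1` in absolute value. [folklore] -/
theorem abs_stepFlux_le_one {h : Site 2 → ℝ} (h01 : ∀ x, h x ∈ Icc (0 : ℝ) 1) (x y : Site 2) :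
    |stepFlux (curH Ω δ h) (curV Ω δ h) x y| ≤ 1 := by
  unfold stepFlux curH curV
  split_ifs <;> first | exact abs_cur_le_one h01 _ _ | (rw [abs_neg]; exact abs_cur_le_one h01 _ _) | simp

/-- **Discrete maximum principle on an index rectangle**, for a function with the mean-value
property at the interior squares of a finite set `F` with respect to neighbour values `V p n`
(equal to `g n` when `n ∈ F`, and at most `M` otherwise): if `g ≤ M` on the squares of `F` on the
boundary of the rectangle, then `g ≤ M` on `F ∩ rectangle` (argmax with least abscissa). [folklore] -/
theorem le_of_meanValue_rect {F : Set (Site 2)} (hF : F.Finite) {g : Site 2 → ℝ} {V : Site 2 → Site 2 → ℝ}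
    {M : ℝ} {xl xr yb yt : ℤ}
    (hmean : ∀ p ∈ F, xl < p 0 → p 0 < xr → yb < p 1 → p 1 < yt →
      ∑ k : Fin 4, (V p (p + cornerUnit k) - g p) = 0)
    (hVin : ∀ p ∈ F, ∀ k : Fin 4, p + cornerUnit k ∈ F → V p (p + cornerUnit k) = g (p + cornerUnit k))
    (hVout : ∀ p ∈ F, xl < p 0 → p 0 < xr → yb < p 1 → p 1 < yt → ∀ k : Fin 4, p + cornerUnit k ∉ F → V p (p + cornerUnit k) ≤ M)
    (hbd : ∀ p ∈ F, xl ≤ p 0 → p 0 ≤ xr → yb ≤ p 1 → p 1 ≤ yt →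
      (p 0 = xl ∨ p 0 = xr ∨ p 1 = yb ∨ p 1 = yt) → g p ≤ M) :
    ∀ p ∈ F, xl ≤ p 0 → p 0 ≤ xr → yb ≤ p 1 → p 1 ≤ yt → g p ≤ M := by
  classical
  by_contra hcon
  push Not at hcon
  -- the finite set of squares of `F` in the rectangle, and the maximum of `g` there
  set A : Finset (Site 2) := hF.toFinset.filter (fun p => xl ≤ p 0 ∧ p 0 ≤ xr ∧ yb ≤ p 1 ∧ p 1 ≤ yt) with hA
  have hmemA : ∀ {p}, p ∈ A ↔ p ∈ F ∧ xl ≤ p 0 ∧ p 0 ≤ xr ∧ yb ≤ p 1 ∧ p 1 ≤ yt := by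
    intro p; simp [hA]
  obtain ⟨p₁, hp₁F, h1, h2, h3, h4, hgt⟩ := hcon
  have hAne : A.Nonempty := ⟨p₁, hmemA.2 ⟨hp₁F, h1, h2, h3, h4⟩⟩
  obtain ⟨pm, hpm, hmax⟩ := A.exists_max_image g hAne
  set M' := g pm with hM'
  have hM'M : M < M' := hgt.trans_le (hmax p₁ (hmemA.2 ⟨hp₁F, h1, h2, h3, h4⟩))
  -- among the maximisers, one with least abscissa
  set Amax : Finset (Site 2) := A.filter (fun p => g p = M') with hAmax
  have hAmaxne : Amax.Nonempty := ⟨pm, Finset.mem_filter.2 ⟨hpm, rfl⟩⟩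
  obtain ⟨p, hpAmax, hmin⟩ := Amax.exists_min_image (fun p => p 0) hAmaxne
  obtain ⟨hpA, hgp⟩ := Finset.mem_filter.1 hpAmax
  obtain ⟨hpF, g1, g2, g3, g4⟩ := hmemA.1 hpA
  -- `p` is interior (on the boundary `g ≤ M < M'`)
  have hint : xl < p 0 ∧ p 0 < xr ∧ yb < p 1 ∧ p 1 < yt := by
    by_contra hni
    have hb : p 0 = xl ∨ p 0 = xr ∨ p 1 = yb ∨ p 1 = yt := by omega
    have := hbd p hpF g1 g2 g3 g4 hb
    linarith
  obtain ⟨i1, i2, i3, i4⟩ := hint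
  -- every neighbour value is `≤ M'`, and they average to `M'`: all equal `M'`
  have hle : ∀ k : Fin 4, V p (p + cornerUnit k) - g p ≤ 0 := by
    intro k
    by_cases hk : p + cornerUnit k ∈ F
    · rw [hVin p hpF k hk, hgp, sub_nonpos]
      refine hmax _ (hmemA.2 ⟨hk, ?_⟩)
      rcases coord_step_of_stepKind (stepKind_add_cornerUnit p k) with ⟨e0, e1⟩ | ⟨e0, e1⟩ | ⟨e0, e1⟩ | ⟨e0, e1⟩ <;> omega
    · have := hVout p hpF i1 i2 i3 i4 k hk
      linarith
  have hsum := hmean p hpF i1 i2 i3 i4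
  have hall : ∀ k : Fin 4, V p (p + cornerUnit k) - g p = 0 := by
    intro k
    have := Finset.sum_eq_zero_iff_of_nonpos (s := Finset.univ) (f := fun k : Fin 4 => V p (p + cornerUnit k) - g p)
      (fun k _ => hle k)
    exact (this.1 hsum) k (Finset.mem_univ _)
  -- the left neighbour
  have hleft := hall 2
  have hcoord := (add_cornerUnit_apply p).2.2.1
  by_cases hk : p + cornerUnit 2 ∈ F
  · rw [hVin p hpF 2 hk, hgp, sub_eq_zero] at hleft
    have hmem : p + cornerUnit 2 ∈ Amax := by
      refine Finset.mem_filter.2 ⟨hmemA.2 ⟨hk, ?_, ?_, ?_, ?_⟩, hleft⟩ <;> omega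
    have := hmin _ hmem
    omega
  · have := hVout p hpF i1 i2 i3 i4 2 hk
    rw [hgp] at hleft
    linarith

/-- Two-sided form of the discrete maximum principle on an index rectangle. [folklore] -/
theorem abs_le_of_meanValue_rect {F : Set (Site 2)} (hF : F.Finite) {g : Site 2 → ℝ} {V : Site 2 → Site 2 → ℝ}
    {M : ℝ} {xl xr yb yt : ℤ}
    (hmean : ∀ p ∈ F, xl < p 0 → p 0 < xr → yb < p 1 → p 1 < yt →
      ∑ k : Fin 4, (V p (p + cornerUnit k) - g p) = 0)
    (hVin : ∀ p ∈ F, ∀ k : Fin 4, p + cornerUnit k ∈ F → V p (p + cornerUnit k) = g (p + cornerUnit k))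
    (hVout : ∀ p ∈ F, xl < p 0 → p 0 < xr → yb < p 1 → p 1 < yt → ∀ k : Fin 4, p + cornerUnit k ∉ F → |V p (p + cornerUnit k)| ≤ M)
    (hbd : ∀ p ∈ F, xl ≤ p 0 → p 0 ≤ xr → yb ≤ p 1 → p 1 ≤ yt →
      (p 0 = xl ∨ p 0 = xr ∨ p 1 = yb ∨ p 1 = yt) → |g p| ≤ M) :
    ∀ p ∈ F, xl ≤ p 0 → p 0 ≤ xr → yb ≤ p 1 → p 1 ≤ yt → |g p| ≤ M := by
  intro p hp h1 h2 h3 h4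
  rw [abs_le]
  constructor
  · have := le_of_meanValue_rect hF (g := fun p => -g p) (V := fun p n => -V p n) (M := M) (xl := xl) (xr := xr)
      (yb := yb) (yt := yt) (fun p hp a b c d => by
        have := hmean p hp a b c d
        have e : ∑ k : Fin 4, (-V p (p + cornerUnit k) - -g p) = -∑ k : Fin 4, (V p (p + cornerUnit k) - g p) := by
          rw [← Finset.sum_neg_distrib]
          exact Finset.sum_congr rfl fun k _ => by ring
        rw [e, this, neg_zero])
      (fun p hp k hk => by simp [hVin p hp k hk])
      (fun p hp a b c d k hk => by have := hVout p hp a b c d k hk; rw [abs_le] at this; linarith)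
      (fun p hp a b c d e => by have := hbd p hp a b c d e; rw [abs_le] at this; linarith) p hp h1 h2 h3 h4
    linarith
  · exact le_of_meanValue_rect hF hmean hVin
      (fun p hp a b c d k hk => (le_abs_self _).trans (hVout p hp a b c d k hk))
      (fun p hp a b c d e => (le_abs_self _).trans (hbd p hp a b c d e)) p hp h1 h2 h3 h4

end LocalSupBound

section RectRing

/-- Equality of `2`-vectors in coordinates. [folklore] -/
theorem vec2_eq_iff (a b c d : ℤ) : ((![a, b] : Site 2) = ![c, d]) ↔ a = c ∧ b = d := by
  constructor
  · intro h
    exact ⟨by simpa using congrFun h 0, by simpa using congrFun h 1⟩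
  · rintro ⟨rfl, rfl⟩; rfl

/-- The boundary ring of the index rectangle `[xl, xr] × [yb, yt]` as a periodic sequence of
squares: bottom row rightwards, right column upwards, top row leftwards, left column downwards.
[folklore] -/
def rectRing (xl xr yb yt : ℤ) (k : ℕ) : Site 2 :=
  let a := (xr - xl).toNat
  let b := (yt - yb).toNat
  let j := k % (2 * a + 2 * b)
  if j < a then ![xl + j, yb]
  else if j < a + b then ![xr, yb + (j - a : ℕ)]
  else if j < 2 * a + b then ![xr - (j - a - b : ℕ), yt]
  else ![xl, yt - (j - 2 * a - b : ℕ)]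

variable {xl xr yb yt : ℤ}

/-- The ring is periodic with period the perimeter. [folklore] -/
theorem rectRing_add_period (xl xr yb yt : ℤ) (k : ℕ) :
    rectRing xl xr yb yt (k + (2 * (xr - xl).toNat + 2 * (yt - yb).toNat)) = rectRing xl xr yb yt k := by
  simp only [rectRing, Nat.add_mod_right]

/-- The ring only depends on the index modulo the perimeter. [folklore] -/
theorem rectRing_mod (xl xr yb yt : ℤ) (k : ℕ) :
    rectRing xl xr yb yt (k % (2 * (xr - xl).toNat + 2 * (yt - yb).toNat)) = rectRing xl xr yb yt k := by
  simp only [rectRing, Nat.mod_mod]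

/-- Bottom row of the ring. [folklore] -/
theorem rectRing_bottom (hx : xl < xr) (hy : yb < yt) {i : ℕ} (hi : (i : ℤ) ≤ xr - xl) :
    rectRing xl xr yb yt i = ![xl + i, yb] := by
  have ha : ((xr - xl).toNat : ℤ) = xr - xl := Int.toNat_of_nonneg (by omega)
  have hb : ((yt - yb).toNat : ℤ) = yt - yb := Int.toNat_of_nonneg (by omega)
  simp only [rectRing]
  rw [Nat.mod_eq_of_lt (by omega : i < 2 * (xr - xl).toNat + 2 * (yt - yb).toNat)]
  by_cases h1 : i < (xr - xl).toNat
  · rw [if_pos h1]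
  · rw [if_neg h1, if_pos (by omega), vec2_eq_iff]
    constructor <;> omega

/-- Right column of the ring. [folklore] -/
theorem rectRing_right (hx : xl < xr) (hy : yb < yt) {i : ℕ} (hi : (i : ℤ) ≤ yt - yb) :
    rectRing xl xr yb yt ((xr - xl).toNat + i) = ![xr, yb + i] := by
  have ha : ((xr - xl).toNat : ℤ) = xr - xl := Int.toNat_of_nonneg (by omega)
  have hb : ((yt - yb).toNat : ℤ) = yt - yb := Int.toNat_of_nonneg (by omega)
  simp only [rectRing]
  rw [Nat.mod_eq_of_lt (by omega : (xr - xl).toNat + i < 2 * (xr - xl).toNat + 2 * (yt - yb).toNat), if_neg (by omega)]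
  by_cases h1 : (xr - xl).toNat + i < (xr - xl).toNat + (yt - yb).toNat
  · rw [if_pos h1, vec2_eq_iff]
    constructor <;> omega
  · rw [if_neg h1, if_pos (by omega), vec2_eq_iff]
    constructor <;> omega

/-- Top row of the ring. [folklore] -/
theorem rectRing_top (hx : xl < xr) (hy : yb < yt) {i : ℕ} (hi : (i : ℤ) ≤ xr - xl) :
    rectRing xl xr yb yt ((xr - xl).toNat + (yt - yb).toNat + i) = ![xr - i, yt] := by
  have ha : ((xr - xl).toNat : ℤ) = xr - xl := Int.toNat_of_nonneg (by omega)
  have hb : ((yt - yb).toNat : ℤ) = yt - yb := Int.toNat_of_nonneg (by omega)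
  simp only [rectRing]
  rw [Nat.mod_eq_of_lt (by omega : (xr - xl).toNat + (yt - yb).toNat + i < 2 * (xr - xl).toNat + 2 * (yt - yb).toNat),
    if_neg (by omega), if_neg (by omega)]
  by_cases h1 : (xr - xl).toNat + (yt - yb).toNat + i < 2 * (xr - xl).toNat + (yt - yb).toNat
  · rw [if_pos h1, vec2_eq_iff]
    constructor <;> omega
  · rw [if_neg h1, vec2_eq_iff]
    constructor <;> omega

/-- Left column of the ring. [folklore] -/
theorem rectRing_left (hx : xl < xr) (hy : yb < yt) {i : ℕ} (hi : (i : ℤ) ≤ yt - yb) :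
    rectRing xl xr yb yt (2 * (xr - xl).toNat + (yt - yb).toNat + i) = ![xl, yt - i] := by
  have ha : ((xr - xl).toNat : ℤ) = xr - xl := Int.toNat_of_nonneg (by omega)
  have hb : ((yt - yb).toNat : ℤ) = yt - yb := Int.toNat_of_nonneg (by omega)
  by_cases h1 : 2 * (xr - xl).toNat + (yt - yb).toNat + i < 2 * (xr - xl).toNat + 2 * (yt - yb).toNat
  · simp only [rectRing]
    rw [Nat.mod_eq_of_lt h1, if_neg (by omega), if_neg (by omega), if_neg (by omega), vec2_eq_iff]
    constructor <;> omega
  · have heq : 2 * (xr - xl).toNat + (yt - yb).toNat + i = 0 + (2 * (xr - xl).toNat + 2 * (yt - yb).toNat) := by omega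
    rw [heq, rectRing_add_period, rectRing_bottom hx hy (i := 0) (by omega), vec2_eq_iff]
    constructor <;> omega

/-- Consecutive squares of the ring are lattice neighbours. [folklore] -/
theorem rectRing_adj (hx : xl < xr) (hy : yb < yt) (k : ℕ) :
    (zdGraph 2).Adj (rectRing xl xr yb yt k) (rectRing xl xr yb yt (k + 1)) := by
  have ha : ((xr - xl).toNat : ℤ) = xr - xl := Int.toNat_of_nonneg (by omega)
  have hb : ((yt - yb).toNat : ℤ) = yt - yb := Int.toNat_of_nonneg (by omega)
  have hP : 0 < 2 * (xr - xl).toNat + 2 * (yt - yb).toNat := by omega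
  rw [← rectRing_mod xl xr yb yt k, ← rectRing_mod xl xr yb yt (k + 1)]
  have hk1 : (k + 1) % (2 * (xr - xl).toNat + 2 * (yt - yb).toNat) =
      (k % (2 * (xr - xl).toNat + 2 * (yt - yb).toNat) + 1) % (2 * (xr - xl).toNat + 2 * (yt - yb).toNat) := by
    rw [Nat.add_mod, Nat.one_mod_eq_one.2 (by omega)]
  rw [hk1]
  generalize hj : k % (2 * (xr - xl).toNat + 2 * (yt - yb).toNat) = j
  have hjP : j < 2 * (xr - xl).toNat + 2 * (yt - yb).toNat := hj ▸ Nat.mod_lt _ hP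
  by_cases hlast : j + 1 = 2 * (xr - xl).toNat + 2 * (yt - yb).toNat
  · -- wrap around: `(xl, yb + 1) → (xl, yb)`
    rw [hlast, Nat.mod_self, show j = 2 * (xr - xl).toNat + (yt - yb).toNat + ((yt - yb).toNat - 1) by omega,
      rectRing_left hx hy (by omega), rectRing_bottom hx hy (i := 0) (by omega)]
    refine adj_of_stepKind (.down ?_ ?_) <;> simp; omega
  rw [Nat.mod_eq_of_lt (by omega : j + 1 < 2 * (xr - xl).toNat + 2 * (yt - yb).toNat)]
  rcases (show j + 1 ≤ (xr - xl).toNat ∨ ((xr - xl).toNat ≤ j ∧ j + 1 ≤ (xr - xl).toNat + (yt - yb).toNat) ∨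
      ((xr - xl).toNat + (yt - yb).toNat ≤ j ∧ j + 1 ≤ 2 * (xr - xl).toNat + (yt - yb).toNat) ∨
      (2 * (xr - xl).toNat + (yt - yb).toNat ≤ j) by omega) with h1 | ⟨h1, h2⟩ | ⟨h1, h2⟩ | h1
  · rw [rectRing_bottom hx hy (i := j) (by omega), rectRing_bottom hx hy (i := j + 1) (by omega)]
    refine adj_of_stepKind (.right ?_ ?_) <;> simp; omega
  · obtain ⟨i, hi⟩ : ∃ i, j = (xr - xl).toNat + i := ⟨j - (xr - xl).toNat, by omega⟩
    rw [hi, show (xr - xl).toNat + i + 1 = (xr - xl).toNat + (i + 1) by omega, rectRing_right hx hy (i := i) (by omega),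
      rectRing_right hx hy (i := i + 1) (by omega)]
    refine adj_of_stepKind (.up ?_ ?_) <;> simp; omega
  · obtain ⟨i, hi⟩ : ∃ i, j = (xr - xl).toNat + (yt - yb).toNat + i := ⟨j - (xr - xl).toNat - (yt - yb).toNat, by omega⟩
    rw [hi, show (xr - xl).toNat + (yt - yb).toNat + i + 1 = (xr - xl).toNat + (yt - yb).toNat + (i + 1) by omega,
      rectRing_top hx hy (i := i) (by omega), rectRing_top hx hy (i := i + 1) (by omega)]
    refine adj_of_stepKind (.left ?_ ?_) <;> simp; omega
  · obtain ⟨i, hi⟩ : ∃ i, j = 2 * (xr - xl).toNat + (yt - yb).toNat + i := ⟨j - 2 * (xr - xl).toNat - (yt - yb).toNat, by omega⟩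
    rw [hi, show 2 * (xr - xl).toNat + (yt - yb).toNat + i + 1 = 2 * (xr - xl).toNat + (yt - yb).toNat + (i + 1) by omega,
      rectRing_left hx hy (i := i) (by omega), rectRing_left hx hy (i := i + 1) (by omega)]
    refine adj_of_stepKind (.down ?_ ?_) <;> simp; omega

/-- Every square on the boundary of the rectangle is on the ring. [folklore] -/
theorem exists_rectRing_eq (hx : xl < xr) (hy : yb < yt) {p : Site 2} (h0 : xl ≤ p 0) (h1 : p 0 ≤ xr)
    (h2 : yb ≤ p 1) (h3 : p 1 ≤ yt) (hb : p 0 = xl ∨ p 0 = xr ∨ p 1 = yb ∨ p 1 = yt) :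
    ∃ k, k < 2 * (xr - xl).toNat + 2 * (yt - yb).toNat ∧ rectRing xl xr yb yt k = p := by
  have ha : ((xr - xl).toNat : ℤ) = xr - xl := Int.toNat_of_nonneg (by omega)
  have hbb : ((yt - yb).toNat : ℤ) = yt - yb := Int.toNat_of_nonneg (by omega)
  have hP : 0 < 2 * (xr - xl).toNat + 2 * (yt - yb).toNat := by omega
  rcases hb with e | e | e | e
  · have hc : ((yt - p 1).toNat : ℤ) = yt - p 1 := Int.toNat_of_nonneg (by omega)
    refine ⟨(2 * (xr - xl).toNat + (yt - yb).toNat + (yt - p 1).toNat) % (2 * (xr - xl).toNat + 2 * (yt - yb).toNat),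
      Nat.mod_lt _ hP, ?_⟩
    rw [rectRing_mod, rectRing_left hx hy (by omega)]
    ext j; fin_cases j <;> simp <;> omega
  · have hc : ((p 1 - yb).toNat : ℤ) = p 1 - yb := Int.toNat_of_nonneg (by omega)
    refine ⟨(xr - xl).toNat + (p 1 - yb).toNat, by omega, ?_⟩
    rw [rectRing_right hx hy (by omega)]
    ext j; fin_cases j <;> simp <;> omega
  · have hc : ((p 0 - xl).toNat : ℤ) = p 0 - xl := Int.toNat_of_nonneg (by omega)
    refine ⟨(p 0 - xl).toNat, by omega, ?_⟩
    rw [rectRing_bottom hx hy (by omega)]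
    ext j; fin_cases j <;> simp <;> omega
  · have hc : ((xr - p 0).toNat : ℤ) = xr - p 0 := Int.toNat_of_nonneg (by omega)
    refine ⟨(xr - xl).toNat + (yt - yb).toNat + (xr - p 0).toNat, by omega, ?_⟩
    rw [rectRing_top hx hy (by omega)]
    ext j; fin_cases j <;> simp <;> omega

/-- Ring squares lie on the boundary of the rectangle. [folklore] -/
theorem rectRing_mem (hx : xl < xr) (hy : yb < yt) (k : ℕ) :
    xl ≤ rectRing xl xr yb yt k 0 ∧ rectRing xl xr yb yt k 0 ≤ xr ∧ yb ≤ rectRing xl xr yb yt k 1 ∧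
      rectRing xl xr yb yt k 1 ≤ yt ∧
      (rectRing xl xr yb yt k 0 = xl ∨ rectRing xl xr yb yt k 0 = xr ∨ rectRing xl xr yb yt k 1 = yb ∨
        rectRing xl xr yb yt k 1 = yt) := by
  have ha : ((xr - xl).toNat : ℤ) = xr - xl := Int.toNat_of_nonneg (by omega)
  have hbb : ((yt - yb).toNat : ℤ) = yt - yb := Int.toNat_of_nonneg (by omega)
  rw [← rectRing_mod xl xr yb yt k]
  generalize hj : k % (2 * (xr - xl).toNat + 2 * (yt - yb).toNat) = j
  have hjP : j < 2 * (xr - xl).toNat + 2 * (yt - yb).toNat := hj ▸ Nat.mod_lt _ (by omega)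
  rcases (show j ≤ (xr - xl).toNat ∨ ((xr - xl).toNat ≤ j ∧ j ≤ (xr - xl).toNat + (yt - yb).toNat) ∨
      ((xr - xl).toNat + (yt - yb).toNat ≤ j ∧ j ≤ 2 * (xr - xl).toNat + (yt - yb).toNat) ∨
      (2 * (xr - xl).toNat + (yt - yb).toNat ≤ j) by omega) with h1 | ⟨h1, h2⟩ | ⟨h1, h2⟩ | h1
  · rw [rectRing_bottom hx hy (i := j) (by omega)]; simp; omega
  · obtain ⟨i, hi⟩ : ∃ i, j = (xr - xl).toNat + i := ⟨j - (xr - xl).toNat, by omega⟩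
    rw [hi, rectRing_right hx hy (i := i) (by omega)]; simp; omega
  · obtain ⟨i, hi⟩ : ∃ i, j = (xr - xl).toNat + (yt - yb).toNat + i := ⟨j - (xr - xl).toNat - (yt - yb).toNat, by omega⟩
    rw [hi, rectRing_top hx hy (i := i) (by omega)]; simp; omega
  · obtain ⟨i, hi⟩ : ∃ i, j = 2 * (xr - xl).toNat + (yt - yb).toNat + i := ⟨j - 2 * (xr - xl).toNat - (yt - yb).toNat, by omega⟩
    rw [hi, rectRing_left hx hy (i := i) (by omega)]; simp; omega

/-- The sum of a periodic sequence over a period does not depend on where the period starts. [folklore] -/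
theorem sum_range_shift_of_periodic {M : Type*} [AddCommGroup M] {f : ℕ → M} {P : ℕ}
    (hf : ∀ k, f (k + P) = f k) (k₀ : ℕ) :
    ∑ l ∈ Finset.range P, f (k₀ + l) = ∑ l ∈ Finset.range P, f l := by
  induction k₀ with
  | zero => simp
  | succ k ih =>
    rw [← ih]
    have e3 : ∑ l ∈ Finset.range P, f (k + 1 + l) = ∑ l ∈ Finset.range P, f (k + (l + 1)) :=
      Finset.sum_congr rfl fun l _ => by rw [Nat.add_right_comm, Nat.add_assoc]
    have key : ∑ l ∈ Finset.range P, f (k + (l + 1)) + f (k + 0) = ∑ l ∈ Finset.range P, f (k + l) + f (k + P) := by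
      rw [← Finset.sum_range_succ' (fun l => f (k + l)) P, Finset.sum_range_succ]
    rw [hf k, add_zero] at key
    rw [e3]
    exact add_right_cancel key

/-- **The ring sum is the sum of the four side sums.** For a weight `w` with `w y x = w x y`,
the sum over one period of the ring of `w` on consecutive squares is the sum over the bottom
and top rows of the horizontal steps plus the sum over the left and right columns of the
vertical steps. [folklore] -/
theorem sum_rectRing_eq (hx : xl < xr) (hy : yb < yt) {w : Site 2 → Site 2 → ℝ} (hw : ∀ x y, w y x = w x y) :
    ∑ k ∈ Finset.range (2 * (xr - xl).toNat + 2 * (yt - yb).toNat),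
        w (rectRing xl xr yb yt k) (rectRing xl xr yb yt (k + 1)) =
      ∑ i ∈ Finset.range (xr - xl).toNat, w ![xl + i, yb] ![xl + i + 1, yb] +
      ∑ i ∈ Finset.range (yt - yb).toNat, w ![xr, yb + i] ![xr, yb + i + 1] +
      ∑ i ∈ Finset.range (xr - xl).toNat, w ![xl + i, yt] ![xl + i + 1, yt] +
      ∑ i ∈ Finset.range (yt - yb).toNat, w ![xl, yb + i] ![xl, yb + i + 1] := by
  have ha : ((xr - xl).toNat : ℤ) = xr - xl := Int.toNat_of_nonneg (by omega)
  have hbb : ((yt - yb).toNat : ℤ) = yt - yb := Int.toNat_of_nonneg (by omega)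
  rw [show 2 * (xr - xl).toNat + 2 * (yt - yb).toNat = (xr - xl).toNat + (yt - yb).toNat + (xr - xl).toNat + (yt - yb).toNat by ring,
    Finset.sum_range_add, Finset.sum_range_add, Finset.sum_range_add]
  congr 1
  congr 1
  congr 1
  · refine Finset.sum_congr rfl fun i hi => ?_
    rw [Finset.mem_range] at hi
    rw [rectRing_bottom hx hy (i := i) (by omega), rectRing_bottom hx hy (i := i + 1) (by omega)]
    congr 1; rw [vec2_eq_iff]; constructor <;> push_cast <;> ring
  · refine Finset.sum_congr rfl fun i hi => ?_
    rw [Finset.mem_range] at hi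
    rw [rectRing_right hx hy (i := i) (by omega), show (xr - xl).toNat + i + 1 = (xr - xl).toNat + (i + 1) by omega,
      rectRing_right hx hy (i := i + 1) (by omega)]
    congr 1; rw [vec2_eq_iff]; constructor <;> push_cast <;> ring
  · -- top row, traversed leftwards: reindex `i ↦ a - 1 - i`
    have h1 : ∀ i ∈ Finset.range (xr - xl).toNat,
        w (rectRing xl xr yb yt ((xr - xl).toNat + (yt - yb).toNat + i))
          (rectRing xl xr yb yt ((xr - xl).toNat + (yt - yb).toNat + i + 1)) =
        w ![xl + ((xr - xl).toNat - 1 - i : ℕ), yt] ![xl + ((xr - xl).toNat - 1 - i : ℕ) + 1, yt] := by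
      intro i hi
      rw [Finset.mem_range] at hi
      rw [rectRing_top hx hy (i := i) (by omega),
        show (xr - xl).toNat + (yt - yb).toNat + i + 1 = (xr - xl).toNat + (yt - yb).toNat + (i + 1) by omega,
        rectRing_top hx hy (i := i + 1) (by omega), hw]
      have hc : (((xr - xl).toNat - 1 - i : ℕ) : ℤ) = (xr - xl).toNat - 1 - i := by omega
      congr 1 <;> rw [vec2_eq_iff] <;> constructor <;> omega
    rw [Finset.sum_congr rfl h1]
    exact Finset.sum_range_reflect (fun i => w ![xl + (i : ℕ), yt] ![xl + (i : ℕ) + 1, yt]) (xr - xl).toNat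
  · have h1 : ∀ i ∈ Finset.range (yt - yb).toNat,
        w (rectRing xl xr yb yt ((xr - xl).toNat + (yt - yb).toNat + (xr - xl).toNat + i))
          (rectRing xl xr yb yt ((xr - xl).toNat + (yt - yb).toNat + (xr - xl).toNat + i + 1)) =
        w ![xl, yb + ((yt - yb).toNat - 1 - i : ℕ)] ![xl, yb + ((yt - yb).toNat - 1 - i : ℕ) + 1] := by
      intro i hi
      rw [Finset.mem_range] at hi
      rw [show (xr - xl).toNat + (yt - yb).toNat + (xr - xl).toNat + i = 2 * (xr - xl).toNat + (yt - yb).toNat + i by ring,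
        rectRing_left hx hy (i := i) (by omega),
        show 2 * (xr - xl).toNat + (yt - yb).toNat + i + 1 = 2 * (xr - xl).toNat + (yt - yb).toNat + (i + 1) by omega,
        rectRing_left hx hy (i := i + 1) (by omega), hw]
      have hc : (((yt - yb).toNat - 1 - i : ℕ) : ℤ) = (yt - yb).toNat - 1 - i := by omega
      congr 1 <;> rw [vec2_eq_iff] <;> constructor <;> omega
    rw [Finset.sum_congr rfl h1]
    exact Finset.sum_range_reflect (fun i => w ![xl, yb + (i : ℕ)] ![xl, yb + (i : ℕ) + 1]) (yt - yb).toNat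

end RectRing

section RingBound

open WeakBeurling

variable {δ : ℝ}

open Classical in
/-- **Bound for the conjugate on the boundary ring of a rectangle.** Let `c` be the common
virtual value of the exits met along the ring (forward direction), and suppose some square of
the ring is not in the component. Then at every square of the component on the ring,
`|h' - c| ≤ 1 + Σ_ring |dh'|`: walk along the ring up to the first exit (where `h' = c ∓ i`,
`|i| ≤ 1`), telescoping the CR-increments. [folklore] -/
theorem abs_dualPot_sub_le_of_ring (R : RandomPlanarGeometry.ConformalRectangle) (h0 : (0 : ℂ) ∈ R.carrier)
    (hδ : 0 < δ) {h : Site 2 → ℝ} {T B : Set (Site 2)} (hT : T ⊆ boundary R.carrier δ) (hB : B ⊆ boundary R.carrier δ)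
    (hharm : ∀ x, x ∉ T → x ∉ B →
      ∑ y ∈ ((zdGraph 2).neighborFinset x).filter (fun y => (domainGraph R.carrier δ).Adj x y), (h y - h x) = 0)
    (h01 : ∀ x, h x ∈ Icc (0 : ℝ) 1) {p₀ : Site 2} (hp₀ : IsInnerSq R.carrier δ p₀) {c : ℝ} {xl xr yb yt : ℤ}
    (hx : xl < xr) (hy : yb < yt)
    (hexit : ∀ k, (dualGraph R.carrier δ).Reachable p₀ (rectRing xl xr yb yt k) →
      ¬ (dualGraph R.carrier δ).Reachable p₀ (rectRing xl xr yb yt (k + 1)) →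
      exitVal R.carrier δ h p₀ (rectRing xl xr yb yt k) (rectRing xl xr yb yt (k + 1)) = c)
    {k₁ : ℕ} (hout : ¬ (dualGraph R.carrier δ).Reachable p₀ (rectRing xl xr yb yt k₁))
    {k₀ : ℕ} (hp : (dualGraph R.carrier δ).Reachable p₀ (rectRing xl xr yb yt k₀)) :
    |dualPot R.carrier δ h p₀ (rectRing xl xr yb yt k₀) - c| ≤
      1 + ∑ l ∈ Finset.range (2 * (xr - xl).toNat + 2 * (yt - yb).toNat),
        |stepFlux (curH R.carrier δ h) (curV R.carrier δ h) (rectRing xl xr yb yt l) (rectRing xl xr yb yt (l + 1))| := by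
  set P := 2 * (xr - xl).toNat + 2 * (yt - yb).toNat with hP
  have hP0 : 0 < P := by rw [hP]; omega
  set ring := rectRing xl xr yb yt with hring
  set F : Set (Site 2) := {q | (dualGraph R.carrier δ).Reachable p₀ q} with hF
  set f : ℕ → ℝ := fun l => |stepFlux (curH R.carrier δ h) (curV R.carrier δ h) (ring l) (ring (l + 1))| with hf
  have hfper : ∀ l, f (l + P) = f l := fun l => by
    simp only [hf, hring, hP, show l + (2 * (xr - xl).toNat + 2 * (yt - yb).toNat) + 1 =
      l + 1 + (2 * (xr - xl).toNat + 2 * (yt - yb).toNat) by ring, rectRing_add_period]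
  -- a non-member within one period ahead
  have hex : ∃ m, ¬ (dualGraph R.carrier δ).Reachable p₀ (ring (k₀ + m)) := by
    refine ⟨(k₁ + P - k₀ % P) % P + P * 0, ?_⟩
    have e : ring (k₀ + ((k₁ + P - k₀ % P) % P + P * 0)) = ring k₁ := by
      rw [hring, ← rectRing_mod xl xr yb yt (k₀ + _), ← rectRing_mod xl xr yb yt k₁, ← hP]
      congr 1
      rw [Nat.mul_zero, Nat.add_zero]
      have e1 : k₀ + (k₁ + P - k₀ % P) % P = (k₁ + P - k₀ % P) % P + k₀ % P + P * (k₀ / P) := by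
        have := Nat.div_add_mod k₀ P; omega
      have e2 : (k₁ + P - k₀ % P) % P + k₀ % P = (k₁ + P - k₀ % P) % P + (k₀ % P) % P := by
        rw [Nat.mod_mod]
      rw [e1, Nat.add_mul_mod_self_left, e2, ← Nat.add_mod, show k₁ + P - k₀ % P + k₀ % P = k₁ + P by
        have := Nat.mod_lt k₀ hP0; omega, Nat.add_mod_right]
    rw [e]; exact hout
  set m₀ := Nat.find hex with hm₀
  have hm₀spec : ¬ (dualGraph R.carrier δ).Reachable p₀ (ring (k₀ + m₀)) := Nat.find_spec hex
  have hmem : ∀ l < m₀, (dualGraph R.carrier δ).Reachable p₀ (ring (k₀ + l)) := fun l hl => by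
    have := Nat.find_min hex (hm₀ ▸ hl)
    simpa using this
  have hm₀pos : 0 < m₀ := by
    by_contra h0'
    have : m₀ = 0 := by omega
    rw [this, add_zero] at hm₀spec
    exact hm₀spec hp
  have hm₀le : m₀ ≤ P := by
    have h1 : ¬ (dualGraph R.carrier δ).Reachable p₀ (ring (k₀ + (k₁ + P - k₀ % P) % P)) := by
      have e : ring (k₀ + (k₁ + P - k₀ % P) % P) = ring k₁ := by
        rw [hring, ← rectRing_mod xl xr yb yt (k₀ + _), ← rectRing_mod xl xr yb yt k₁, ← hP]
        congr 1
        have e1 : k₀ + (k₁ + P - k₀ % P) % P = (k₁ + P - k₀ % P) % P + k₀ % P + P * (k₀ / P) := by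
          have := Nat.div_add_mod k₀ P; omega
        have e2 : (k₁ + P - k₀ % P) % P + k₀ % P = (k₁ + P - k₀ % P) % P + (k₀ % P) % P := by
          rw [Nat.mod_mod]
        rw [e1, Nat.add_mul_mod_self_left, e2, ← Nat.add_mod, show k₁ + P - k₀ % P + k₀ % P = k₁ + P by
          have := Nat.mod_lt k₀ hP0; omega, Nat.add_mod_right]
      rw [e]; exact hout
    have := Nat.find_min' hex h1
    have h2 : (k₁ + P - k₀ % P) % P < P := Nat.mod_lt _ hP0
    omega
  -- telescoping along the ring
  set g : ℕ → ℝ := fun l => dualPot R.carrier δ h p₀ (ring (k₀ + l)) - c with hg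
  have hstep : ∀ l, l + 1 < m₀ → g (l + 1) - g l = stepFlux (curH R.carrier δ h) (curV R.carrier δ h)
      (ring (k₀ + l)) (ring (k₀ + l + 1)) := by
    intro l hl
    have hr1 := hmem l (by omega)
    have hr2 := hmem (l + 1) hl
    have hadj : (dualGraph R.carrier δ).Adj (ring (k₀ + l)) (ring (k₀ + l + 1)) := by
      refine dualGraph_adj_iff.2 ⟨by rw [hring]; exact rectRing_adj hx hy _, ?_, ?_⟩
      · obtain ⟨W⟩ := hr1; exact isInnerSq_of_mem_support' hp₀ W (Walk.end_mem_support _)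
      · obtain ⟨W⟩ := hr2; exact isInnerSq_of_mem_support' hp₀ W (Walk.end_mem_support _)
    simp only [hg, show k₀ + (l + 1) = k₀ + l + 1 by ring]
    rw [← dualPot_sub_dualPot_of_adj R h0 hδ hT hB hharm hp₀ hr1 hadj]
    ring
  have htel : ∀ n, n < m₀ → |g 0 - g n| ≤ ∑ l ∈ Finset.range n, f (k₀ + l) := by
    intro n
    induction n with
    | zero => intro _; simp
    | succ n ih =>
      intro hn
      have h1 := ih (by omega)
      have h2 := hstep n hn
      rw [Finset.sum_range_succ]
      have h3 : |g n - g (n + 1)| = f (k₀ + n) := by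
        rw [abs_sub_comm, h2]
      calc |g 0 - g (n + 1)| ≤ |g 0 - g n| + |g n - g (n + 1)| := abs_sub_le _ _ _
        _ ≤ _ := by rw [h3]; linarith
  -- the last member before the exit
  have hlast : |g (m₀ - 1)| ≤ 1 := by
    have hr := hmem (m₀ - 1) (by omega)
    have hex' := hexit (k₀ + (m₀ - 1)) hr (by rw [show k₀ + (m₀ - 1) + 1 = k₀ + m₀ by omega]; exact hm₀spec)
    simp only [hg]
    rw [exitVal] at hex'
    have : dualPot R.carrier δ h p₀ (ring (k₀ + (m₀ - 1))) - c =
        -stepFlux (curH R.carrier δ h) (curV R.carrier δ h) (ring (k₀ + (m₀ - 1))) (ring (k₀ + (m₀ - 1) + 1)) := by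
      rw [hring] at hex' ⊢; linarith
    rw [this, abs_neg]
    exact abs_stepFlux_le_one h01 _ _
  have hmain := htel (m₀ - 1) (by omega)
  have hsum : ∑ l ∈ Finset.range (m₀ - 1), f (k₀ + l) ≤ ∑ l ∈ Finset.range P, f l := by
    rw [← sum_range_shift_of_periodic hfper k₀]
    exact Finset.sum_le_sum_of_subset_of_nonneg (Finset.range_mono (by omega)) fun l _ _ => abs_nonneg _
  have hg0 : g 0 = dualPot R.carrier δ h p₀ (ring k₀) - c := by simp [hg]
  rw [← hg0]
  calc |g 0| ≤ |g 0 - g (m₀ - 1)| + |g (m₀ - 1)| := by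
        have := abs_add_le (g 0 - g (m₀ - 1)) (g (m₀ - 1)); rwa [sub_add_cancel] at this
    _ ≤ ∑ l ∈ Finset.range P, f l + 1 := add_le_add (hmain.trans hsum) hlast
    _ = _ := by rw [add_comm]

end RingBound

section GoodLines

open WeakBeurling

variable {Ω : Set ℂ} {δ : ℝ}

/-- `cur x y ^ 2` is the squared increment of the edge when `{x, y}` is an edge of `Ω_n`, and
zero otherwise. [folklore] -/
theorem cur_sq_eq (h : Site 2 → ℝ) (x y : Site 2) [Decidable ((domainGraph Ω δ).Adj x y)] :
    cur Ω δ h x y ^ 2 = if (domainGraph Ω δ).Adj x y then sqIncr h s(x, y) else 0 := by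
  unfold cur
  split_ifs <;> simp

open Classical in
/-- **Energy bound for a family of distinct edges.** The sum of `cur²` over the vertical edges
`{a(t,i), a(t,i) + e₁}` indexed injectively by a finite set is at most the energy
`Σ_e (dh(e))²` of `h` on `Ω_n`. [folklore] -/
theorem sum_cur_sq_le_energy {ι : Type*} (s : Finset ι) (a : ι → Site 2) (ha : Set.InjOn a s)
    (h : Site 2 → ℝ) (u : Site 2) (hu : u ≠ 0) (hEF : (domainGraph Ω δ).edgeSet.Finite) :
    ∑ t ∈ s, cur Ω δ h (a t) (a t + u) ^ 2 ≤ ∑ e ∈ hEF.toFinset, sqIncr h e := by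
  have step1 : ∑ t ∈ s, cur Ω δ h (a t) (a t + u) ^ 2 =
      ∑ t ∈ s.filter (fun t => (domainGraph Ω δ).Adj (a t) (a t + u)), sqIncr h s(a t, a t + u) := by
    rw [Finset.sum_filter]
    exact Finset.sum_congr rfl fun t _ => cur_sq_eq h _ _
  rw [step1]
  have hinj : Set.InjOn (fun t => s(a t, a t + u)) (s.filter (fun t => (domainGraph Ω δ).Adj (a t) (a t + u))) := by
    intro t ht t' ht' he
    simp only [Finset.coe_filter, Set.mem_setOf_eq] at ht ht'
    have : a t = a t' := by
      rcases Sym2.eq_iff.1 he with ⟨h1, -⟩ | ⟨h1, h2⟩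
      · exact h1
      · -- `a t = a t' + u` and `a t + u = a t'` give `u + u = 0`
        have e : a t' + (u + u) = a t' + 0 := by rw [add_zero, ← add_assoc, ← h1]; exact h2
        have huu : u + u = 0 := add_left_cancel e
        exfalso; apply hu
        ext i
        have := congrFun huu i
        simp only [Pi.add_apply, Pi.zero_apply] at this
        simp only [Pi.zero_apply]
        omega
    exact ha ht.1 ht'.1 this
  rw [← Finset.sum_image hinj]
  refine Finset.sum_le_sum_of_subset_of_nonneg (fun e he => ?_) fun e _ _ => sqIncr_nonneg h e
  rw [Finset.mem_image] at he
  obtain ⟨t, ht, rfl⟩ := he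
  exact hEF.mem_toFinset.2 (Finset.mem_filter.1 ht).2

/-- **A good line.** Among `J + 1` parallel lines of `4J` steps each, one has total `|dh'|` at
most `2 √E`, `E` the energy (Cauchy–Schwarz and pigeonhole). Here for horizontal runs of squares
`(x₀ + i, y₀ + t)`, `i < 4J`, `t ≤ J`, whose steps cross the vertical edges from
`(x₀ + i + 1, y₀ + t)`. [folklore] -/
theorem exists_good_row (hEF : (domainGraph Ω δ).edgeSet.Finite) (h : Site 2 → ℝ) {E : ℝ}
    (hE : ∑ e ∈ hEF.toFinset, sqIncr h e ≤ E) (x₀ y₀ : ℤ) {J : ℕ} (hJ : 1 ≤ J) :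
    ∃ t : ℕ, t ≤ J ∧ ∑ i ∈ Finset.range (4 * J),
      |stepFlux (curH Ω δ h) (curV Ω δ h) ![x₀ + i, y₀ + t] ![x₀ + i + 1, y₀ + t]| ≤ 2 * Real.sqrt E := by
  classical
  -- the step fluxes are currents of vertical edges
  have hsf : ∀ (i t : ℕ), stepFlux (curH Ω δ h) (curV Ω δ h) ![x₀ + i, y₀ + t] ![x₀ + i + 1, y₀ + t] =
      -cur Ω δ h ![x₀ + i + 1, y₀ + t] (![x₀ + i + 1, y₀ + t] + Pi.single 1 1) := by
    intro i t
    have hval : stepFlux (curH Ω δ h) (curV Ω δ h) ![x₀ + i, y₀ + t] ![x₀ + i + 1, y₀ + t] =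
        -curV Ω δ h (![x₀ + i, y₀ + t] - Pi.single 1 1) := by
      unfold stepFlux; simp
    rw [hval, curV]
    have hv : (Pi.single 1 1 : Site 2) = ![0, 1] := by ext j; fin_cases j <;> simp
    have h1v : (1 : Site 2) = ![1, 1] := by ext j; fin_cases j <;> simp
    rw [hv, h1v]
    congr 2 <;> ext j <;> fin_cases j <;> simp
  set RS : ℕ → ℝ := fun t => ∑ i ∈ Finset.range (4 * J),
    |stepFlux (curH Ω δ h) (curV Ω δ h) ![x₀ + i, y₀ + t] ![x₀ + i + 1, y₀ + t]| with hRS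
  -- Cauchy–Schwarz on each row and the energy bound over all rows
  have hCS : ∀ t, RS t ^ 2 ≤ 4 * J * ∑ i ∈ Finset.range (4 * J),
      cur Ω δ h ![x₀ + i + 1, y₀ + t] (![x₀ + i + 1, y₀ + t] + Pi.single 1 1) ^ 2 := by
    intro t
    have := sq_sum_le_card_mul_sum_sq (s := Finset.range (4 * J))
      (f := fun i => |stepFlux (curH Ω δ h) (curV Ω δ h) ![x₀ + i, y₀ + t] ![x₀ + i + 1, y₀ + t]|)
    simp only [Finset.card_range, sq_abs] at this
    refine this.trans (le_of_eq ?_)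
    push_cast
    congr 1
    exact Finset.sum_congr rfl fun i _ => by rw [hsf, neg_sq]
  have htot : ∑ t ∈ Finset.range (J + 1), ∑ i ∈ Finset.range (4 * J),
      cur Ω δ h ![x₀ + i + 1, y₀ + t] (![x₀ + i + 1, y₀ + t] + Pi.single 1 1) ^ 2 ≤ E := by
    rw [← Finset.sum_product']
    refine (sum_cur_sq_le_energy (Finset.range (J + 1) ×ˢ Finset.range (4 * J))
      (fun p : ℕ × ℕ => (![x₀ + p.2 + 1, y₀ + p.1] : Site 2)) ?_ h (Pi.single 1 1) (by simp) hEF).trans hE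
    intro p _ p' _ he
    have h0 := congrFun he 0
    have h1 := congrFun he 1
    simp at h0 h1
    ext <;> omega
  have hsum : ∑ t ∈ Finset.range (J + 1), RS t ^ 2 ≤ 4 * J * E := by
    calc ∑ t ∈ Finset.range (J + 1), RS t ^ 2
        ≤ ∑ t ∈ Finset.range (J + 1), 4 * J * ∑ i ∈ Finset.range (4 * J),
            cur Ω δ h ![x₀ + i + 1, y₀ + t] (![x₀ + i + 1, y₀ + t] + Pi.single 1 1) ^ 2 :=
          Finset.sum_le_sum fun t _ => hCS t
      _ = 4 * J * ∑ t ∈ Finset.range (J + 1), ∑ i ∈ Finset.range (4 * J),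
            cur Ω δ h ![x₀ + i + 1, y₀ + t] (![x₀ + i + 1, y₀ + t] + Pi.single 1 1) ^ 2 := by
          rw [Finset.mul_sum]
      _ ≤ 4 * J * E := by gcongr
  -- pigeonhole
  have hE0 : 0 ≤ E := le_trans (Finset.sum_nonneg fun e _ => sqIncr_nonneg h e) hE
  obtain ⟨t, ht, hle⟩ := Finset.exists_le_of_sum_le (s := Finset.range (J + 1)) (f := fun t => RS t ^ 2)
    (g := fun _ => 4 * E) (by simp) (by
      rw [Finset.sum_const, Finset.card_range, nsmul_eq_mul]
      push_cast
      have : (4 : ℝ) * J * E ≤ (J + 1) * (4 * E) := by nlinarith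
      exact hsum.trans this)
  refine ⟨t, by simpa [Nat.lt_succ_iff] using ht, ?_⟩
  have hRS0 : 0 ≤ RS t := Finset.sum_nonneg fun i _ => abs_nonneg _
  have : RS t ≤ Real.sqrt (4 * E) := Real.le_sqrt_of_sq_le hle
  rw [show (4 : ℝ) * E = 2 ^ 2 * E by norm_num, Real.sqrt_mul (by norm_num), Real.sqrt_sq (by norm_num)] at this
  exact this

/-- A good column (same, for vertical runs whose steps cross the horizontal edges from
`(x₀ + t + 1, y₀ + i + 1)`… more precisely the edges `{(x₀+t, y₀+i+1) + e₀… }`). [folklore] -/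
theorem exists_good_col (hEF : (domainGraph Ω δ).edgeSet.Finite) (h : Site 2 → ℝ) {E : ℝ}
    (hE : ∑ e ∈ hEF.toFinset, sqIncr h e ≤ E) (x₀ y₀ : ℤ) {J : ℕ} (hJ : 1 ≤ J) :
    ∃ t : ℕ, t ≤ J ∧ ∑ i ∈ Finset.range (4 * J),
      |stepFlux (curH Ω δ h) (curV Ω δ h) ![x₀ + t, y₀ + i] ![x₀ + t, y₀ + i + 1]| ≤ 2 * Real.sqrt E := by
  classical
  have hsf : ∀ (i t : ℕ), stepFlux (curH Ω δ h) (curV Ω δ h) ![x₀ + t, y₀ + i] ![x₀ + t, y₀ + i + 1] =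
      cur Ω δ h ![x₀ + t, y₀ + i + 1] (![x₀ + t, y₀ + i + 1] + Pi.single 0 1) := by
    intro i t
    have hval : stepFlux (curH Ω δ h) (curV Ω δ h) ![x₀ + t, y₀ + i] ![x₀ + t, y₀ + i + 1] =
        curH Ω δ h (![x₀ + t, y₀ + i] - Pi.single 0 1) := by
      unfold stepFlux; simp
    rw [hval, curH]
    have hv : (Pi.single 0 1 : Site 2) = ![1, 0] := by ext j; fin_cases j <;> simp
    have h1v : (1 : Site 2) = ![1, 1] := by ext j; fin_cases j <;> simp
    rw [hv, h1v]
    congr 1 <;> ext j <;> fin_cases j <;> simp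
  set RS : ℕ → ℝ := fun t => ∑ i ∈ Finset.range (4 * J),
    |stepFlux (curH Ω δ h) (curV Ω δ h) ![x₀ + t, y₀ + i] ![x₀ + t, y₀ + i + 1]| with hRS
  have hCS : ∀ t, RS t ^ 2 ≤ 4 * J * ∑ i ∈ Finset.range (4 * J),
      cur Ω δ h ![x₀ + t, y₀ + i + 1] (![x₀ + t, y₀ + i + 1] + Pi.single 0 1) ^ 2 := by
    intro t
    have := sq_sum_le_card_mul_sum_sq (s := Finset.range (4 * J))
      (f := fun i => |stepFlux (curH Ω δ h) (curV Ω δ h) ![x₀ + t, y₀ + i] ![x₀ + t, y₀ + i + 1]|)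
    simp only [Finset.card_range, sq_abs] at this
    refine this.trans (le_of_eq ?_)
    push_cast
    congr 1
    exact Finset.sum_congr rfl fun i _ => by rw [hsf]
  have htot : ∑ t ∈ Finset.range (J + 1), ∑ i ∈ Finset.range (4 * J),
      cur Ω δ h ![x₀ + t, y₀ + i + 1] (![x₀ + t, y₀ + i + 1] + Pi.single 0 1) ^ 2 ≤ E := by
    rw [← Finset.sum_product']
    refine (sum_cur_sq_le_energy (Finset.range (J + 1) ×ˢ Finset.range (4 * J))
      (fun p : ℕ × ℕ => (![x₀ + p.1, y₀ + p.2 + 1] : Site 2)) ?_ h (Pi.single 0 1) (by simp) hEF).trans hE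
    intro p _ p' _ he
    have h0 := congrFun he 0
    have h1 := congrFun he 1
    simp at h0 h1
    ext <;> omega
  have hsum : ∑ t ∈ Finset.range (J + 1), RS t ^ 2 ≤ 4 * J * E := by
    calc ∑ t ∈ Finset.range (J + 1), RS t ^ 2
        ≤ ∑ t ∈ Finset.range (J + 1), 4 * J * ∑ i ∈ Finset.range (4 * J),
            cur Ω δ h ![x₀ + t, y₀ + i + 1] (![x₀ + t, y₀ + i + 1] + Pi.single 0 1) ^ 2 :=
          Finset.sum_le_sum fun t _ => hCS t
      _ = 4 * J * ∑ t ∈ Finset.range (J + 1), ∑ i ∈ Finset.range (4 * J),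
            cur Ω δ h ![x₀ + t, y₀ + i + 1] (![x₀ + t, y₀ + i + 1] + Pi.single 0 1) ^ 2 := by
          rw [Finset.mul_sum]
      _ ≤ 4 * J * E := by gcongr
  have hE0 : 0 ≤ E := le_trans (Finset.sum_nonneg fun e _ => sqIncr_nonneg h e) hE
  obtain ⟨t, ht, hle⟩ := Finset.exists_le_of_sum_le (s := Finset.range (J + 1)) (f := fun t => RS t ^ 2)
    (g := fun _ => 4 * E) (by simp) (by
      rw [Finset.sum_const, Finset.card_range, nsmul_eq_mul]
      push_cast
      have : (4 : ℝ) * J * E ≤ (J + 1) * (4 * E) := by nlinarith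
      exact hsum.trans this)
  refine ⟨t, by simpa [Nat.lt_succ_iff] using ht, ?_⟩
  have hRS0 : 0 ≤ RS t := Finset.sum_nonneg fun i _ => abs_nonneg _
  have : RS t ≤ Real.sqrt (4 * E) := Real.le_sqrt_of_sq_le hle
  rw [show (4 : ℝ) * E = 2 ^ 2 * E by norm_num, Real.sqrt_mul (by norm_num), Real.sqrt_sq (by norm_num)] at this
  exact this

end GoodLines

section LocalSupBound2

open WeakBeurling

variable {δ : ℝ}

/-- A lattice walk from inside a closed index rectangle to outside it passes through a square on
its boundary. [folklore] -/
theorem exists_mem_support_on_rectBoundary {xl xr yb yt : ℤ} :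
    ∀ {u v : Site 2} (W : (zdGraph 2).Walk u v),
      (xl ≤ u 0 ∧ u 0 ≤ xr ∧ yb ≤ u 1 ∧ u 1 ≤ yt) → ¬ (xl ≤ v 0 ∧ v 0 ≤ xr ∧ yb ≤ v 1 ∧ v 1 ≤ yt) →
      ∃ z ∈ W.support, xl ≤ z 0 ∧ z 0 ≤ xr ∧ yb ≤ z 1 ∧ z 1 ≤ yt ∧ (z 0 = xl ∨ z 0 = xr ∨ z 1 = yb ∨ z 1 = yt) := by
  intro u v W
  induction W with
  | nil => intro hu hv; exact (hv hu).elim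
  | cons hadj W ih =>
    rename_i u w v
    intro hu hv
    by_cases hw : xl ≤ w 0 ∧ w 0 ≤ xr ∧ yb ≤ w 1 ∧ w 1 ≤ yt
    · obtain ⟨z, hz, h⟩ := ih hw hv
      exact ⟨z, by simp [hz], h⟩
    · refine ⟨u, by simp, hu.1, hu.2.1, hu.2.2.1, hu.2.2.2, ?_⟩
      rcases coord_step_of_adj hadj with ⟨e0, e1⟩ | ⟨e0, e1⟩ | ⟨e0, e1⟩ | ⟨e0, e1⟩ <;> omega

/-- Shifted partial sums of a nonnegative sequence are bounded by the full sum. [folklore] -/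
theorem sum_range_shift_le {F : ℕ → ℝ} (hF : ∀ i, 0 ≤ F i) {a sft N : ℕ} (h : a + sft ≤ N) :
    ∑ i ∈ Finset.range a, F (i + sft) ≤ ∑ j ∈ Finset.range N, F j := by
  classical
  have hinj : Set.InjOn (fun i => i + sft) (Finset.range a) := fun i _ j _ hij => by simpa using hij
  rw [← Finset.sum_image hinj]
  refine Finset.sum_le_sum_of_subset_of_nonneg (fun j hj => ?_) fun j _ _ => hF j
  rw [Finset.mem_image] at hj
  obtain ⟨i, hi, rfl⟩ := hj
  rw [Finset.mem_range] at hi ⊢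
  omega

open Classical in
/-- **Local bound for the conjugate** ([GP19] use `0 ≤ h' ≤ I*_n` from the planar dual; here a
local substitute needing no global structure). Let `h ∈ [0,1]` be harmonic for `Ω_n` off
`T ∪ B ⊆ ∂Ω_n` with energy `≤ E`, `h'` its conjugate based at `p₀`, and `q̂` a square, `J ≥ 1`,
such that (i) every exit of the component inside `sqBox q̂ (2J)` has virtual value `c`, and
(ii) some lattice walk of squares outside the component joins `sqBox q̂ (J-1)` to the outside of
`sqBox q̂ (2J)`. Then `|h' - c| ≤ 1 + 8 √E` on the component inside `sqBox q̂ J`. Proof: choose by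
length–area a rectangle between the two boxes whose boundary ring has `Σ |dh'| ≤ 8 √E`; the ring
meets the cutting walk, so along the ring every square of the component is joined within the
component to an exit (`|h' - c| ≤ 1 + 8√E` there); conclude by the maximum principle.
[cite: GeorgakopoulosPanagiotis2019, §3.2 (local form)] -/
theorem abs_dualPot_sub_le_local (R : RandomPlanarGeometry.ConformalRectangle) (h0 : (0 : ℂ) ∈ R.carrier)
    (hδ : 0 < δ) {h : Site 2 → ℝ} {T B : Set (Site 2)} (hT : T ⊆ boundary R.carrier δ) (hB : B ⊆ boundary R.carrier δ)
    (hharm : ∀ x, x ∉ T → x ∉ B →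
      ∑ y ∈ ((zdGraph 2).neighborFinset x).filter (fun y => (domainGraph R.carrier δ).Adj x y), (h y - h x) = 0)
    (h01 : ∀ x, h x ∈ Icc (0 : ℝ) 1) {p₀ : Site 2} (hp₀ : IsInnerSq R.carrier δ p₀) {E : ℝ}
    (hE : ∑ e ∈ (edgeSet_domainGraph_finite R.isBounded hδ).toFinset, sqIncr h e ≤ E)
    {c : ℝ} {qc : Site 2} {J : ℕ} (hJ : 1 ≤ J)
    (hexit : ∀ p, (dualGraph R.carrier δ).Reachable p₀ p → p ∈ sqBox qc (2 * J) → ∀ n, (zdGraph 2).Adj p n →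
      ¬ (dualGraph R.carrier δ).Reachable p₀ n → exitVal R.carrier δ h p₀ p n = c)
    {pc pfar : Site 2} (Wcut : (zdGraph 2).Walk pc pfar) (hpc : pc ∈ sqBox qc (J - 1)) (hpfar : pfar ∉ sqBox qc (2 * J))
    (hWcut : ∀ z ∈ Wcut.support, ¬ (dualGraph R.carrier δ).Reachable p₀ z)
    {p : Site 2} (hp : (dualGraph R.carrier δ).Reachable p₀ p) (hpJ : p ∈ sqBox qc J) :
    |dualPot R.carrier δ h p₀ p - c| ≤ 1 + 8 * Real.sqrt E := by
  have hEF := edgeSet_domainGraph_finite (Ω := R.carrier) R.isBounded hδ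
  have hJ' : (1 : ℤ) ≤ J := by exact_mod_cast hJ
  -- good lines
  obtain ⟨t₁, ht₁, hrow₁⟩ := exists_good_row hEF h hE (qc 0 - 2 * J) (qc 1 + J) hJ
  obtain ⟨t₂, ht₂, hrow₂⟩ := exists_good_row hEF h hE (qc 0 - 2 * J) (qc 1 - 2 * J) hJ
  obtain ⟨t₃, ht₃, hcol₃⟩ := exists_good_col hEF h hE (qc 0 + J) (qc 1 - 2 * J) hJ
  obtain ⟨t₄, ht₄, hcol₄⟩ := exists_good_col hEF h hE (qc 0 - 2 * J) (qc 1 - 2 * J) hJ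
  set yt : ℤ := qc 1 + J + t₁ with hyt
  set yb : ℤ := qc 1 - 2 * J + t₂ with hyb
  set xr : ℤ := qc 0 + J + t₃ with hxr
  set xl : ℤ := qc 0 - 2 * J + t₄ with hxl
  have ht₁' : (t₁ : ℤ) ≤ J := by exact_mod_cast ht₁
  have ht₂' : (t₂ : ℤ) ≤ J := by exact_mod_cast ht₂
  have ht₃' : (t₃ : ℤ) ≤ J := by exact_mod_cast ht₃
  have ht₄' : (t₄ : ℤ) ≤ J := by exact_mod_cast ht₄
  have hx : xl < xr := by omega
  have hy : yb < yt := by omega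
  -- the rectangle lies in `sqBox qc (2J)` and contains `sqBox qc J`
  have hrect_box : ∀ z : Site 2, xl ≤ z 0 → z 0 ≤ xr → yb ≤ z 1 → z 1 ≤ yt → z ∈ sqBox qc (2 * J) := by
    intro z a1 a2 a3 a4
    rw [mem_sqBox, abs_le, abs_le]; omega
  -- the ring sum is at most `8 √E`
  have hsymm : ∀ x y : Site 2, |stepFlux (curH R.carrier δ h) (curV R.carrier δ h) y x| = |stepFlux (curH R.carrier δ h) (curV R.carrier δ h) x y| := by
    intro x y
    by_cases hxy : (zdGraph 2).Adj x y
    · rw [stepFlux_antisymm _ _ (stepKind_of_adj hxy), abs_neg]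
    · have h1 : stepFlux (curH R.carrier δ h) (curV R.carrier δ h) x y = 0 := by
        unfold stepFlux
        have := fun hk : StepKind x y => hxy (adj_of_stepKind hk)
        split_ifs with a1 a2 a3 a4
        · exact (this (.up a1.1 a1.2)).elim
        · exact (this (.down a2.1 a2.2)).elim
        · exact (this (.right a3.1 a3.2)).elim
        · exact (this (.left a4.1 a4.2)).elim
        · rfl
      have h2 : stepFlux (curH R.carrier δ h) (curV R.carrier δ h) y x = 0 := by
        unfold stepFlux
        have := fun hk : StepKind y x => hxy (adj_of_stepKind hk).symm
        split_ifs with a1 a2 a3 a4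
        · exact (this (.up a1.1 a1.2)).elim
        · exact (this (.down a2.1 a2.2)).elim
        · exact (this (.right a3.1 a3.2)).elim
        · exact (this (.left a4.1 a4.2)).elim
        · rfl
      rw [h1, h2]
  have hring_sum : ∑ k ∈ Finset.range (2 * (xr - xl).toNat + 2 * (yt - yb).toNat),
      |stepFlux (curH R.carrier δ h) (curV R.carrier δ h) (rectRing xl xr yb yt k) (rectRing xl xr yb yt (k + 1))| ≤ 8 * Real.sqrt E := by
    rw [sum_rectRing_eq hx hy (w := fun x y => |stepFlux (curH R.carrier δ h) (curV R.carrier δ h) x y|) hsymm]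
    have ha : (xr - xl).toNat + t₄ ≤ 4 * J := by omega
    have hb : (yt - yb).toNat + t₂ ≤ 4 * J := by omega
    -- bottom row `yb = (qc 1 - 2J) + t₂`, abscissae `xl + i = (qc 0 - 2J) + (i + t₄)`
    have e1 : ∑ i ∈ Finset.range (xr - xl).toNat, |stepFlux (curH R.carrier δ h) (curV R.carrier δ h) ![xl + i, yb] ![xl + i + 1, yb]| ≤ 2 * Real.sqrt E := by
      refine le_trans (le_of_eq ?_) ((sum_range_shift_le (fun i => abs_nonneg _) ha).trans hrow₂)
      refine Finset.sum_congr rfl fun i _ => ?_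
      congr 2 <;> ext j <;> fin_cases j <;> simp [hxl, hyb] <;> ring
    have e3 : ∑ i ∈ Finset.range (xr - xl).toNat, |stepFlux (curH R.carrier δ h) (curV R.carrier δ h) ![xl + i, yt] ![xl + i + 1, yt]| ≤ 2 * Real.sqrt E := by
      refine le_trans (le_of_eq ?_) ((sum_range_shift_le (fun i => abs_nonneg _) ha).trans hrow₁)
      refine Finset.sum_congr rfl fun i _ => ?_
      congr 2 <;> ext j <;> fin_cases j <;> simp [hxl, hyt] <;> ring
    -- right column `xr = (qc 0 + J) + t₃`, ordinates `yb + i = (qc 1 - 2J) + (i + t₂)`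
    have e2 : ∑ i ∈ Finset.range (yt - yb).toNat, |stepFlux (curH R.carrier δ h) (curV R.carrier δ h) ![xr, yb + i] ![xr, yb + i + 1]| ≤ 2 * Real.sqrt E := by
      refine le_trans (le_of_eq ?_) ((sum_range_shift_le (fun i => abs_nonneg _) hb).trans hcol₃)
      refine Finset.sum_congr rfl fun i _ => ?_
      congr 2 <;> ext j <;> fin_cases j <;> simp [hxr, hyb] <;> ring
    have e4 : ∑ i ∈ Finset.range (yt - yb).toNat, |stepFlux (curH R.carrier δ h) (curV R.carrier δ h) ![xl, yb + i] ![xl, yb + i + 1]| ≤ 2 * Real.sqrt E := by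
      refine le_trans (le_of_eq ?_) ((sum_range_shift_le (fun i => abs_nonneg _) hb).trans hcol₄)
      refine Finset.sum_congr rfl fun i _ => ?_
      congr 2 <;> ext j <;> fin_cases j <;> simp [hxl, hyb] <;> ring
    linarith
  -- a square of the ring outside the component
  have hout : ∃ k₁, ¬ (dualGraph R.carrier δ).Reachable p₀ (rectRing xl xr yb yt k₁) := by
    have hpc' : xl ≤ pc 0 ∧ pc 0 ≤ xr ∧ yb ≤ pc 1 ∧ pc 1 ≤ yt := by
      rw [mem_sqBox, abs_le, abs_le] at hpc; omega
    have hpfar' : ¬ (xl ≤ pfar 0 ∧ pfar 0 ≤ xr ∧ yb ≤ pfar 1 ∧ pfar 1 ≤ yt) := fun hh =>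
      hpfar (hrect_box pfar hh.1 hh.2.1 hh.2.2.1 hh.2.2.2)
    obtain ⟨z, hz, a1, a2, a3, a4, hb⟩ := exists_mem_support_on_rectBoundary Wcut hpc' hpfar'
    obtain ⟨k₁, -, hk₁⟩ := exists_rectRing_eq hx hy a1 a2 a3 a4 hb
    exact ⟨k₁, by rw [hk₁]; exact hWcut z hz⟩
  obtain ⟨k₁, hk₁⟩ := hout
  -- bound on the ring
  have hring : ∀ q, (dualGraph R.carrier δ).Reachable p₀ q → xl ≤ q 0 → q 0 ≤ xr → yb ≤ q 1 → q 1 ≤ yt →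
      (q 0 = xl ∨ q 0 = xr ∨ q 1 = yb ∨ q 1 = yt) → |dualPot R.carrier δ h p₀ q - c| ≤ 1 + 8 * Real.sqrt E := by
    intro q hq a1 a2 a3 a4 hb
    obtain ⟨k₀, -, rfl⟩ := exists_rectRing_eq hx hy a1 a2 a3 a4 hb
    refine (abs_dualPot_sub_le_of_ring R h0 hδ hT hB hharm h01 hp₀ hx hy (fun k hk hk' => ?_) hk₁ hq).trans
      (by linarith [hring_sum])
    obtain ⟨b1, b2, b3, b4, -⟩ := rectRing_mem hx hy k
    exact hexit _ hk (hrect_box _ b1 b2 b3 b4) _ (rectRing_adj hx hy k) hk'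
  -- the maximum principle
  have hFfin : {q : Site 2 | (dualGraph R.carrier δ).Reachable p₀ q}.Finite := by
    obtain ⟨r₀, hr₀⟩ := (isBounded_iff_subset_closedBall (0 : ℂ)).1 R.isBounded
    refine (sqBox_finite 0 ⌈r₀ / δ⌉).subset fun q hq => ?_
    obtain ⟨W⟩ := hq
    exact mem_sqBox_of_isInnerSq h0 hr₀ hδ (isInnerSq_of_mem_support' hp₀ W (Walk.end_mem_support _))
  have hpbox : xl ≤ p 0 ∧ p 0 ≤ xr ∧ yb ≤ p 1 ∧ p 1 ≤ yt := by
    rw [mem_sqBox, abs_le, abs_le] at hpJ; omega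
  refine abs_le_of_meanValue_rect hFfin (g := fun q => dualPot R.carrier δ h p₀ q - c)
    (V := fun q n => if (dualGraph R.carrier δ).Reachable p₀ n then dualPot R.carrier δ h p₀ n - c
      else exitVal R.carrier δ h p₀ q n - c)
    (M := 1 + 8 * Real.sqrt E) (xl := xl) (xr := xr) (yb := yb) (yt := yt) ?_ ?_ ?_ ?_ p hp hpbox.1 hpbox.2.1
    hpbox.2.2.1 hpbox.2.2.2
  · -- mean value: the four CR-increments around an inner square sum to zero
    intro q hq a1 a2 a3 a4
    have hqI : IsInnerSq R.carrier δ q := by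
      obtain ⟨W⟩ := hq; exact isInnerSq_of_mem_support' hp₀ W (Walk.end_mem_support _)
    have hterm : ∀ k : Fin 4, ((if (dualGraph R.carrier δ).Reachable p₀ (q + cornerUnit k)
        then dualPot R.carrier δ h p₀ (q + cornerUnit k) - c else exitVal R.carrier δ h p₀ q (q + cornerUnit k) - c) -
        (dualPot R.carrier δ h p₀ q - c)) = stepFlux (curH R.carrier δ h) (curV R.carrier δ h) q (q + cornerUnit k) := by
      intro k
      split_ifs with hr
      · have hadj : (dualGraph R.carrier δ).Adj q (q + cornerUnit k) := by
          refine dualGraph_adj_iff.2 ⟨adj_of_stepKind (stepKind_add_cornerUnit q k), hqI, ?_⟩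
          obtain ⟨W⟩ := hr; exact isInnerSq_of_mem_support' hp₀ W (Walk.end_mem_support _)
        rw [← dualPot_sub_dualPot_of_adj R h0 hδ hT hB hharm hp₀ hq hadj]
        ring
      · rw [exitVal]; ring
    rw [Finset.sum_congr rfl fun k _ => hterm k, Fin.sum_univ_four]
    have := sum_stepFlux_eq_zero_of_isInnerSq (h := h) hqI
    simp only [cornerUnit] at this ⊢
    rw [show q + -Pi.single (0 : Fin 2) (1 : ℤ) = q - Pi.single 0 1 by abel,
      show q + -Pi.single (1 : Fin 2) (1 : ℤ) = q - Pi.single 1 1 by abel]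
    linarith
  · intro q _ k hk
    simp only [Set.mem_setOf_eq] at hk
    rw [if_pos hk]
  · intro q hq a1 a2 a3 a4 k hk
    simp only [Set.mem_setOf_eq] at hk hq
    rw [if_neg hk, hexit q hq (hrect_box q a1.le a2.le a3.le a4.le) _ (adj_of_stepKind (stepKind_add_cornerUnit q k)) hk,
      sub_self, abs_zero]
    positivity
  · intro q hq a1 a2 a3 a4 hb
    exact hring q hq a1 a2 a3 a4 hb

end LocalSupBound2

/-! ### §D7. The weak Beurling estimate for the conjugate near the exits -/

section DualBeurling

open WeakBeurling

variable {δ : ℝ}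

open Classical in
/-- **Weak Beurling for the conjugate** (the dual counterpart of `exists_forall_one_sub_le` of
`SquareTilingModulusProofs.lean`, replacing the Brownian motion of [GP19], Lemma 4.8 on the
dual graph). With the hypotheses of `abs_dualPot_sub_le_local` on the box `sqBox qc (2(R+3))`
about a square `qc` next to the square `p` from which the cutting walk starts: on the component,
`|h' - c| ≤ (1 + 8√E) · C_B · ((ρ+1)/(R+1))^β` at the squares of `sqBox p ρ ∩ sqBox p R`. Proof:
the site function `(h' - c)/(1 + 8√E)` on the component (and `0` elsewhere) is lattice harmonic
on `S = component ∩ sqBox p R` (CR around each inner square, exits having value `c`), bounded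
by `1` on `∂S` (local bound) and `0` on `∂S ∩ sqBox p R` (exits), and the cutting walk avoids
`S`; apply `weakBeurling_of_cutPath` to it and to its negative. [cite: GeorgakopoulosPanagiotis2019, Lemma 4.8 (dual, discrete form)] -/
theorem abs_dualPot_sub_le_beurling (R : RandomPlanarGeometry.ConformalRectangle) (h0 : (0 : ℂ) ∈ R.carrier)
    (hδ : 0 < δ) {h : Site 2 → ℝ} {T B : Set (Site 2)} (hT : T ⊆ boundary R.carrier δ) (hB : B ⊆ boundary R.carrier δ)
    (hharm : ∀ x, x ∉ T → x ∉ B →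
      ∑ y ∈ ((zdGraph 2).neighborFinset x).filter (fun y => (domainGraph R.carrier δ).Adj x y), (h y - h x) = 0)
    (h01 : ∀ x, h x ∈ Icc (0 : ℝ) 1) {p₀ : Site 2} (hp₀ : IsInnerSq R.carrier δ p₀) {E : ℝ}
    (hE : ∑ e ∈ (edgeSet_domainGraph_finite R.isBounded hδ).toFinset, sqIncr h e ≤ E)
    {c : ℝ} {qc p : Site 2} {Rb : ℕ} (hRb : 1 ≤ Rb) (hpqc : p ∈ sqBox qc 1)
    (hexit : ∀ p', (dualGraph R.carrier δ).Reachable p₀ p' → p' ∈ sqBox qc (2 * (Rb + 3)) → ∀ n, (zdGraph 2).Adj p' n →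
      ¬ (dualGraph R.carrier δ).Reachable p₀ n → exitVal R.carrier δ h p₀ p' n = c)
    {d : Site 2} (Wcut : (zdGraph 2).Walk p d) (hd : d ∉ sqBox qc (2 * (Rb + 3)))
    (hWcut : ∀ z ∈ Wcut.support, ¬ (dualGraph R.carrier δ).Reachable p₀ z)
    {ρ : ℕ} {z : Site 2} (hz : (dualGraph R.carrier δ).Reachable p₀ z) (hzρ : z ∈ sqBox p ρ) (hzR : z ∈ sqBox p Rb) :
    |dualPot R.carrier δ h p₀ z - c| ≤
      (1 + 8 * Real.sqrt E) * beurlingConst * (((ρ : ℝ) + 1) / ((Rb : ℝ) + 1)) ^ beurlingExp := by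
  set M : ℝ := 1 + 8 * Real.sqrt E with hM
  have hM0 : 0 < M := by rw [hM]; positivity
  set Fc : Set (Site 2) := {q | (dualGraph R.carrier δ).Reachable p₀ q} with hFc
  set g : Site 2 → ℝ := fun q => if (dualGraph R.carrier δ).Reachable p₀ q then (dualPot R.carrier δ h p₀ q - c) / M else 0
    with hg
  set S : Set (Site 2) := {q | (dualGraph R.carrier δ).Reachable p₀ q ∧ q ∈ sqBox p Rb} with hS
  -- boxes
  have hpqc' := hpqc
  rw [mem_sqBox, abs_le, abs_le] at hpqc'
  have hbox1 : ∀ w : Site 2, w ∈ sqBox p (Rb + 1) → w ∈ sqBox qc (Rb + 3) := by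
    intro w hw
    rw [mem_sqBox, abs_le, abs_le] at hw ⊢; omega
  have hbox2 : ∀ w : Site 2, w ∈ sqBox qc (Rb + 3) → w ∈ sqBox qc (2 * (Rb + 3)) := fun w hw =>
    sqBox_mono qc (by omega) hw
  -- the local bound on `sqBox qc (Rb + 3)`
  have hloc : ∀ w, (dualGraph R.carrier δ).Reachable p₀ w → w ∈ sqBox qc (Rb + 3) →
      |dualPot R.carrier δ h p₀ w - c| ≤ M := by
    intro w hw hwb
    have hJ : 1 ≤ Rb + 3 := by omega
    refine abs_dualPot_sub_le_local R h0 hδ hT hB hharm h01 hp₀ hE (qc := qc) (J := Rb + 3) hJ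
      (fun p' hp' hb n hn hn' => hexit p' hp' (by simpa using hb) n hn hn') Wcut
      (sqBox_mono qc (by omega) hpqc) (by simpa using hd) hWcut hw (by simpa using hwb)
  -- `S` is finite
  have hSfin : S.Finite := (sqBox_finite p Rb).subset fun q hq => hq.2
  -- `g` is lattice harmonic on `S`
  have hgharm : IsLatticeHarmonicOn g S := by
    intro q hq
    obtain ⟨hqF, hqb⟩ := hq
    have hqI : IsInnerSq R.carrier δ q := by
      obtain ⟨W⟩ := hqF; exact isInnerSq_of_mem_support' hp₀ W (Walk.end_mem_support _)
    rw [latticeLaplacian]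
    have hterm : ∀ k : Fin 4, g (q + cornerUnit k) - g q =
        stepFlux (curH R.carrier δ h) (curV R.carrier δ h) q (q + cornerUnit k) / M := by
      intro k
      simp only [hg, if_pos hqF]
      split_ifs with hr
      · have hadj : (dualGraph R.carrier δ).Adj q (q + cornerUnit k) := by
          refine dualGraph_adj_iff.2 ⟨adj_of_stepKind (stepKind_add_cornerUnit q k), hqI, ?_⟩
          obtain ⟨W⟩ := hr; exact isInnerSq_of_mem_support' hp₀ W (Walk.end_mem_support _)
        rw [← dualPot_sub_dualPot_of_adj R h0 hδ hT hB hharm hp₀ hqF hadj]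
        ring
      · have hqbox : q ∈ sqBox qc (2 * (Rb + 3)) :=
          hbox2 q (hbox1 q (sqBox_mono p (by omega) hqb))
        have := hexit q hqF hqbox _ (adj_of_stepKind (stepKind_add_cornerUnit q k)) hr
        rw [exitVal] at this
        field_simp
        linarith
    rw [Finset.sum_congr rfl fun k _ => hterm k, ← Finset.sum_div, Fin.sum_univ_four]
    have := sum_stepFlux_eq_zero_of_isInnerSq (h := h) hqI
    simp only [cornerUnit] at this ⊢
    rw [show q + -Pi.single (0 : Fin 2) (1 : ℤ) = q - Pi.single 0 1 by abel,
      show q + -Pi.single (1 : Fin 2) (1 : ℤ) = q - Pi.single 1 1 by abel,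
      show stepFlux (curH R.carrier δ h) (curV R.carrier δ h) q (q + Pi.single 0 1) +
        stepFlux (curH R.carrier δ h) (curV R.carrier δ h) q (q + Pi.single 1 1) +
        stepFlux (curH R.carrier δ h) (curV R.carrier δ h) q (q - Pi.single 0 1) +
        stepFlux (curH R.carrier δ h) (curV R.carrier δ h) q (q - Pi.single 1 1) = 0 by linarith, zero_div]
  -- bounds on the outer boundary
  have h1 : ∀ w ∈ latticeOuterBoundary S, |g w| ≤ 1 := by
    intro w hw
    obtain ⟨hwS, v, hvS, hadj⟩ := mem_latticeOuterBoundary_iff.1 hw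
    simp only [hg]
    split_ifs with hr
    · -- a member of the component just outside the box `sqBox p Rb`: within `sqBox p (Rb+1)`
      have hvb : w ∈ sqBox p (Rb + 1) := mem_sqBox_succ_of_adj hvS.2 hadj
      have := hloc _ hr (hbox1 _ hvb)
      rw [abs_div, abs_of_pos hM0, div_le_one hM0]
      exact this
    · simp
  have h0' : ∀ w ∈ latticeOuterBoundary S, w ∈ sqBox p Rb → g w = 0 := by
    intro w hw hwb
    obtain ⟨hwS, v, hvS, hadj⟩ := mem_latticeOuterBoundary_iff.1 hw
    simp only [hg]
    rw [if_neg]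
    intro hr
    exact hwS ⟨hr, hwb⟩
  -- the cut
  have hcut : ∀ w ∈ Wcut.support, w ∉ S := fun w hw hwS => hWcut w hw hwS.1
  have hdR : d ∉ sqBox p Rb := fun hdb => hd (hbox2 d (hbox1 d (sqBox_mono p (by omega) hdb)))
  have hzS : z ∈ S := ⟨hz, hzR⟩
  -- Beurling for `g` and `-g`
  have hB1 := weakBeurling_of_cutPath hSfin hgharm (fun w hw => (le_abs_self _).trans (h1 w hw)) h0' Wcut hdR hcut hzS hzρ
  have hgneg : IsLatticeHarmonicOn (fun q => -g q) S := fun q hq => by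
    have := hgharm q hq
    rw [latticeLaplacian] at this ⊢
    rw [← neg_eq_zero, ← this, ← Finset.sum_neg_distrib]
    exact Finset.sum_congr rfl fun k _ => by ring
  have hB2 := weakBeurling_of_cutPath hSfin hgneg (fun w hw => (neg_le_abs _).trans (h1 w hw))
    (fun w hw hwb => by simp [h0' w hw hwb]) Wcut hdR hcut hzS hzρ
  have hgz : g z = (dualPot R.carrier δ h p₀ z - c) / M := by simp only [hg, if_pos hz]
  rw [hgz] at hB1 hB2
  have habs : |(dualPot R.carrier δ h p₀ z - c) / M| ≤ beurlingConst * (((ρ : ℝ) + 1) / ((Rb : ℝ) + 1)) ^ beurlingExp := by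
    rw [abs_le]; constructor <;> linarith
  rw [abs_div, abs_of_pos hM0, div_le_iff₀ hM0] at habs
  linarith

end DualBeurling

section DualBeurlingGeometric

open WeakBeurling

variable {δ : ℝ}

/-- Points of a square with index in `sqBox qc k` are within `2(k+1)δ` of any point of the square
`qc`. [folklore] -/
theorem dist_le_of_mem_sqBox (hδ : 0 ≤ δ) {qc n : Site 2} {k : ℤ} (hn : n ∈ sqBox qc k) {w q : ℂ}
    (hw : w ∈ closedSq δ n) (hq : q ∈ closedSq δ qc) : dist w q ≤ 2 * (k + 1) * δ := by
  rw [mem_sqBox, abs_le, abs_le] at hn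
  obtain ⟨a1, a2⟩ := hn
  obtain ⟨h0, h0', h1, h1'⟩ := hw
  obtain ⟨g0, g0', g1, g1'⟩ := hq
  have hk0 : (n 0 : ℝ) - qc 0 ≤ k ∧ (qc 0 : ℝ) - n 0 ≤ k := by constructor <;> exact_mod_cast (by omega)
  have hk1 : (n 1 : ℝ) - qc 1 ≤ k ∧ (qc 1 : ℝ) - n 1 ≤ k := by constructor <;> exact_mod_cast (by omega)
  rw [Complex.dist_eq]
  refine (Complex.norm_le_abs_re_add_abs_im _).trans ?_
  simp only [Complex.sub_re, Complex.sub_im]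
  have e1 : |w.re - q.re| ≤ (k + 1) * δ := by
    rw [abs_le]; constructor <;> nlinarith
  have e2 : |w.im - q.im| ≤ (k + 1) * δ := by
    rw [abs_le]; constructor <;> nlinarith
  linarith

open Classical in
/-- **The conjugate near a boundary point far from `T ∪ B` is nearly constant at the exits**
(geometric form of `abs_dualPot_sub_le_beurling`). Let `q = boundary s₀`, `ε > 0` with all
vertices of `T ∪ B` at distance `≥ ε + 3δ` from `q`, `ρ ≤ ε` a radius for
`JordanDomain.exists_joinedIn_exterior_diff_closedBall`, and `r_arc` a radius for
`exists_short_boundary_arc` with target `ρ - 6δ`; let `e` be an exterior point within `δ/2` of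
`q`, `p` its square, `qc` the square of `q`, and `Rb ≥ 1` with `2(2 Rb + 10) δ < r_arc`. Then for
every exit `(p₁, n₁)` of the component of `p₀` in `sqBox qc (2(Rb+3))` and every square `z` of
the component in `sqBox p ρ' ∩ sqBox p Rb`,
`|h'(z) - E(p₁, n₁)| ≤ (1 + 8 √E) · C_B · ((ρ'+1)/(Rb+1))^β`. [cite: GeorgakopoulosPanagiotis2019, Lemma 4.8 (dual, discrete form)] -/
theorem abs_dualPot_sub_exitVal_le (R : RandomPlanarGeometry.ConformalRectangle) (h0 : (0 : ℂ) ∈ R.carrier)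
    (hδ : 0 < δ) {h : Site 2 → ℝ} {T B : Set (Site 2)} (hT : T ⊆ boundary R.carrier δ) (hB : B ⊆ boundary R.carrier δ)
    (hharm : ∀ x, x ∉ T → x ∉ B →
      ∑ y ∈ ((zdGraph 2).neighborFinset x).filter (fun y => (domainGraph R.carrier δ).Adj x y), (h y - h x) = 0)
    (h01 : ∀ x, h x ∈ Icc (0 : ℝ) 1) {p₀ : Site 2} (hp₀ : IsInnerSq R.carrier δ p₀) {E : ℝ}
    (hE : ∑ e ∈ (edgeSet_domainGraph_finite R.isBounded hδ).toFinset, sqIncr h e ≤ E)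
    {s₀ ε ρ rarc : ℝ} (hε : 0 < ε) (hρε : ρ ≤ ε)
    (hρ : ∀ e y : ℂ, e ∈ (closure R.carrier)ᶜ → y ∈ (closure R.carrier)ᶜ →
      ε ≤ dist e (R.boundary s₀) → ε ≤ dist y (R.boundary s₀) →
      JoinedIn ((closure R.carrier)ᶜ \ closedBall (R.boundary s₀) ρ) e y)
    (harc : ∀ j j' : ℂ, j ∈ frontier R.carrier → j' ∈ frontier R.carrier →
      dist j (R.boundary s₀) < rarc → dist j' (R.boundary s₀) < rarc →
      ∃ a a' : ℝ, a ≤ a' ∧ ((R.boundary a = j ∧ R.boundary a' = j') ∨ (R.boundary a = j' ∧ R.boundary a' = j)) ∧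
        ∀ t ∈ Icc a a', dist (R.boundary t) (R.boundary s₀) < ρ - 6 * δ)
    (hfar : ∀ x ∈ T ∪ B, ε + 3 * δ ≤ dist (meshPoint δ x) (R.boundary s₀))
    {Rb : ℕ} (hRb : 1 ≤ Rb) (hbox : 2 * (2 * Rb + 10) * δ < rarc)
    {e : ℂ} (he : e ∈ (closure R.carrier)ᶜ) (heq : dist e (R.boundary s₀) < δ / 2)
    {p₁ n₁ : Site 2} (hp₁ : (dualGraph R.carrier δ).Reachable p₀ p₁) (hp₁b : p₁ ∈ sqBox (floorSq δ (R.boundary s₀)) (2 * (Rb + 3)))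
    (hn₁ : (zdGraph 2).Adj p₁ n₁) (hn₁' : ¬ (dualGraph R.carrier δ).Reachable p₀ n₁)
    {ρ' : ℕ} {z : Site 2} (hz : (dualGraph R.carrier δ).Reachable p₀ z) (hzρ : z ∈ sqBox (floorSq δ e) ρ')
    (hzR : z ∈ sqBox (floorSq δ e) Rb) :
    |dualPot R.carrier δ h p₀ z - exitVal R.carrier δ h p₀ p₁ n₁| ≤
      (1 + 8 * Real.sqrt E) * beurlingConst * (((ρ' : ℝ) + 1) / ((Rb : ℝ) + 1)) ^ beurlingExp := by
  set q := R.boundary s₀ with hq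
  set qc := floorSq δ q with hqc
  set p := floorSq δ e with hp
  have hqqc : q ∈ closedSq δ qc := mem_closedSq_floorSq hδ q
  -- `p ∈ sqBox qc 1`
  have hpqc : p ∈ sqBox qc 1 := by
    rw [mem_sqBox]
    exact ⟨abs_floorSq_sub_le hδ (by linarith [heq] : dist e q < δ) 0,
      abs_floorSq_sub_le hδ (by linarith [heq] : dist e q < δ) 1⟩
  -- outer squares of exits in the big box contain boundary points within `rarc` of `q`
  have hJpt : ∀ p' n : Site 2, (dualGraph R.carrier δ).Reachable p₀ p' → p' ∈ sqBox qc (2 * (Rb + 3)) →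
      (zdGraph 2).Adj p' n → ¬ (dualGraph R.carrier δ).Reachable p₀ n →
      ∃ j ∈ closedSq δ n, j ∈ frontier R.carrier ∧ dist j q < rarc := by
    intro p' n hp' hb hadj hnr
    have hp'I : IsInnerSq R.carrier δ p' := by
      obtain ⟨W⟩ := hp'; exact isInnerSq_of_mem_support' hp₀ W (Walk.end_mem_support _)
    have hnI : ¬ IsInnerSq R.carrier δ n := fun hnI =>
      hnr (hp'.trans (dualGraph_adj_iff.2 ⟨hadj, hp'I, hnI⟩).reachable)
    obtain ⟨j, hj, hjf⟩ := exists_mem_frontier_of_adj_not_isInnerSq R hδ hp'I hadj hnI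
    refine ⟨j, hj, hjf, ?_⟩
    have hnb : n ∈ sqBox qc (2 * (Rb + 3) + 1) := mem_sqBox_succ_of_adj hb hadj
    have := dist_le_of_mem_sqBox hδ.le hnb hj hqqc
    push_cast at this
    nlinarith
  -- all exits in the big box have the value `c = E(p₁, n₁)`
  obtain ⟨j₁, hj₁, hj₁f, hj₁q⟩ := hJpt p₁ n₁ hp₁ hp₁b hn₁ hn₁'
  have hexit : ∀ p', (dualGraph R.carrier δ).Reachable p₀ p' → p' ∈ sqBox qc (2 * (Rb + 3)) → ∀ n, (zdGraph 2).Adj p' n →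
      ¬ (dualGraph R.carrier δ).Reachable p₀ n → exitVal R.carrier δ h p₀ p' n = exitVal R.carrier δ h p₀ p₁ n₁ := by
    intro p' hp' hb n hadj hnr
    obtain ⟨j, hj, hjf, hjq⟩ := hJpt p' n hp' hb hadj hnr
    obtain ⟨a, a', haa', hends, harc'⟩ := harc j j₁ hjf hj₁f hjq hj₁q
    rcases hends with ⟨ha, ha'⟩ | ⟨ha, ha'⟩
    · exact exitVal_eq_exitVal R h0 hδ hT hB hharm hp₀ hε hρε hρ hfar hp' hadj hp₁ hn₁ haa'
        (by rw [ha]; exact hj) (by rw [ha']; exact hj₁) harc'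
    · exact (exitVal_eq_exitVal R h0 hδ hT hB hharm hp₀ hε hρε hρ hfar hp₁ hn₁ hp' hadj haa'
        (by rw [ha]; exact hj₁) (by rw [ha']; exact hj) harc').symm
  -- the cutting walk: an exterior path from `e` to a far point, shadowed by squares outside the component
  obtain ⟨r₀, hr₀⟩ := (isBounded_iff_subset_closedBall (0 : ℂ)).1 R.isBounded
  have hr₀nn : 0 ≤ r₀ := by simpa using hr₀ h0
  have hqr : ‖q‖ ≤ r₀ := by
    have : q ∈ closedBall (0 : ℂ) r₀ :=
      closure_minimal hr₀ isClosed_closedBall (frontier_subset_closure (R.boundary_mem_frontier s₀))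
    simpa using this
  set X : ℝ := 2 * r₀ + 2 + δ * (6 * Rb + 20) with hX
  have hX0 : 0 < X := by rw [hX]; positivity
  have hfarX : (X : ℂ) ∈ (closure R.carrier)ᶜ := by
    intro hmem
    have : (X : ℂ) ∈ closedBall (0 : ℂ) r₀ := closure_minimal hr₀ isClosed_closedBall hmem
    have h1 : ‖(X : ℂ)‖ ≤ r₀ := by simpa using this
    rw [Complex.norm_real, Real.norm_eq_abs, abs_of_pos hX0] at h1
    rw [hX] at h1; nlinarith
  have hpath : JoinedIn (closure R.carrier)ᶜ e (X : ℂ) :=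
    ((R.isOpen_exterior.isConnected_iff_isPathConnected).1 R.isConnected_exterior).joinedIn e he _ hfarX
  have hγc : ContinuousOn (fun t : ℝ => hpath.somePath.extend t) (Icc 0 1) :=
    hpath.somePath.continuous_extend.continuousOn
  have hγE : ∀ t ∈ Icc (0 : ℝ) 1, hpath.somePath.extend t ∈ (closure R.carrier)ᶜ := fun t ht => by
    rw [Path.extend_extends' hpath.somePath ⟨t, ht⟩]
    exact hpath.somePath_mem _
  obtain ⟨Wcut, -, hWs⟩ := exists_dualWalk_of_path hδ zero_le_one hγc (P := p) (P' := floorSq δ (X : ℂ))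
    (by simpa [hp] using mem_closedSq_floorSq hδ e) (by simpa using mem_closedSq_floorSq hδ (X : ℂ))
  have hWcut : ∀ w ∈ Wcut.support, ¬ (dualGraph R.carrier δ).Reachable p₀ w := by
    intro w hw hwr
    obtain ⟨t, ht, hγt⟩ := hWs w hw
    have hwI : IsInnerSq R.carrier δ w := by
      obtain ⟨W⟩ := hwr; exact isInnerSq_of_mem_support' hp₀ W (Walk.end_mem_support _)
    exact not_isInnerSq_of_mem_closedSq R hδ hγt (fun h' => hγE t ht (subset_closure h')) hwI
  have hd : floorSq δ (X : ℂ) ∉ sqBox qc (2 * (Rb + 3)) := by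
    intro hdb
    have := dist_le_of_mem_sqBox hδ.le hdb (mem_closedSq_floorSq hδ (X : ℂ)) hqqc
    have h1 : ‖(X : ℂ)‖ - ‖q‖ ≤ dist (X : ℂ) q := by
      rw [dist_eq_norm]; exact norm_sub_norm_le _ _
    rw [Complex.norm_real, Real.norm_eq_abs, abs_of_pos hX0] at h1
    push_cast at this
    have h2 : X - ‖q‖ ≤ 2 * (2 * (Rb + 3) + 1) * δ := h1.trans this
    rw [hX] at h2
    nlinarith
  exact abs_dualPot_sub_le_beurling R h0 hδ hT hB hharm h01 hp₀ hE hRb hpqc hexit Wcut hd hWcut hz hzρ hzR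

end DualBeurlingGeometric

end SquareTiling

end Literature.Probability.LatticeModels
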